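import Mathlib
import Summits.ValiantsHypothesis.ValiantsHypothesis.Theses.LacunarySymmetroid
import Literature.Algebra.Polynomial.LacunaryBivariateOnLine
import Summits.ValiantsHypothesis.ValiantsHypothesis.Theorems.DoorA26.Negative.EG15PoincareSmallExponent
import Summits.ValiantsHypothesis.ValiantsHypothesis.Theorems.DoorA26.Negative.EG15CanonicalTwoAtSc

/-!
# wall_bubbling — the END DOOR `EG15(δ*)` and the ROLLE-WINDOW certificate programme — STATEMENT FILE (defs + logical splits)

**rev 3 (line lead val-idea-15 g5, lens=finite, 2026-08-29; rev 1 ≈03Z; rev 2 ≈03:45Z adds the rank-one END form `eg8Poly` and the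
OPEN sharp law `EG8Chart`; rev 3 ≈04:15Z adds the EG9 objects `eg9Gamma`, `EG9CritLaw`, `EG9SixLaw`, `EG9Bookkeeping` — all at the end of the file).**  Companion of `Lines/wall_bubbling.lean`
(skeleton; stub (M) = `Stmt.stub_mixedWalls`), `Lines/wall_bubbling_ConfluentDoor.lean` (the (W) ledger) and memo
`Lines/wall_bubbling_M-sieve.md` §7.9 / §7.12.  It TYPES, and proves nothing about, the objects of memo §7.12:

* `endPoly k e S` = `det (−w wᵀ + Σ_a X^{e a} • S a)`, `w = (1, X^k)` — the far-scale leading form of a lacunary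
  symmetric 2×2 pencil at an END configuration whose near letters degenerate to a null frame with a cancelling pair
  (memo §7.9); `EndDoorAt k e B` = «every such form with symmetric letters has ≤ B positive zeros COUNTED WITH
  MULTIPLICITY»; **`EG15 := EndDoorAt 3 ![14, 30, 48] 13`** is the door of the END-giant mirror class
  {hc1706_2604, hc0953_0954} of the (M) residual at the facet δ* = (0, 1/16, 1/8, 7/24, 5/8, 1) (integer form
  e = 48·δ* = (0,3,6,14,30,48); far letters at 14, 30, 48; support `V15` = {14,…,96}, 15 monomials, Descartes 14).
  The REDUCTION «END survivors of that class accumulate ⇒ ¬ EG15» (a ConfluentLimit/ConfluentFrame-type blow-up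
  statement in W1/W2's currency) is NOT typed here; until it is, `EG15` bites on nothing in the kernel.
* `WindowHolds f vm v vp others` = the ROLLE-WINDOW inequality of memo §7.12 (b) at a consecutive exponent triple;
  `RolleWindowLemma` = LEMMA RW in general form (natural exponents; elementary: iterated `(X^{−u}·)′` + Rolle with
  multiplicity + the trinomial two-zero criterion; UNPROVED here); `RW15` = its specialisation to `V15`, with
  `rw15_of_rolleWindowLemma`.
* `RW15Empty` = the FINITE CERTIFICATE TARGET: no symmetric triple `S` with full support `V15` satisfies all 13
  windows (a semialgebraic emptiness statement in 9 real letter entries; decidable in principle; intended to be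
  closed by an outward-rounded branch-and-bound or an explicit AM–GM dual chain — kit-class, not run).
  `EG15Degenerate` = the complement (a vanishing coefficient ⇒ ≤ 14 monomials ⇒ ≤ 13 zeros with multiplicity:
  Descartes' ceiling, folklore, to be linked to the tree's Descartes files).  Kernel-checked split:
  **`eg15_of : RW15 → RW15Empty → EG15Degenerate → EG15`**.
* `InertiaConfinementND` / `FrameDeterminantLemma` = the two pointwise linear-algebra facts behind memo §7.12's
  inertia bookkeeping (a negative-definite `Q` minus a rank-one square has positive determinant, so `endPoly` has no
  zero where `Σ y^{e_a} S_a` is negative definite; `det (Q − w wᵀ) = det Q · (1 − wᵀ Q⁻¹ w)` for invertible `Q`) —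
  routine for a prover, stated as `Prop`s so that nothing here is asserted.

CALIBRATION OF RECORD for the window inequalities (memo §7.12 (b)): the kernel's Descartes-sharp (2,5) witness
`Theorems/LacunarySymmetroidMatrixDescartesCensusM2K5T14.lean` satisfies all 13 windows of its support with minimum
slack +0.016 (log-units).  HONEST STATUS: every `def … : Prop` below is OPEN unless a `theorem` in this file derives it
from others; `EG15`, `RolleWindowLemma`, `RW15Empty`, `EG15Degenerate`, (M), (W), (R), `DoorA26` (19979) and 18050 are
OPEN; no count of record is claimed; VP ≠ VNP is not moved by anything here.
-/

-- `Summit.ValiantsHypothesis.ValiantsHypothesis.…` repeats a component by the D-0017 layout; the name is mandated.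
set_option linter.dupNamespace false

namespace Summit.ValiantsHypothesis.ValiantsHypothesis.Cruxes.DoorA26.WallBubbling.EndDoor

open Polynomial

/-- Number of POSITIVE roots of a real polynomial, COUNTED WITH MULTIPLICITY (`Polynomial.roots` is a multiset;
the zero polynomial has no roots by Mathlib's convention). -/
noncomputable def posRootCard (f : ℝ[X]) : ℕ := (f.roots.filter (fun t => 0 < t)).card

/-- The null frame `w wᵀ`, `w = (1, X^k)`, as a matrix over `ℝ[X]`. -/
noncomputable def frame (k : ℕ) : Matrix (Fin 2) (Fin 2) ℝ[X] :=
  Matrix.of ![![1, (X : ℝ[X]) ^ k], ![(X : ℝ[X]) ^ k, (X : ℝ[X]) ^ (2 * k)]]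

/-- The END form: `det (−w wᵀ + Σ_a X^{e a} • S a)` with three far letters `S a ∈ Mat₂(ℝ)`. -/
noncomputable def endPoly (k : ℕ) (e : Fin 3 → ℕ) (S : Fin 3 → Matrix (Fin 2) (Fin 2) ℝ) : ℝ[X] :=
  (-frame k + ∑ a, (X : ℝ[X]) ^ e a • (S a).map C).det

-- OPEN door family (hypothesis only; never asserted)
/-- `EndDoorAt k e B`: every END form with symmetric far letters has at most `B` positive zeros counted with
multiplicity. -/
def EndDoorAt (k : ℕ) (e : Fin 3 → ℕ) (B : ℕ) : Prop :=
  ∀ S : Fin 3 → Matrix (Fin 2) (Fin 2) ℝ, (∀ a, (S a).IsSymm) → posRootCard (endPoly k e S) ≤ B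

/-- The far exponents of the END-giant class at δ*: letters 3, 4, 5 of e = (0,3,6,14,30,48). -/
def e15 : Fin 3 → ℕ := ![14, 30, 48]

/-- `eg15Poly S` — the 15-nomial `g` of memo §7.12 (a) (support ⊆ `V15`). -/
noncomputable def eg15Poly (S : Fin 3 → Matrix (Fin 2) (Fin 2) ℝ) : ℝ[X] := endPoly 3 e15 S

-- OPEN door (hypothesis only; never asserted)
/-- **EG15(δ*)**: `g = det(−w wᵀ + X¹⁴ S₀ + X³⁰ S₁ + X⁴⁸ S₂)`, `w = (1, X³)`, has at most 13 positive zeros counted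
with multiplicity for all symmetric `S₀, S₁, S₂` (Descartes allows 14).  Would close the far cluster of the mirror class
{hc1706_2604, hc0953_0954} at second order ONCE the blow-up reduction is typed and proved (it is not, here). -/
def EG15 : Prop := EndDoorAt 3 e15 13

/-- The support of `eg15Poly`: `V(δ*)` = {14,17,20,28,30,33,36,44,48,51,54,60,62,78,96} (sorted). -/
def V15 : List ℕ := [14, 17, 20, 28, 30, 33, 36, 44, 48, 51, 54, 60, 62, 78, 96]

/-- `|c_v| · Π_{u ∈ others} |v − u|` — the weighted coefficient entering a Rolle window. -/
noncomputable def windowWeight (f : ℝ[X]) (v : ℕ) (others : List ℕ) : ℝ :=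
  |f.coeff v| * (others.map (fun u => |(v : ℝ) - (u : ℝ)|)).prod

/-- The ROLLE WINDOW at a consecutive exponent triple `vm < v < vp` of the support, `others` = the remaining support
exponents: with `P = v − vm`, `Q = vp − vm`, `θ = P/Q`,
`W(v) ≥ Q / ((Q−P)^{1−θ} P^θ) · W(vm)^{1−θ} · W(vp)^θ` (real powers). -/
def WindowHolds (f : ℝ[X]) (vm v vp : ℕ) (others : List ℕ) : Prop :=
  let P : ℝ := (v : ℝ) - (vm : ℝ)
  let Q : ℝ := (vp : ℝ) - (vm : ℝ)
  let θ : ℝ := P / Q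
  Q / ((Q - P) ^ (1 - θ) * P ^ θ) * windowWeight f vm others ^ (1 - θ) * windowWeight f vp others ^ θ
    ≤ windowWeight f v others

/-- All windows of a sorted support list `s` hold for `f` (one per consecutive triple of `s`; `s` strictly increasing = `List.Pairwise (· < ·)`). -/
def AllWindows (f : ℝ[X]) (s : List ℕ) : Prop :=
  ∀ (i vm v vp : ℕ), s[i]? = some vm → s[i + 1]? = some v → s[i + 2]? = some vp →
    WindowHolds f vm v vp (s.filter (fun u => u ≠ vm ∧ u ≠ v ∧ u ≠ vp))

-- OPEN (elementary; unproved here)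
/-- **LEMMA RW** (Rolle windows, general form, natural exponents): if `f` has support EXACTLY the sorted list `s`
(`s.length = N + 1` monomials) and at least `N` positive zeros counted with multiplicity (Descartes-sharp), then every
consecutive triple of `s` satisfies its window.  Proof sketch (memo §7.12 (b)): remove the other `N − 2` monomials one
at a time from either end by `f ↦ (X^{−u} f)′` (Rolle with multiplicity loses ≤ 1 positive zero per step and multiplies
`c_w` by `(w − u)` without changing relative signs), then apply the two-zero criterion for an alternating trinomial. -/
def RolleWindowLemma : Prop :=
  ∀ (f : ℝ[X]) (s : List ℕ), s.Pairwise (· < ·) → (∀ u, u ∈ f.support ↔ u ∈ s) →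
    s.length - 1 ≤ posRootCard f → AllWindows f s

-- OPEN (instance of `RolleWindowLemma`)
/-- `RW15`: the 13 windows of `V15` are necessary for 14 positive zeros (with multiplicity) of a full-support `eg15Poly S`. -/
def RW15 : Prop :=
  ∀ S : Fin 3 → Matrix (Fin 2) (Fin 2) ℝ, (∀ a, (S a).IsSymm) → (∀ u, u ∈ (eg15Poly S).support ↔ u ∈ V15) →
    14 ≤ posRootCard (eg15Poly S) → AllWindows (eg15Poly S) V15

theorem V15_sorted : V15.Pairwise (· < ·) := by decide

theorem V15_length : V15.length = 15 := by decide

/-- `RW15` is the `V15` instance of LEMMA RW. -/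
theorem rw15_of_rolleWindowLemma (h : RolleWindowLemma) : RW15 := by
  intro S _ hsupp hcard
  exact h (eg15Poly S) V15 V15_sorted hsupp (by rw [V15_length]; omega)

-- OPEN — the FINITE CERTIFICATE TARGET (kit-class; not run)
/-- `RW15Empty`: no symmetric triple `S` whose `eg15Poly` has full support `V15` satisfies all 13 windows.  Equivalent
to the emptiness of an explicit semialgebraic set in the nine letter entries (memo §7.12 (c): coefficients = the Gram
map; full alternation forces the two sign charts). -/
def RW15Empty : Prop :=
  ∀ S : Fin 3 → Matrix (Fin 2) (Fin 2) ℝ, (∀ a, (S a).IsSymm) → (∀ u, u ∈ (eg15Poly S).support ↔ u ∈ V15) →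
    ¬ AllWindows (eg15Poly S) V15

-- OPEN (Descartes' ceiling with multiplicity for ≤ 14 monomials; folklore, to be linked)
/-- `EG15Degenerate`: if some coefficient of `eg15Poly S` on `V15` vanishes (support not all of `V15`), then ≤ 13
positive zeros with multiplicity. -/
def EG15Degenerate : Prop :=
  ∀ S : Fin 3 → Matrix (Fin 2) (Fin 2) ℝ, (∀ a, (S a).IsSymm) → ¬ (∀ u, u ∈ (eg15Poly S).support ↔ u ∈ V15) →
    posRootCard (eg15Poly S) ≤ 13

/-- The certificate split of the END door: windows necessary (`RW15`) + window system empty (`RW15Empty`) + the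
degenerate supports (`EG15Degenerate`) ⇒ `EG15`. -/
theorem eg15_of (hRW : RW15) (hE : RW15Empty) (hD : EG15Degenerate) : EG15 := by
  intro S hS
  by_cases hsupp : ∀ u, u ∈ (eg15Poly S).support ↔ u ∈ V15
  · by_contra hle
    have h14 : 14 ≤ posRootCard (eg15Poly S) := by unfold eg15Poly; omega
    exact hE S hS hsupp (hRW S hS hsupp h14)
  · exact hD S hS hsupp

/-- Same split through the general lemma. -/
theorem eg15_of_rolleWindowLemma (h : RolleWindowLemma) (hE : RW15Empty) (hD : EG15Degenerate) : EG15 :=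
  eg15_of (rw15_of_rolleWindowLemma h) hE hD

-- Routine linear algebra (stated, not proved here; a prover closes both in a few lines)
/-- INERTIA CONFINEMENT, negative-definite case: `Q` negative definite ⇒ `det (Q − w wᵀ) > 0` (2×2: `Q − w wᵀ` is
negative definite).  Consequence (memo §7.12): `endPoly` has no zero at any `y > 0` where `Σ_a y^{e a} S a` is negative
definite. -/
def InertiaConfinementND : Prop :=
  ∀ (Q : Matrix (Fin 2) (Fin 2) ℝ) (w : Fin 2 → ℝ), (-Q).PosDef → 0 < (Q - Matrix.vecMulVec w w).det

/-- FRAME DETERMINANT LEMMA: `det (Q − w wᵀ) = det Q · (1 − wᵀ Q⁻¹ w)` for invertible `Q` (matrix determinant lemma);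
so the zeros of `endPoly` away from `det Q = 0` are the solutions of `wᵀ Q(y)⁻¹ w = 1`. -/
def FrameDeterminantLemma : Prop :=
  ∀ (Q : Matrix (Fin 2) (Fin 2) ℝ) (w : Fin 2 → ℝ), IsUnit Q.det →
    (Q - Matrix.vecMulVec w w).det = Q.det * (1 - w ⬝ᵥ Q⁻¹.mulVec w)


/-! ## rev 2 (g5, 2026-08-29): the rank-one END form «EG8» as a typed hand target

`eg8Poly S₃ K = det(−w wᵀ + X¹⁴ S₃ + K X³⁰ v vᵀ)` with `w = (1, X³)`, `v = (1,1)` is the boundary stratum `S₄ = K v vᵀ`, `S₅ = 0` of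
`eg15Poly`.  Companion memo `Lines/wall_bubbling_EndDoor.md` §7.12 (i)–(k): Sylvester form, the closed-form critical-point function
`Λ(s) = δ(4s−7)(s−1) + (1−θ)·q·(7a₁ + 4a₂ s + 8θ q)` of the Schur height (exact), the K-independent WINDOW LEMMA (critical points only for
`s = y³ ∈ (1, 7/4)` or `q·c < 0`; proved on paper), a two-pair instance, and scans (level-count always ≤ 3).  `EG8Chart` below is the
conjectured sharp law «3 of Descartes 7» in the chart S₃ ≻ 0, b₃ > 0, K > 0 (the chart where the scans were run); it is OPEN and is implied by
L1 ∧ L2 ∧ L3 of the memo's (k)(6).  Nothing here is proved about it. -/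

/-- The all-ones matrix `v vᵀ`, `v = (1,1)`. -/
def onesMat : Matrix (Fin 2) (Fin 2) ℝ := Matrix.of ![![1, 1], ![1, 1]]

/-- The rank-one END form: letters `S₃`, `S₄ = K · v vᵀ`, `S₅ = 0` at the exponents `e15 = (14, 30, 48)`, frame exponent 3. -/
noncomputable def eg8Poly (S₃ : Matrix (Fin 2) (Fin 2) ℝ) (K : ℝ) : ℝ[X] :=
  endPoly 3 e15 ![S₃, K • onesMat, 0]

/-- «EG8 = 3» (OPEN conjecture; companion memo §7.12 (i)(k)): in the chart `S₃ ≻ 0`, `(S₃)₀₁ > 0`, `K > 0` the rank-one END form has at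
most 3 positive zeros counted with multiplicity (Descartes allows 7; 3 is attained). -/
def EG8Chart : Prop :=
  ∀ (S₃ : Matrix (Fin 2) (Fin 2) ℝ) (K : ℝ), S₃.PosDef → 0 < S₃ 0 1 → 0 < K → posRootCard (eg8Poly S₃ K) ≤ 3

theorem onesMat_isSymm : onesMat.IsSymm := by
  ext i j; fin_cases i <;> fin_cases j <;> rfl

/-- Sanity link: the door `EG15` already bounds the rank-one END form by 13 (its letters form a symmetric triple). -/
theorem eg8_le_13_of_EG15 (h : EG15) (S₃ : Matrix (Fin 2) (Fin 2) ℝ) (hS : S₃.IsSymm) (K : ℝ) :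
    posRootCard (eg8Poly S₃ K) ≤ 13 := by
  unfold eg8Poly
  apply h
  intro a
  fin_cases a
  · simpa using hS
  · simpa using (onesMat_isSymm.smul K)
  · simp [Matrix.IsSymm]


/-! ## rev 3 (g5, 2026-08-29): EG9 by the Schur height — `eg9Gamma`, the critical-point budget and the full-pattern law

Companion memo §7.12 (l).  For `P = S₃ + X¹⁶ S₄`, `J = adj P`, `w = (1, X³)`, the Schur height `h = wᵀP⁻¹w / y¹⁴` has
`h′ = −Γ/(y¹⁵ (det P)²)` with `Γ = det P·(14 J₁₁ + 22 J₁₂ X³ + 8 J₂₂ X⁶) + 16 X¹⁶·(Jw)ᵀ S₄ (Jw)` (exact, memo (l)(1)).  In the two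
full-alternation charts below (the D = 8 charts of memo (i), with the sign conditions of the scans spelled out) `h` has exactly one pole
and the inertia/pole bookkeeping of memo (l)(2) gives: (#positive zeros of Γ ≤ 5) ⟹ (≤ 6 distinct positive zeros of the EG9 form).
`EG9CritLaw` is OPEN (search-limited support: climbs never exceed 5; Descartes on Γ gives 7 or 9); `EG9SixLaw` is the found maximum
«6 of Descartes 8»; `EG9Bookkeeping` is the paper-proved implication, stated here and NOT proved in Lean.  Nothing of record. -/

/-- Distinct positive roots (the currency of `PosRootLawAt`). -/
noncomputable def posRootCardD (f : ℝ[X]) : ℕ := (f.roots.toFinset.filter (fun t => 0 < t)).card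

/-- The EG9 pencil `P = S₃ + X¹⁶ • S₄` over `ℝ[X]`. -/
noncomputable def eg9Pencil (S₃ S₄ : Matrix (Fin 2) (Fin 2) ℝ) : Matrix (Fin 2) (Fin 2) ℝ[X] :=
  S₃.map C + (X : ℝ[X]) ^ 16 • S₄.map C

/-- `Γ` of memo §7.12 (l)(1) (its positive zeros are the critical points of the Schur height). -/
noncomputable def eg9Gamma (S₃ S₄ : Matrix (Fin 2) (Fin 2) ℝ) : ℝ[X] :=
  let P := eg9Pencil S₃ S₄
  let J := P.adjugate
  let z : Fin 2 → ℝ[X] := J.mulVec ![1, (X : ℝ[X]) ^ 3]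
  P.det * (C 14 * J 0 0 + C 22 * J 0 1 * X ^ 3 + C 8 * J 1 1 * X ^ 6)
    + C 16 * X ^ 16 * (z ⬝ᵥ (S₄.map C).mulVec z)

/-- The EG9 far-scale form: letters `S₃`, `S₄`, `S₅ = 0` at `e15`, frame exponent 3. -/
noncomputable def eg9Poly (S₃ S₄ : Matrix (Fin 2) (Fin 2) ℝ) : ℝ[X] := endPoly 3 e15 ![S₃, S₄, 0]

/-- The mixed ("polar") coefficient `a₃c₄ + c₃a₄ − 2 b₃b₄` (coefficient of `y⁴⁴`). -/
def polar (S₃ S₄ : Matrix (Fin 2) (Fin 2) ℝ) : ℝ := S₃ 0 0 * S₄ 1 1 + S₃ 1 1 * S₄ 0 0 - 2 * S₃ 0 1 * S₄ 0 1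

/-- Full-alternation chart (−,−): `S₃` indefinite with negative entries, `S₄ ≺ 0` with negative off-diagonal, polar < 0. -/
def EG9ChartMM (S₃ S₄ : Matrix (Fin 2) (Fin 2) ℝ) : Prop :=
  S₃.IsSymm ∧ S₃ 0 0 < 0 ∧ S₃ 0 1 < 0 ∧ S₃ 1 1 < 0 ∧ S₃.det < 0 ∧ (-S₄).PosDef ∧ S₄ 0 1 < 0 ∧ polar S₃ S₄ < 0

/-- Full-alternation chart (+,+): `S₃ ≻ 0` with positive off-diagonal, `S₄` indefinite with positive entries, polar > 0. -/
def EG9ChartPP (S₃ S₄ : Matrix (Fin 2) (Fin 2) ℝ) : Prop :=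
  S₃.PosDef ∧ 0 < S₃ 0 1 ∧ S₄.IsSymm ∧ 0 < S₄ 0 0 ∧ 0 < S₄ 0 1 ∧ 0 < S₄ 1 1 ∧ S₄.det < 0 ∧ 0 < polar S₃ S₄

/-- EG9 CRITICAL-POINT BUDGET (OPEN; memo (l)(4)): in the full-alternation charts `Γ` has at most 5 positive zeros (with multiplicity). -/
def EG9CritLaw : Prop :=
  ∀ S₃ S₄ : Matrix (Fin 2) (Fin 2) ℝ, (EG9ChartMM S₃ S₄ ∨ EG9ChartPP S₃ S₄) → posRootCard (eg9Gamma S₃ S₄) ≤ 5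

/-- EG9 FULL-PATTERN LAW «6 of Descartes 8» (OPEN; the found maximum of memo (i), 6 certified): -/
def EG9SixLaw : Prop :=
  ∀ S₃ S₄ : Matrix (Fin 2) (Fin 2) ℝ, (EG9ChartMM S₃ S₄ ∨ EG9ChartPP S₃ S₄) → posRootCardD (eg9Poly S₃ S₄) ≤ 6

/-- The inertia/pole bookkeeping of memo (l)(2) (one pole; `h(0⁺) = +∞`, `h(∞) = 0⁻`, `h(y_p∓) = ±∞`; monotone pieces and parity):
proved on paper, stated here as the implication to be formalised. -/
def EG9Bookkeeping : Prop := EG9CritLaw → EG9SixLaw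


/-! ## rev 4 (g6, 2026-08-29, lens = finite): EG15 AS A REDUCTION TO TWO FINITE CERTIFICATE CHECKS — the Γ₁₅ budget

Companion memo §7.12 (m)–(o).  Write `P = S₃ + X¹⁶ S₄ + X³⁴ S₅` (`eg15Pencil`), `D = det P` (`eg15D`),
`N = wᵀ adj(P) w = P₂₂ − X³(P₁₂ + P₂₁) + X⁶ P₁₁` (`eg15N`, `w = (1, X³)`), so that — KERNEL, `eg15Poly_eq` —
`eg15Poly S = X¹⁴ · (X¹⁴ D − N)`, and the Wronskian of `G := X¹⁴ D` against `N` is — KERNEL, `wronskian_eg15` —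
`W(G, N) = −X¹³ Γ₁₅`, `Γ₁₅ := 14·D·N + X·D′·N − X·D·N′` (`eg15Gamma`; 30 monomials generically).
THE REDUCTION (kernel, `eg15_of_critBudget`): off the two full-alternation charts Descartes gives ≤ 13 (Mathlib
`roots_countP_pos_le_signVariations`); on chart (+,+,+) the GENERAL Wronskian–Rolle lemma `WronskianRolle` (paper-proved, no
genericity hypothesis: Rolle with multiplicity on the pole-free segments of `F/G` plus multiplicity domination `mult_t F ≤ mult_t W`
at zeros `t` of `G`) gives `Z₊(F) ≤ Z₊(Γ₁₅) + Z₊ᴰ(D) + 1` (KERNEL from the lemma: `posRootCard_eg15Poly_le`), the pole law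
`EG15PoleLawP` (`Z₊ᴰ(D) ≤ 1`; paper-proved by Loewner monotonicity of the pencil root, memo (m)) and the CERTIFICATE `EG15CritLawP`
(`Z₊(Γ₁₅) ≤ 11`; OPEN — found maximum 5) close 11 + 1 + 1 = 13; on chart (−,−,−) poles number up to q = 3 (located exact instance, memo (m):
q = 3, Z₊(Γ₁₅) = 7, Z₊(F) = 4) but INERTIA confines the zeros of `F` to `{D < 0}` (all diagonal entries of `P` negative ⇒ `D > 0` forces
`P ≺ 0`, `adj P ≺ 0`, `X¹⁴D − N > 0`), whence the bookkeeping `EG15BookkeepingM` (`Z₊(F) ≤ Z₊^{D≤0}(Γ₁₅) + 2`, paper-proved, memo (n)) and the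
CERTIFICATE `EG15CritLawM` (`Z₊^{D≤0}(Γ₁₅) ≤ 11`; OPEN — found maximum 5) close 11 + 2 = 13.  The two certificates are decidable-in-principle
statements about the sign structure of ONE explicit integer-coefficient polynomial identity in 9 letters on two explicit semialgebraic charts —
the finite checks this lens asks for; `EG15ChartLaw` is routine coefficient extraction.  NOTHING of record: `EG15`, every `…Law…` Prop and
`WronskianRolle` are OPEN here (hypotheses only); DoorA26 (19979) and 18050 untouched; VP ≠ VNP not moved. -/

/-- The far pencil `P = S₃ + X¹⁶ S₄ + X³⁴ S₅` over `ℝ[X]` (letters `S 0, S 1, S 2`). -/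
noncomputable def eg15Pencil (S : Fin 3 → Matrix (Fin 2) (Fin 2) ℝ) : Matrix (Fin 2) (Fin 2) ℝ[X] :=
  (S 0).map C + (X : ℝ[X]) ^ 16 • (S 1).map C + (X : ℝ[X]) ^ 34 • (S 2).map C

/-- `D = det P` (support ⊆ {0,16,32,34,50,68}; coefficients det S₃, polar₃₄, det S₄, polar₃₅, polar₄₅, det S₅). -/
noncomputable def eg15D (S : Fin 3 → Matrix (Fin 2) (Fin 2) ℝ) : ℝ[X] := (eg15Pencil S).det

/-- `N = wᵀ adj(P) w`, `w = (1, X³)`, written out by entries (no symmetry assumed). -/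
noncomputable def eg15N (S : Fin 3 → Matrix (Fin 2) (Fin 2) ℝ) : ℝ[X] :=
  eg15Pencil S 1 1 - X ^ 3 * eg15Pencil S 0 1 - X ^ 3 * eg15Pencil S 1 0 + X ^ 6 * eg15Pencil S 0 0

/-- `Γ₁₅ = 14·D·N + X·D′·N − X·D·N′` — the critical-point polynomial of the Schur height (memo §7.12 (l)/(m)). -/
noncomputable def eg15Gamma (S : Fin 3 → Matrix (Fin 2) (Fin 2) ℝ) : ℝ[X] :=
  C 14 * eg15D S * eg15N S + X * derivative (eg15D S) * eg15N S - X * eg15D S * derivative (eg15N S)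

/-- KERNEL IDENTITY: `g = X¹⁴ (X¹⁴ D − N)`. -/
theorem eg15Poly_eq (S : Fin 3 → Matrix (Fin 2) (Fin 2) ℝ) :
    eg15Poly S = X ^ 14 * (X ^ 14 * eg15D S - eg15N S) := by
  simp only [eg15Poly, endPoly, frame, eg15D, eg15N, eg15Pencil, Matrix.det_fin_two, Fin.sum_univ_three, e15]
  simp [Matrix.add_apply, Matrix.smul_apply, Matrix.map_apply]
  ring

/-- KERNEL IDENTITY: `W(X¹⁴ D, N) = −X¹³ Γ₁₅` (Mathlib `wronskian a b = a b′ − a′ b`). -/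
theorem wronskian_eg15 (S : Fin 3 → Matrix (Fin 2) (Fin 2) ℝ) :
    wronskian (X ^ 14 * eg15D S) (eg15N S) = -(X ^ 13 * eg15Gamma S) := by
  simp only [wronskian, eg15Gamma, derivative_mul, derivative_X_pow]
  push_cast
  ring

/-- `Γ₁₅(0) = 14 · det S₃ · (S₃)₂₂`. -/
theorem eg15Gamma_eval_zero (S : Fin 3 → Matrix (Fin 2) (Fin 2) ℝ) :
    (eg15Gamma S).eval 0 = 14 * (S 0).det * S 0 1 1 := by
  simp [eg15Gamma, eg15D, eg15N, eg15Pencil, Matrix.det_fin_two, Polynomial.eval_mul, Matrix.add_apply,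
    Matrix.smul_apply, Matrix.map_apply]

theorem eg15Gamma_ne_zero (S : Fin 3 → Matrix (Fin 2) (Fin 2) ℝ) (hdet : (S 0).det ≠ 0) (hc : S 0 1 1 ≠ 0) :
    eg15Gamma S ≠ 0 := by
  intro h0
  have h := eg15Gamma_eval_zero S
  rw [h0, eval_zero] at h
  exact mul_ne_zero (mul_ne_zero (by norm_num) hdet) hc h.symm

/-- Descartes (Mathlib) in this file's currency. -/
theorem posRootCard_le_signVariations (f : ℝ[X]) : posRootCard f ≤ f.signVariations := by
  unfold posRootCard
  rw [← Multiset.countP_eq_card_filter]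
  exact f.roots_countP_pos_le_signVariations

theorem posRootCard_neg (f : ℝ[X]) : posRootCard (-f) = posRootCard f := by
  simp [posRootCard, Polynomial.roots_neg]

theorem posRootCard_X_pow_mul (n : ℕ) (f : ℝ[X]) : posRootCard (X ^ n * f) = posRootCard f := by
  by_cases hf : f = 0
  · simp [hf]
  unfold posRootCard
  rw [Polynomial.roots_mul (mul_ne_zero (pow_ne_zero _ X_ne_zero) hf), Polynomial.roots_X_pow, Multiset.filter_add,
    Multiset.filter_nsmul, Multiset.filter_singleton]
  simp

theorem posRootCardD_X_pow_mul (n : ℕ) (f : ℝ[X]) : posRootCardD (X ^ n * f) = posRootCardD f := by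
  by_cases hf : f = 0
  · simp [hf]
  unfold posRootCardD
  rw [Polynomial.roots_mul (mul_ne_zero (pow_ne_zero _ X_ne_zero) hf), Polynomial.roots_X_pow]
  congr 1
  ext t
  simp only [Finset.mem_filter, Multiset.mem_toFinset, Multiset.mem_add, Multiset.mem_nsmul, Multiset.mem_singleton]
  constructor
  · rintro ⟨h | h, ht⟩
    · exact absurd h.2 ht.ne'
    · exact ⟨h, ht⟩
  · rintro ⟨h, ht⟩
    exact ⟨Or.inr h, ht⟩

/-- THE GENERAL WRONSKIAN–ROLLE LEMMA (no genericity hypothesis; paper-proved, memo §7.12 (n); OPEN in Lean — an M-sized support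
item anyone may take): for real polynomials `G, N` with `W(G,N) ≢ 0`, the positive zeros of `G − N` counted with multiplicity number at
most `Z₊(W(G,N)) + Z₊ᴰ(G) + 1` — Rolle with multiplicity for `(G − N)/G` on each of the `Z₊ᴰ(G) + 1` pole-free segments of `(0, ∞)`, plus
`mult_t (G − N) ≤ mult_t W(G, G − N)` at every positive zero `t` of `G` (and `W(G, G − N) = −W(G, N)`).  The term `Z₊ᴰ(G)` cannot be
dropped: `G = X² + X − 1`, `N = X` has `W = X² + 1 > 0` and `G − N = X² − 1`. -/
def WronskianRolle : Prop :=
  ∀ G N : ℝ[X], wronskian G N ≠ 0 → posRootCard (G - N) ≤ posRootCard (wronskian G N) + posRootCardD G + 1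

/-- KERNEL (from the lemma): chart-free bookkeeping `Z₊(g) ≤ Z₊(Γ₁₅) + Z₊ᴰ(D) + 1` whenever `Γ₁₅ ≢ 0`. -/
theorem posRootCard_eg15Poly_le (hWR : WronskianRolle) (S : Fin 3 → Matrix (Fin 2) (Fin 2) ℝ) (hΓ : eg15Gamma S ≠ 0) :
    posRootCard (eg15Poly S) ≤ posRootCard (eg15Gamma S) + posRootCardD (eg15D S) + 1 := by
  have hW : wronskian (X ^ 14 * eg15D S) (eg15N S) ≠ 0 := by
    rw [wronskian_eg15]
    exact neg_ne_zero.mpr (mul_ne_zero (pow_ne_zero _ X_ne_zero) hΓ)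
  have h := hWR (X ^ 14 * eg15D S) (eg15N S) hW
  rw [wronskian_eg15, posRootCard_neg, posRootCard_X_pow_mul, posRootCardD_X_pow_mul] at h
  rw [eg15Poly_eq, posRootCard_X_pow_mul]
  exact h

/-- Full-alternation chart (+,+,+) of the 15-nomial (Descartes 14, first coefficient `−(S₃)₂₂ < 0`): all nine entries positive,
`det S₃ > 0`, `polar₃₄ > 0`, `det S₄ > 0`, `polar₃₅ < 0`, `polar₄₅ > 0`, `det S₅ < 0`. -/
def EG15ChartP (S : Fin 3 → Matrix (Fin 2) (Fin 2) ℝ) : Prop :=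
  (∀ a i j, 0 < S a i j) ∧ 0 < (S 0).det ∧ 0 < polar (S 0) (S 1) ∧ 0 < (S 1).det ∧ polar (S 0) (S 2) < 0 ∧
    0 < polar (S 1) (S 2) ∧ (S 2).det < 0

/-- Full-alternation chart (−,−,−): every sign of chart (+,+,+) flipped. -/
def EG15ChartM (S : Fin 3 → Matrix (Fin 2) (Fin 2) ℝ) : Prop :=
  (∀ a i j, S a i j < 0) ∧ (S 0).det < 0 ∧ polar (S 0) (S 1) < 0 ∧ (S 1).det < 0 ∧ 0 < polar (S 0) (S 2) ∧
    polar (S 1) (S 2) < 0 ∧ 0 < (S 2).det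

/-- CHART LAW (routine coefficient extraction; OPEN in Lean, support-sized): 14 sign variations of the 15-nomial force one of the two
full-alternation charts (the 15 coefficients on `V15` are `−c₃, 2b₃, −a₃, det S₃, −c₄, 2b₄, −a₄, polar₃₄, −c₅, 2b₅, −a₅, det S₄, polar₃₅,
polar₄₅, det S₅` for symmetric letters `S_l = (a_l b_l; b_l c_l)`). -/
def EG15ChartLaw : Prop :=
  ∀ S : Fin 3 → Matrix (Fin 2) (Fin 2) ℝ, (∀ a, (S a).IsSymm) → 14 ≤ (eg15Poly S).signVariations → EG15ChartP S ∨ EG15ChartM S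

/-- POLE LAW on chart (+,+,+) (paper-proved, memo §7.12 (m); OPEN in Lean): `D = det(S₃ + y¹⁶S₄ + y³⁴S₅)` has at most ONE distinct
positive zero when `S₃, S₄ ≻ 0` and `det S₅ < 0` — the positive root `t*(A)` of `det(A + t S₅)`, `A ≻ 0`, is 1-homogeneous and Loewner-monotone,
and `D(y) = 0 ⟺ t*(y⁻³⁴S₃ + y⁻¹⁸S₄) = 1` with a strictly Loewner-decreasing argument.  (FALSE on chart (−,−,−): q = 3 occurs, memo (m).) -/
def EG15PoleLawP : Prop :=
  ∀ S : Fin 3 → Matrix (Fin 2) (Fin 2) ℝ, (∀ a, (S a).IsSymm) → EG15ChartP S → posRootCardD (eg15D S) ≤ 1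

/-- CERTIFICATE (+): on chart (+,+,+) `Γ₁₅` has at most 11 positive zeros counted with multiplicity.  OPEN — the finite check this
lens reduces EG15 to (found maximum 5; Descartes on the 30-nomial `Γ₁₅` does NOT give it). -/
def EG15CritLawP : Prop :=
  ∀ S : Fin 3 → Matrix (Fin 2) (Fin 2) ℝ, (∀ a, (S a).IsSymm) → EG15ChartP S → posRootCard (eg15Gamma S) ≤ 11

/-- `Z₊^{D≤0}(Γ₁₅)`: positive zeros of `Γ₁₅` (with multiplicity) at which `D ≤ 0` — the only critical points charged on chart (−,−,−). -/
noncomputable def negRootedCritCard (S : Fin 3 → Matrix (Fin 2) (Fin 2) ℝ) : ℕ :=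
  ((eg15Gamma S).roots.filter (fun t => 0 < t ∧ (eg15D S).eval t ≤ 0)).card

theorem negRootedCritCard_le (S : Fin 3 → Matrix (Fin 2) (Fin 2) ℝ) : negRootedCritCard S ≤ posRootCard (eg15Gamma S) := by
  unfold negRootedCritCard posRootCard
  exact Multiset.card_le_card (Multiset.monotone_filter_right _ (fun t ht => ht.1))

/-- INERTIA BOOKKEEPING on chart (−,−,−) (paper-proved, memo §7.12 (n); OPEN in Lean): zeros of `X¹⁴D − N` lie in `{D < 0} ∪ {D = 0}`
(`D > 0` with negative diagonal forces `P ≺ 0`, `adj P ≺ 0`, `X¹⁴D − N > 0`); `{D < 0} ∩ (0,∞)` has ≤ 2 components (Descartes 3 on the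
6-nomial `D`, `D(0⁺) = det S₃ < 0 < det S₅ = D(∞)`); Rolle with multiplicity on each component and multiplicity domination at `D = 0`
(`W(X¹⁴D, N) = −X¹³Γ₁₅`, `Γ₁₅(0) = 14 det S₃ (S₃)₂₂ ≠ 0`). -/
def EG15BookkeepingM : Prop :=
  ∀ S : Fin 3 → Matrix (Fin 2) (Fin 2) ℝ, (∀ a, (S a).IsSymm) → EG15ChartM S → posRootCard (eg15Poly S) ≤ negRootedCritCard S + 2

/-- CERTIFICATE (−): on chart (−,−,−) at most 11 positive zeros of `Γ₁₅` (with multiplicity) sit where `D ≤ 0`.  OPEN — the second finite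
check (value 4 = 3 + 1 on the located q = 3 instance, where `Z₊(Γ₁₅) = 7` and `Z₊(g) = 4`; found maximum 5 in the first targeted climbs, memo (m)(2)). -/
def EG15CritLawM : Prop :=
  ∀ S : Fin 3 → Matrix (Fin 2) (Fin 2) ℝ, (∀ a, (S a).IsSymm) → EG15ChartM S → negRootedCritCard S ≤ 11

/-- The uniform certificate «`Z₊(Γ₁₅) ≤ 11` on both charts» implies both chart certificates (kernel). -/
theorem critLaws_of_uniform
    (h : ∀ S : Fin 3 → Matrix (Fin 2) (Fin 2) ℝ, (∀ a, (S a).IsSymm) → (EG15ChartP S ∨ EG15ChartM S) →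
      posRootCard (eg15Gamma S) ≤ 11) : EG15CritLawP ∧ EG15CritLawM :=
  ⟨fun S hS hP => h S hS (Or.inl hP), fun S hS hM => (negRootedCritCard_le S).trans (h S hS (Or.inr hM))⟩

/-- **THE REDUCTION (kernel): EG15 ⟸ chart law ∧ Wronskian–Rolle ∧ pole law (+) ∧ CERTIFICATE (+) ∧ inertia bookkeeping (−) ∧ CERTIFICATE (−).**
Every hypothesis is an OPEN Prop of this file (three of them paper-proved); nothing is asserted. -/
theorem eg15_of_critBudget (hC : EG15ChartLaw) (hWR : WronskianRolle) (hQ : EG15PoleLawP) (hΓP : EG15CritLawP)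
    (hBM : EG15BookkeepingM) (hΓM : EG15CritLawM) : EG15 := by
  intro S hS
  show posRootCard (eg15Poly S) ≤ 13
  by_cases h14 : 14 ≤ (eg15Poly S).signVariations
  · rcases hC S hS h14 with hP | hM
    · have hΓ : eg15Gamma S ≠ 0 := eg15Gamma_ne_zero S hP.2.1.ne' (hP.1 0 1 1).ne'
      have h1 := posRootCard_eg15Poly_le hWR S hΓ
      have h2 := hΓP S hS hP
      have h3 := hQ S hS hP
      omega
    · have h1 := hBM S hS hM
      have h2 := hΓM S hS hM
      omega
  · have h1 := posRootCard_le_signVariations (eg15Poly S)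
    omega


/-! ## rev 5 (A) (line lead val-idea-15 g6, 2026-08-29 ≈07Z): THE POLE LAW ON CHART (+,+,+) PROVED IN THE KERNEL — nothing of revs 1–4 changed

rev 4 + ONE appended block: `eg15D_eval` (`D(y)` by entries), `det_pos_of_psd_add_pd` (2×2 algebra: `det(c·P + E) > 0` for `P` singular
with `P₁₁ > 0`, `c ≥ 0`, `E ≻ 0`), `eg15D_eval_pos_below_root` (if `y₂ > y₁ > 0` and `D(y₂) = 0` then `D(y₁) > 0`, via the entrywise identity
`y₂³⁴·P(y₁) = y₁³⁴·P(y₂) + E`, `E = (y₂³⁴ − y₁³⁴)S₃ + y₁¹⁶y₂¹⁶(y₂¹⁸ − y₁¹⁸)S₄ ≻ 0`, using only the chart-(+,+,+) facts «`S₃, S₄` entrywise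
positive, `det S₃ > 0`, `det S₄ > 0`, `polar₃₄ > 0`»), hence **`eg15PoleLawP_holds : EG15PoleLawP`** — at most ONE distinct positive pole on
chart (+,+,+); the Loewner argument of memo §7.12 (m)(1) made elementary — and the corollary **`eg15_of_critBudget5`**: the reduction of record
now reads **EG15 ⟸ EG15ChartLaw ∧ WronskianRolle ∧ EG15CritLawP ∧ EG15BookkeepingM ∧ EG15CritLawM** (two certificates + three paper
lemmas).  `EG15`, both certificates, `WronskianRolle`, `EG15ChartLaw`, `EG15BookkeepingM` stay OPEN; DoorA26 (19979) and 18050 untouched;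
VP ≠ VNP not moved. -/

/-- `D(y)` by entries. -/
theorem eg15D_eval (S : Fin 3 → Matrix (Fin 2) (Fin 2) ℝ) (y : ℝ) :
    (eg15D S).eval y =
      (S 0 0 0 + y ^ 16 * S 1 0 0 + y ^ 34 * S 2 0 0) * (S 0 1 1 + y ^ 16 * S 1 1 1 + y ^ 34 * S 2 1 1)
        - (S 0 0 1 + y ^ 16 * S 1 0 1 + y ^ 34 * S 2 0 1) * (S 0 1 0 + y ^ 16 * S 1 1 0 + y ^ 34 * S 2 1 0) := by
  simp only [eg15D, eg15Pencil, Matrix.det_fin_two, eval_sub, eval_mul]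
  simp [Matrix.add_apply, Matrix.smul_apply, Matrix.map_apply]
  ring

/-- 2×2 algebra: `c·P + E` has positive determinant when `P` is singular with `P₁₁ > 0` («PSD rank one»), `c ≥ 0`, and `E ≻ 0`. -/
theorem det_pos_of_psd_add_pd {p₁₁ p₁₂ p₂₂ e₁₁ e₁₂ e₂₂ c : ℝ} (hc : 0 ≤ c) (hp : 0 < p₁₁)
    (hpsd : p₁₁ * p₂₂ - p₁₂ * p₁₂ = 0) (he : 0 < e₁₁) (hE : 0 < e₁₁ * e₂₂ - e₁₂ * e₁₂) :
    0 < (c * p₁₁ + e₁₁) * (c * p₂₂ + e₂₂) - (c * p₁₂ + e₁₂) * (c * p₁₂ + e₁₂) := by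
  have key : e₁₁ * p₁₁ * (p₁₁ * e₂₂ + p₂₂ * e₁₁ - 2 * p₁₂ * e₁₂)
      = (p₁₂ * e₁₁ - p₁₁ * e₁₂) ^ 2 + p₁₁ ^ 2 * (e₁₁ * e₂₂ - e₁₂ * e₁₂) + e₁₁ ^ 2 * (p₁₁ * p₂₂ - p₁₂ * p₁₂) := by ring
  have hX : 0 ≤ p₁₁ * e₂₂ + p₂₂ * e₁₁ - 2 * p₁₂ * e₁₂ := by
    by_contra hneg
    have hneg : p₁₁ * e₂₂ + p₂₂ * e₁₁ - 2 * p₁₂ * e₁₂ < 0 := lt_of_not_ge hneg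
    have h1 : e₁₁ * p₁₁ * (p₁₁ * e₂₂ + p₂₂ * e₁₁ - 2 * p₁₂ * e₁₂) < 0 :=
      mul_neg_of_pos_of_neg (mul_pos he hp) hneg
    have h2 : 0 ≤ (p₁₂ * e₁₁ - p₁₁ * e₁₂) ^ 2 + p₁₁ ^ 2 * (e₁₁ * e₂₂ - e₁₂ * e₁₂) + e₁₁ ^ 2 * (p₁₁ * p₂₂ - p₁₂ * p₁₂) := by
      rw [hpsd]; positivity
    linarith [key]
  have expand : (c * p₁₁ + e₁₁) * (c * p₂₂ + e₂₂) - (c * p₁₂ + e₁₂) * (c * p₁₂ + e₁₂)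
      = c ^ 2 * (p₁₁ * p₂₂ - p₁₂ * p₁₂) + c * (p₁₁ * e₂₂ + p₂₂ * e₁₁ - 2 * p₁₂ * e₁₂) + (e₁₁ * e₂₂ - e₁₂ * e₁₂) := by ring
  rw [expand, hpsd]
  nlinarith [mul_nonneg hc hX]

/-- If `y₂ > y₁ > 0` is a zero of `D` on chart (+,+,+) (first four conditions), then `D(y₁) > 0`. -/
theorem eg15D_eval_pos_below_root (S : Fin 3 → Matrix (Fin 2) (Fin 2) ℝ) (hS : ∀ a, (S a).IsSymm)
    (hpos : ∀ a i j, 0 < S a i j) (hd3 : 0 < (S 0).det) (hp34 : 0 < polar (S 0) (S 1)) (hd4 : 0 < (S 1).det)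
    {y₁ y₂ : ℝ} (hy₁ : 0 < y₁) (h12 : y₁ < y₂) (e₂ : (eg15D S).eval y₂ = 0) : 0 < (eg15D S).eval y₁ := by
  have hb3 : S 0 1 0 = S 0 0 1 := (hS 0).apply 0 1
  have hb4 : S 1 1 0 = S 1 0 1 := (hS 1).apply 0 1
  have hb5 : S 2 1 0 = S 2 0 1 := (hS 2).apply 0 1
  rw [eg15D_eval] at e₂ ⊢
  rw [Matrix.det_fin_two] at hd3 hd4
  simp only [polar] at hp34
  rw [hb3] at hd3 ⊢ e₂; rw [hb4] at hd4 ⊢ e₂; rw [hb5] at e₂ ⊢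
  have hy₂ : 0 < y₂ := hy₁.trans h12
  -- the shift coefficients
  have hα : 0 < y₂ ^ 34 - y₁ ^ 34 := sub_pos.mpr (pow_lt_pow_left₀ h12 hy₁.le (by norm_num))
  have hβ : 0 < y₂ ^ 34 * y₁ ^ 16 - y₁ ^ 34 * y₂ ^ 16 := by
    have : y₂ ^ 34 * y₁ ^ 16 - y₁ ^ 34 * y₂ ^ 16 = y₁ ^ 16 * y₂ ^ 16 * (y₂ ^ 18 - y₁ ^ 18) := by ring
    rw [this]
    exact mul_pos (mul_pos (pow_pos hy₁ 16) (pow_pos hy₂ 16)) (sub_pos.mpr (pow_lt_pow_left₀ h12 hy₁.le (by norm_num)))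
  set α := y₂ ^ 34 - y₁ ^ 34 with hαdef
  set β := y₂ ^ 34 * y₁ ^ 16 - y₁ ^ 34 * y₂ ^ 16 with hβdef
  set a₃ := S 0 0 0; set b₃ := S 0 0 1; set c₃ := S 0 1 1
  set a₄ := S 1 0 0; set b₄ := S 1 0 1; set c₄ := S 1 1 1
  set a₅ := S 2 0 0; set b₅ := S 2 0 1; set c₅ := S 2 1 1
  have ha₃ : 0 < a₃ := hpos 0 0 0
  have ha₄ : 0 < a₄ := hpos 1 0 0
  have ha₅ : 0 < a₅ := hpos 2 0 0
  -- entries of P(y₂) and of E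
  set p₁₁ := a₃ + y₂ ^ 16 * a₄ + y₂ ^ 34 * a₅ with hp₁₁
  set p₁₂ := b₃ + y₂ ^ 16 * b₄ + y₂ ^ 34 * b₅ with hp₁₂
  set p₂₂ := c₃ + y₂ ^ 16 * c₄ + y₂ ^ 34 * c₅ with hp₂₂
  have hp : 0 < p₁₁ := by positivity
  have he : 0 < α * a₃ + β * a₄ := by positivity
  have hE : 0 < (α * a₃ + β * a₄) * (α * c₃ + β * c₄) - (α * b₃ + β * b₄) * (α * b₃ + β * b₄) := by
    have : (α * a₃ + β * a₄) * (α * c₃ + β * c₄) - (α * b₃ + β * b₄) * (α * b₃ + β * b₄)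
        = α ^ 2 * (a₃ * c₃ - b₃ * b₃) + β ^ 2 * (a₄ * c₄ - b₄ * b₄) + α * β * (a₃ * c₄ + c₃ * a₄ - 2 * b₃ * b₄) := by ring
    rw [this]; positivity
  have main := det_pos_of_psd_add_pd (pow_pos hy₁ 34).le hp e₂ he hE
  -- y₂^34 · P(y₁) = y₁^34 · P(y₂) + E, entrywise
  have i₁₁ : y₂ ^ 34 * (a₃ + y₁ ^ 16 * a₄ + y₁ ^ 34 * a₅) = y₁ ^ 34 * p₁₁ + (α * a₃ + β * a₄) := by
    simp only [hp₁₁, hαdef, hβdef]; ring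
  have i₁₂ : y₂ ^ 34 * (b₃ + y₁ ^ 16 * b₄ + y₁ ^ 34 * b₅) = y₁ ^ 34 * p₁₂ + (α * b₃ + β * b₄) := by
    simp only [hp₁₂, hαdef, hβdef]; ring
  have i₂₂ : y₂ ^ 34 * (c₃ + y₁ ^ 16 * c₄ + y₁ ^ 34 * c₅) = y₁ ^ 34 * p₂₂ + (α * c₃ + β * c₄) := by
    simp only [hp₂₂, hαdef, hβdef]; ring
  have scaled : (y₂ ^ 34) ^ 2 * ((a₃ + y₁ ^ 16 * a₄ + y₁ ^ 34 * a₅) * (c₃ + y₁ ^ 16 * c₄ + y₁ ^ 34 * c₅)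
      - (b₃ + y₁ ^ 16 * b₄ + y₁ ^ 34 * b₅) * (b₃ + y₁ ^ 16 * b₄ + y₁ ^ 34 * b₅))
      = (y₁ ^ 34 * p₁₁ + (α * a₃ + β * a₄)) * (y₁ ^ 34 * p₂₂ + (α * c₃ + β * c₄))
        - (y₁ ^ 34 * p₁₂ + (α * b₃ + β * b₄)) * (y₁ ^ 34 * p₁₂ + (α * b₃ + β * b₄)) := by
    rw [← i₁₁, ← i₁₂, ← i₂₂]; ring
  have hpos2 : 0 < (y₂ ^ 34) ^ 2 := by positivity
  have := main
  rw [← scaled] at this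
  exact (mul_pos_iff_of_pos_left hpos2).mp this

theorem eg15PoleLawP_holds : EG15PoleLawP := by
  intro S hS hC
  obtain ⟨hpos, hd3, hp34, hd4, -, -, -⟩ := hC
  unfold posRootCardD
  refine Finset.card_le_one.mpr ?_
  intro y₁ hy₁ y₂ hy₂
  simp only [Finset.mem_filter, Multiset.mem_toFinset] at hy₁ hy₂
  obtain ⟨hr₁, hy₁pos⟩ := hy₁
  obtain ⟨hr₂, hy₂pos⟩ := hy₂
  have e₁ : (eg15D S).eval y₁ = 0 := (mem_roots'.mp hr₁).2
  have e₂ : (eg15D S).eval y₂ = 0 := (mem_roots'.mp hr₂).2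
  by_contra hne
  rcases lt_or_gt_of_ne hne with h | h
  · exact absurd e₁ (ne_of_gt (eg15D_eval_pos_below_root S hS hpos hd3 hp34 hd4 hy₁pos h e₂))
  · exact absurd e₂ (ne_of_gt (eg15D_eval_pos_below_root S hS hpos hd3 hp34 hd4 hy₂pos h e₁))

/-- (rev 5) THE REDUCTION OF RECORD after rev 5: **EG15 ⟸ EG15ChartLaw ∧ WronskianRolle ∧ EG15CritLawP ∧ EG15BookkeepingM ∧ EG15CritLawM**
(the pole law discharged in the kernel).  Every hypothesis OPEN, typed, never asserted. -/
theorem eg15_of_critBudget5 (hC : EG15ChartLaw) (hWR : WronskianRolle) (hΓP : EG15CritLawP) (hBM : EG15BookkeepingM)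
    (hΓM : EG15CritLawM) : EG15 :=
  eg15_of_critBudget hC hWR eg15PoleLawP_holds hΓP hBM hΓM


/-! ## rev 5 (B) (g6, 2026-08-29) — the CHART LAW is kernel: `eg15ChartLaw_holds : EG15ChartLaw`

Memo §7.12 (a)/(b): `14 ≤ signVariations (eg15Poly S)` with support ⊆ `V15` (15 slots) forces ALL fifteen coefficients
nonzero with ALTERNATING signs along `V15`, and reading the alternating pattern off the coefficient table
(`−c₃, 2b₃, −a₃, det S₃, −c₄, 2b₄, −a₄, polar₃₄, −c₅, 2b₅, −a₅, det S₄, polar₃₅, polar₄₅, det S₅` at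
`14,17,20,28,30,33,36,44,48,51,54,60,62,78,96`) gives exactly chart (+,+,+) (`EG15ChartP`) or its mirror (`EG15ChartM`).
Ingredients, all elementary: (a) the explicit 15-nomial (`eg15Poly_expand`, by `simp` + `ring`); (b) the general slot bound
`signVariations P + 1 ≤ #support P` (`signVariations_succ_le_card_support`, induction on `eraseLead` via Mathlib's
`signVariations_eq_eraseLead_add_ite` and `card_support_eraseLead`); (c) support `= V15.toFinset` in the extremal case
(`Finset.eq_of_subset_of_card_le`); (d) `alternate_of_extremal`: along a strictly decreasing exponent list that IS the
support, `length ≤ signVariations + 1` forces `sign (coeff a) = − sign (coeff b)` for consecutive `a, b` (induction on the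
list, peeling `eraseLead`); (e) assembly.  Consequence: `eg15_of_critBudget4 : WronskianRolle → EG15CritLawP →
EG15BookkeepingM → EG15CritLawM → EG15` — the reduction of record now has FOUR hypotheses (the two finite certificates +
two paper lemmas `WronskianRolle`, `EG15BookkeepingM`).  Nothing OPEN is asserted: `EG15`, both certificates,
`WronskianRolle`, `EG15BookkeepingM`, (M), DoorA26 19979, 18050 remain OPEN. -/

/-! ### rev 5 (B.a): the fifteen coefficients written out -/

/-- The 15-nomial written out (no symmetry assumed). -/
theorem eg15Poly_expand (S : Fin 3 → Matrix (Fin 2) (Fin 2) ℝ) :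
    eg15Poly S =
      C (-(S 0 1 1)) * X ^ 14 + C (S 0 0 1 + S 0 1 0) * X ^ 17 + C (-(S 0 0 0)) * X ^ 20
      + C (S 0 0 0 * S 0 1 1 - S 0 0 1 * S 0 1 0) * X ^ 28
      + C (-(S 1 1 1)) * X ^ 30 + C (S 1 0 1 + S 1 1 0) * X ^ 33 + C (-(S 1 0 0)) * X ^ 36
      + C (S 0 0 0 * S 1 1 1 + S 0 1 1 * S 1 0 0 - S 0 0 1 * S 1 1 0 - S 0 1 0 * S 1 0 1) * X ^ 44
      + C (-(S 2 1 1)) * X ^ 48 + C (S 2 0 1 + S 2 1 0) * X ^ 51 + C (-(S 2 0 0)) * X ^ 54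
      + C (S 1 0 0 * S 1 1 1 - S 1 0 1 * S 1 1 0) * X ^ 60
      + C (S 0 0 0 * S 2 1 1 + S 0 1 1 * S 2 0 0 - S 0 0 1 * S 2 1 0 - S 0 1 0 * S 2 0 1) * X ^ 62
      + C (S 1 0 0 * S 2 1 1 + S 1 1 1 * S 2 0 0 - S 1 0 1 * S 2 1 0 - S 1 1 0 * S 2 0 1) * X ^ 78
      + C (S 2 0 0 * S 2 1 1 - S 2 0 1 * S 2 1 0) * X ^ 96 := by
  simp only [eg15Poly, endPoly, frame, Matrix.det_fin_two, Fin.sum_univ_three, e15]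
  simp [Matrix.add_apply, Matrix.smul_apply, Matrix.map_apply, map_add, map_sub, map_mul, map_neg]
  ring

/-! ### rev 5 (B.b): Descartes' slot bound `signVariations P + 1 ≤ #support P` -/

theorem signVariations_succ_le_card_support (P : ℝ[X]) (hP : P ≠ 0) :
    P.signVariations + 1 ≤ P.support.card := by
  induction h : P.support.card using Nat.strong_induction_on generalizing P with
  | _ n ih =>
    subst h
    rw [signVariations_eq_eraseLead_add_ite hP]
    have hcard : P.eraseLead.support.card = P.support.card - 1 := card_support_eraseLead
    have hpos : 0 < P.support.card := Finset.card_pos.mpr (support_nonempty.mpr hP)  -- nonempty support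
    by_cases hE : P.eraseLead = 0
    · have hlc : ¬ (SignType.sign P.leadingCoeff = 0) :=
        fun h => (leadingCoeff_ne_zero.mpr hP) (sign_eq_zero_iff.mp h)
      simp only [hE, signVariations_zero, leadingCoeff_zero, sign_zero, neg_zero, hlc, if_false, zero_add]
      omega
    · have hlt : P.eraseLead.support.card < P.support.card := by omega
      have := ih _ hlt P.eraseLead hE rfl
      split_ifs <;> omega

/-! ### rev 5 (B.c): support ⊆ `V15`; `14 ≤ signVariations` forces all fifteen coefficients nonzero -/

theorem V15_toFinset_card : V15.toFinset.card = 15 := by decide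

theorem eg15Poly_coeff (S : Fin 3 → Matrix (Fin 2) (Fin 2) ℝ) (n : ℕ) :
    (eg15Poly S).coeff n =
      (if n = 14 then -(S 0 1 1) else 0) + (if n = 17 then S 0 0 1 + S 0 1 0 else 0) + (if n = 20 then -(S 0 0 0) else 0)
      + (if n = 28 then S 0 0 0 * S 0 1 1 - S 0 0 1 * S 0 1 0 else 0)
      + (if n = 30 then -(S 1 1 1) else 0) + (if n = 33 then S 1 0 1 + S 1 1 0 else 0) + (if n = 36 then -(S 1 0 0) else 0)
      + (if n = 44 then S 0 0 0 * S 1 1 1 + S 0 1 1 * S 1 0 0 - S 0 0 1 * S 1 1 0 - S 0 1 0 * S 1 0 1 else 0)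
      + (if n = 48 then -(S 2 1 1) else 0) + (if n = 51 then S 2 0 1 + S 2 1 0 else 0) + (if n = 54 then -(S 2 0 0) else 0)
      + (if n = 60 then S 1 0 0 * S 1 1 1 - S 1 0 1 * S 1 1 0 else 0)
      + (if n = 62 then S 0 0 0 * S 2 1 1 + S 0 1 1 * S 2 0 0 - S 0 0 1 * S 2 1 0 - S 0 1 0 * S 2 0 1 else 0)
      + (if n = 78 then S 1 0 0 * S 2 1 1 + S 1 1 1 * S 2 0 0 - S 1 0 1 * S 2 1 0 - S 1 1 0 * S 2 0 1 else 0)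
      + (if n = 96 then S 2 0 0 * S 2 1 1 - S 2 0 1 * S 2 1 0 else 0) := by
  rw [eg15Poly_expand]
  simp only [coeff_add, coeff_C_mul, coeff_X_pow, mul_ite, mul_one, mul_zero]

theorem eg15Poly_support_subset (S : Fin 3 → Matrix (Fin 2) (Fin 2) ℝ) : (eg15Poly S).support ⊆ V15.toFinset := by
  intro n hn
  rw [mem_support_iff, eg15Poly_coeff] at hn
  by_contra hV
  simp only [V15, List.toFinset_cons, List.toFinset_nil, Finset.mem_insert, Finset.notMem_empty, or_false, not_or] at hV
  obtain ⟨h14, h17, h20, h28, h30, h33, h36, h44, h48, h51, h54, h60, h62, h78, h96⟩ := hV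
  simp only [h14, h17, h20, h28, h30, h33, h36, h44, h48, h51, h54, h60, h62, h78, h96, if_false, add_zero,
    ne_eq, not_true_eq_false] at hn

theorem eg15Poly_support_eq (S : Fin 3 → Matrix (Fin 2) (Fin 2) ℝ) (h14 : 14 ≤ (eg15Poly S).signVariations) :
    (eg15Poly S).support = V15.toFinset := by
  have hF : eg15Poly S ≠ 0 := by
    intro h; rw [h, signVariations_zero] at h14; omega
  have h1 := signVariations_succ_le_card_support _ hF
  exact Finset.eq_of_subset_of_card_le (eg15Poly_support_subset S) (by rw [V15_toFinset_card]; omega)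

theorem eg15Poly_coeff_ne_zero (S : Fin 3 → Matrix (Fin 2) (Fin 2) ℝ) (h14 : 14 ≤ (eg15Poly S).signVariations)
    {n : ℕ} (hn : n ∈ V15.toFinset) : (eg15Poly S).coeff n ≠ 0 := by
  rw [← mem_support_iff, eg15Poly_support_eq S h14]; exact hn

/-! ### rev 5 (B.d): the extremal case of the slot bound forces sign alternation along the support -/

/-- If the support of `Q` is `insert m T` with `m` above `T`, then `natDegree Q = m`. -/
theorem natDegree_eq_of_support {Q : ℝ[X]} {m : ℕ} {T : Finset ℕ} (hQ : Q.support = insert m T)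
    (hT : ∀ t ∈ T, t < m) : Q.natDegree = m := by
  apply le_antisymm
  · rw [natDegree_le_iff_coeff_eq_zero]
    intro k hk
    by_contra hne
    have hk' : k ∈ Q.support := mem_support_iff.mpr hne
    rw [hQ, Finset.mem_insert] at hk'
    rcases hk' with rfl | hkT
    · exact lt_irrefl _ hk
    · exact lt_asymm hk (hT k hkT)
  · apply le_natDegree_of_ne_zero
    rw [← mem_support_iff, hQ]; exact Finset.mem_insert_self _ _

/-- Alternation along a strictly decreasing exponent list that IS the support, in the extremal case
`length = signVariations + 1`. -/
theorem alternate_of_extremal : ∀ (L : List ℕ) (Q : ℝ[X]), L.Pairwise (· > ·) → Q.support = L.toFinset →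
    L.length ≤ Q.signVariations + 1 →
    L.IsChain (fun a b => SignType.sign (Q.coeff a) = -SignType.sign (Q.coeff b))
  | [], _, _, _, _ => List.IsChain.nil
  | [a], _, _, _, _ => List.IsChain.singleton a
  | a :: b :: L', Q, hsort, hsupp, hlen => by
    have hQ : Q ≠ 0 := by
      intro h; rw [h, support_zero] at hsupp
      have : a ∈ (∅ : Finset ℕ) := by rw [hsupp]; simp
      simp at this
    have hab : ∀ t ∈ (b :: L'), t < a := fun t ht => (List.pairwise_cons.mp hsort).1 t ht
    have hnotin : a ∉ (b :: L').toFinset := by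
      intro h; have := hab a (List.mem_toFinset.mp h); exact lt_irrefl _ this
    have hsupp' : Q.support = insert a (b :: L').toFinset := by rw [hsupp]; simp
    have hdeg : Q.natDegree = a :=
      natDegree_eq_of_support hsupp' (fun t ht => hab t (List.mem_toFinset.mp ht))
    have hEsupp : Q.eraseLead.support = (b :: L').toFinset := by
      rw [eraseLead_support, hdeg, hsupp', Finset.erase_insert hnotin]
    have hsort' : (b :: L').Pairwise (· > ·) := (List.pairwise_cons.mp hsort).2
    have hE : Q.eraseLead ≠ 0 := by
      intro h; rw [h, support_zero] at hEsupp
      have : b ∈ (∅ : Finset ℕ) := by rw [hEsupp]; simp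
      simp at this
    have hnodup : (b :: L').Nodup := hsort'.nodup  -- hmm: Pairwise (>) → Nodup
    have hcardE : Q.eraseLead.support.card = (b :: L').length := by
      rw [hEsupp, List.toFinset_card_of_nodup hnodup]
    have hA := signVariations_succ_le_card_support _ hE
    have hrec := signVariations_eq_eraseLead_add_ite hQ
    -- the `ite` must be 1 and the eraseLead must be extremal again
    have hite : SignType.sign Q.leadingCoeff = -SignType.sign Q.eraseLead.leadingCoeff := by
      by_contra hne
      rw [if_neg hne] at hrec
      simp only [List.length_cons] at hlen hcardE
      omega
    have hlen' : (b :: L').length ≤ Q.eraseLead.signVariations + 1 := by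
      rw [if_pos hite] at hrec
      simp only [List.length_cons] at hlen ⊢
      omega
    have IH := alternate_of_extremal (b :: L') Q.eraseLead hsort' hEsupp hlen'
    -- natDegree of eraseLead Q is b
    have hbL : ∀ t ∈ L', t < b := fun t ht => (List.pairwise_cons.mp hsort').1 t ht
    have hEsupp'' : Q.eraseLead.support = insert b L'.toFinset := by rw [hEsupp]; simp
    have hdegE : Q.eraseLead.natDegree = b :=
      natDegree_eq_of_support hEsupp'' (fun t ht => hbL t (List.mem_toFinset.mp ht))
    -- transfer IH from eraseLead-coefficients to Q-coefficients
    have hcoe : ∀ t ∈ (b :: L'), Q.eraseLead.coeff t = Q.coeff t := by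
      intro t ht
      exact eraseLead_coeff_of_ne t (by rw [hdeg]; exact (hab t ht).ne)
    have IH' : (b :: L').IsChain (fun x y => SignType.sign (Q.coeff x) = -SignType.sign (Q.coeff y)) := by
      refine List.IsChain.imp_of_mem_imp ?_ IH
      intro x y hx hy hxy
      rwa [hcoe x hx, hcoe y hy] at hxy
    refine List.IsChain.cons_cons ?_ IH'
    have h1 : Q.coeff a = Q.leadingCoeff := by rw [leadingCoeff, hdeg]
    have h2 : Q.coeff b = Q.eraseLead.leadingCoeff := by
      rw [leadingCoeff, hdegE, hcoe b (List.mem_cons_self)]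
    rw [h1, h2]; exact hite

/-! ### rev 5 (B.e): the chart law and the four-hypothesis reduction -/

theorem V15_reverse_pairwise : V15.reverse.Pairwise (· > ·) := by decide

theorem V15_reverse_toFinset : V15.reverse.toFinset = V15.toFinset := List.toFinset_reverse

theorem up_pos {a b : ℝ} (h : SignType.sign a = -SignType.sign b) (hb : b < 0) : 0 < a := by
  rw [sign_neg hb, neg_neg] at h
  exact sign_eq_one_iff.mp h

theorem up_neg {a b : ℝ} (h : SignType.sign a = -SignType.sign b) (hb : 0 < b) : a < 0 := by
  rw [sign_pos hb] at h
  exact sign_eq_neg_one_iff.mp h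

theorem eg15ChartLaw_holds : EG15ChartLaw := by
  intro S hS h14
  set F := eg15Poly S with hFdef
  have hsupp : F.support = V15.reverse.toFinset := by rw [V15_reverse_toFinset]; exact eg15Poly_support_eq S h14
  have hchain := alternate_of_extremal V15.reverse F V15_reverse_pairwise hsupp
    (by simp only [V15, List.reverse_cons, List.reverse_nil, List.nil_append, List.cons_append, List.length_cons,
      List.length_nil]; omega)
  simp only [V15, List.reverse_cons, List.reverse_nil, List.nil_append, List.cons_append, List.isChain_cons_cons,
    List.isChain_singleton, and_true] at hchain
  obtain ⟨r96, r78, r62, r60, r54, r51, r48, r44, r36, r33, r30, r28, r20, r17⟩ := hchain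
  -- coefficient values
  have cf := eg15Poly_coeff S
  have c14 : F.coeff 14 = -(S 0 1 1) := by rw [hFdef, cf]; norm_num
  have c17 : F.coeff 17 = S 0 0 1 + S 0 1 0 := by rw [hFdef, cf]; norm_num
  have c20 : F.coeff 20 = -(S 0 0 0) := by rw [hFdef, cf]; norm_num
  have c28 : F.coeff 28 = S 0 0 0 * S 0 1 1 - S 0 0 1 * S 0 1 0 := by rw [hFdef, cf]; norm_num
  have c30 : F.coeff 30 = -(S 1 1 1) := by rw [hFdef, cf]; norm_num
  have c33 : F.coeff 33 = S 1 0 1 + S 1 1 0 := by rw [hFdef, cf]; norm_num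
  have c36 : F.coeff 36 = -(S 1 0 0) := by rw [hFdef, cf]; norm_num
  have c44 : F.coeff 44 = S 0 0 0 * S 1 1 1 + S 0 1 1 * S 1 0 0 - S 0 0 1 * S 1 1 0 - S 0 1 0 * S 1 0 1 := by
    rw [hFdef, cf]; norm_num
  have c48 : F.coeff 48 = -(S 2 1 1) := by rw [hFdef, cf]; norm_num
  have c51 : F.coeff 51 = S 2 0 1 + S 2 1 0 := by rw [hFdef, cf]; norm_num
  have c54 : F.coeff 54 = -(S 2 0 0) := by rw [hFdef, cf]; norm_num
  have c60 : F.coeff 60 = S 1 0 0 * S 1 1 1 - S 1 0 1 * S 1 1 0 := by rw [hFdef, cf]; norm_num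
  have c62 : F.coeff 62 = S 0 0 0 * S 2 1 1 + S 0 1 1 * S 2 0 0 - S 0 0 1 * S 2 1 0 - S 0 1 0 * S 2 0 1 := by
    rw [hFdef, cf]; norm_num
  have c78 : F.coeff 78 = S 1 0 0 * S 2 1 1 + S 1 1 1 * S 2 0 0 - S 1 0 1 * S 2 1 0 - S 1 1 0 * S 2 0 1 := by
    rw [hFdef, cf]; norm_num
  have c96 : F.coeff 96 = S 2 0 0 * S 2 1 1 - S 2 0 1 * S 2 1 0 := by rw [hFdef, cf]; norm_num
  have s0 : S 0 1 0 = S 0 0 1 := (hS 0).apply 0 1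
  have s1 : S 1 1 0 = S 1 0 1 := (hS 1).apply 0 1
  have s2 : S 2 1 0 = S 2 0 1 := (hS 2).apply 0 1
  have hd0 : (S 0).det = F.coeff 28 := by rw [c28, Matrix.det_fin_two]
  have hd1 : (S 1).det = F.coeff 60 := by rw [c60, Matrix.det_fin_two]
  have hd2 : (S 2).det = F.coeff 96 := by rw [c96, Matrix.det_fin_two]
  have hp01 : polar (S 0) (S 1) = F.coeff 44 := by rw [c44, polar, s0, s1]; ring
  have hp02 : polar (S 0) (S 2) = F.coeff 62 := by rw [c62, polar, s0, s2]; ring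
  have hp12 : polar (S 1) (S 2) = F.coeff 78 := by rw [c78, polar, s1, s2]; ring
  have hne14 : F.coeff 14 ≠ 0 := eg15Poly_coeff_ne_zero S h14 (by decide)
  rcases lt_or_gt_of_ne hne14 with hlt | hgt
  · -- coefficient at 14 negative: chart (+,+,+)
    left
    have h17 := up_pos r17 hlt
    have h20 := up_neg r20 h17
    have h28 := up_pos r28 h20
    have h30 := up_neg r30 h28
    have h33 := up_pos r33 h30
    have h36 := up_neg r36 h33
    have h44 := up_pos r44 h36
    have h48 := up_neg r48 h44
    have h51 := up_pos r51 h48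
    have h54 := up_neg r54 h51
    have h60 := up_pos r60 h54
    have h62 := up_neg r62 h60
    have h78 := up_pos r78 h62
    have h96 := up_neg r96 h78
    rw [c14] at hlt; rw [c17] at h17; rw [c20] at h20; rw [c30] at h30; rw [c33] at h33; rw [c36] at h36
    rw [c48] at h48; rw [c51] at h51; rw [c54] at h54
    refine ⟨?_, by rw [hd0]; exact h28, by rw [hp01]; exact h44, by rw [hd1]; exact h60, by rw [hp02]; exact h62,
      by rw [hp12]; exact h78, by rw [hd2]; exact h96⟩
    intro a i j
    have ka : a = 0 ∨ a = 1 ∨ a = 2 := by fin_cases a <;> simp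
    have ki : i = 0 ∨ i = 1 := by fin_cases i <;> simp
    have kj : j = 0 ∨ j = 1 := by fin_cases j <;> simp
    rcases ka with rfl | rfl | rfl <;> rcases ki with rfl | rfl <;> rcases kj with rfl | rfl <;> linarith
  · -- coefficient at 14 positive: chart (−,−,−)
    right
    have h17 := up_neg r17 hgt
    have h20 := up_pos r20 h17
    have h28 := up_neg r28 h20
    have h30 := up_pos r30 h28
    have h33 := up_neg r33 h30
    have h36 := up_pos r36 h33
    have h44 := up_neg r44 h36
    have h48 := up_pos r48 h44
    have h51 := up_neg r51 h48
    have h54 := up_pos r54 h51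
    have h60 := up_neg r60 h54
    have h62 := up_pos r62 h60
    have h78 := up_neg r78 h62
    have h96 := up_pos r96 h78
    rw [c14] at hgt; rw [c17] at h17; rw [c20] at h20; rw [c30] at h30; rw [c33] at h33; rw [c36] at h36
    rw [c48] at h48; rw [c51] at h51; rw [c54] at h54
    refine ⟨?_, by rw [hd0]; exact h28, by rw [hp01]; exact h44, by rw [hd1]; exact h60, by rw [hp02]; exact h62,
      by rw [hp12]; exact h78, by rw [hd2]; exact h96⟩
    intro a i j
    have ka : a = 0 ∨ a = 1 ∨ a = 2 := by fin_cases a <;> simp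
    have ki : i = 0 ∨ i = 1 := by fin_cases i <;> simp
    have kj : j = 0 ∨ j = 1 := by fin_cases j <;> simp
    rcases ka with rfl | rfl | rfl <;> rcases ki with rfl | rfl <;> rcases kj with rfl | rfl <;> linarith

/-- **The reduction of record after rev 5 (FOUR hypotheses: two finite certificates + two paper lemmas).** -/
theorem eg15_of_critBudget4 (hWR : WronskianRolle) (hΓP : EG15CritLawP) (hBM : EG15BookkeepingM) (hΓM : EG15CritLawM) :
    EG15 :=
  eg15_of_critBudget5 eg15ChartLaw_holds hWR hΓP hBM hΓM


/-! ## rev 6 (val-idea-15 g6, 2026-08-29) — BOTH BOOKKEEPINGS ARE KERNEL: `EG15 ⟸ EG15CritLawP ∧ EG15CritLawM`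

Pure insertion after rev 5 (nothing above this line changed).  Contents:
(a) INERTIA CONFINEMENT on chart (−,−,−): `eg15Poly_eval_pos_of_chartM_of_D_pos` — at `y > 0` with `D(y) > 0` one has `F(y) > 0`
    (identity `p₁₁·N = (y³p₁₁ − p₁₂)² + D`), so positive zeros of `g` lie in `{D ≤ 0}`;
(b) MULTIPLICITY DOMINATION: `mult_t(H) − 1 ≤ mult_t(W(G,H))`, and `mult_t(H) ≤ mult_t(W(G,H))` at a common zero of `G` and `H`;
(c) ROLLE WITH MULTIPLICITY for `H/G` on a pole-free open interval: `card_roots_Ioo_le_wronskian`;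
(d) chart (+,+,+) bookkeeping in the kernel, `Z₊(g) ≤ Z₊(Γ₁₅) + 2` (`posRootCard_eg15Poly_le_chartP`), and `eg15_of_critBudget3`;
(e) DESCARTES FOR `D` on chart (−,−,−): `eg15D_descartes_chartM` (three sign variations, `natDegree = 68`, `lc > 0`), hence at most
    three positive poles with multiplicity;
(f) chart (−,−,−) bookkeeping in the kernel: `eg15BookkeepingM_holds : EG15BookkeepingM` (gap / point / chain lemmas, the gap budget
    `gapNeg_le_two`: the last gap is positive and two adjacent negative gaps would make the pole between them a double zero of `D`), and
    the TWO-HYPOTHESIS REDUCTION OF RECORD `eg15_of_certificates : EG15CritLawP → EG15CritLawM → EG15`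
    (axioms: propext, Classical.choice, Quot.sound).
`WronskianRolle` is no longer load-bearing; `EG15BookkeepingM` is now a theorem.  OPEN and NOT asserted anywhere in this file:
`EG15CritLawP`, `EG15CritLawM` (the two finite certificates of `wall_bubbling_EndDoor_PRED-critbudget.md`), `EG15`, `DoorA26`, (W), (M), (R). -/

/-! ### rev 6 (a): inertia confinement on chart (−,−,−) -/

/-- `N(y)` by entries. -/
theorem eg15N_eval (S : Fin 3 → Matrix (Fin 2) (Fin 2) ℝ) (y : ℝ) :
    (eg15N S).eval y =
      (S 0 1 1 + y ^ 16 * S 1 1 1 + y ^ 34 * S 2 1 1) - y ^ 3 * (S 0 0 1 + y ^ 16 * S 1 0 1 + y ^ 34 * S 2 0 1)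
        - y ^ 3 * (S 0 1 0 + y ^ 16 * S 1 1 0 + y ^ 34 * S 2 1 0) + y ^ 6 * (S 0 0 0 + y ^ 16 * S 1 0 0 + y ^ 34 * S 2 0 0) := by
  simp only [eg15N, eg15Pencil, eval_sub, eval_add, eval_mul, eval_pow, eval_X]
  simp [Matrix.add_apply, Matrix.smul_apply, Matrix.map_apply]
  ring

/-- INERTIA CONFINEMENT on chart (−,−,−) (memo §7.12 (n), first clause): where `D(y) > 0` (`y > 0`) the pencil value
`P(y)` is negative definite (its diagonal is negative), hence `adj P(y) ≺ 0`, `N(y) = wᵀ adj P(y) w < 0` and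
`g(y) = y¹⁴ (y¹⁴ D(y) − N(y)) > 0`: the positive zeros of `g` on chart (−,−,−) lie in `{D ≤ 0}`.  Elementary form used:
`p₁₁ · N = (y³ p₁₁ − p₁₂)² + det P`. -/
theorem eg15Poly_eval_pos_of_chartM_of_D_pos (S : Fin 3 → Matrix (Fin 2) (Fin 2) ℝ) (hS : ∀ a, (S a).IsSymm)
    (hneg : ∀ a i j, S a i j < 0) {y : ℝ} (hy : 0 < y) (hD : 0 < (eg15D S).eval y) :
    0 < (eg15Poly S).eval y := by
  have s0 : S 0 1 0 = S 0 0 1 := (hS 0).apply 0 1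
  have s1 : S 1 1 0 = S 1 0 1 := (hS 1).apply 0 1
  have s2 : S 2 1 0 = S 2 0 1 := (hS 2).apply 0 1
  rw [eg15D_eval, s0, s1, s2] at hD
  rw [eg15Poly_eq, eval_mul, eval_pow, eval_X, eval_sub, eval_mul, eval_pow, eval_X, eg15D_eval, eg15N_eval,
    s0, s1, s2]
  set p₁₁ := S 0 0 0 + y ^ 16 * S 1 0 0 + y ^ 34 * S 2 0 0 with hp₁₁
  set p₁₂ := S 0 0 1 + y ^ 16 * S 1 0 1 + y ^ 34 * S 2 0 1 with hp₁₂
  set p₂₂ := S 0 1 1 + y ^ 16 * S 1 1 1 + y ^ 34 * S 2 1 1 with hp₂₂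
  have hy16 : 0 < y ^ 16 := pow_pos hy 16
  have hy34 : 0 < y ^ 34 := pow_pos hy 34
  have hy3 : 0 < y ^ 3 := pow_pos hy 3
  have hy14 : 0 < y ^ 14 := pow_pos hy 14
  have h11 : p₁₁ < 0 := by
    have := hneg 0 0 0; have := hneg 1 0 0; have := hneg 2 0 0; nlinarith
  -- `p₁₁ · N = (y³ p₁₁ − p₁₂)² + det P > 0`, hence `N < 0`
  have hN : p₂₂ - y ^ 3 * p₁₂ - y ^ 3 * p₁₂ + (y ^ 3) ^ 2 * p₁₁ < 0 := by
    have key : p₁₁ * (p₂₂ - y ^ 3 * p₁₂ - y ^ 3 * p₁₂ + (y ^ 3) ^ 2 * p₁₁)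
        = (y ^ 3 * p₁₁ - p₁₂) ^ 2 + (p₁₁ * p₂₂ - p₁₂ * p₁₂) := by ring
    have hpos : 0 < p₁₁ * (p₂₂ - y ^ 3 * p₁₂ - y ^ 3 * p₁₂ + (y ^ 3) ^ 2 * p₁₁) := by
      rw [key]; nlinarith [sq_nonneg (y ^ 3 * p₁₁ - p₁₂)]
    by_contra hge
    rw [not_lt] at hge
    nlinarith
  have hy6 : y ^ 6 = (y ^ 3) ^ 2 := by ring
  rw [hy6]
  have : 0 < y ^ 14 * (p₁₁ * p₂₂ - p₁₂ * p₁₂) - (p₂₂ - y ^ 3 * p₁₂ - y ^ 3 * p₁₂ + (y ^ 3) ^ 2 * p₁₁) := by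
    nlinarith
  exact mul_pos hy14 this

/-! ### rev 6 (b): ROLLE WITH MULTIPLICITY FOR A QUOTIENT — multiplicity domination by the Wronskian -/

/-- `(X - C t)^(m-1) ∣ W(G,H)` where `m = rootMultiplicity t H`. -/
theorem pow_rootMultiplicity_sub_one_dvd_wronskian (G H : ℝ[X]) (t : ℝ) :
    (X - C t) ^ (H.rootMultiplicity t - 1) ∣ wronskian G H := by
  have h1 : (X - C t) ^ (H.rootMultiplicity t - 1) ∣ H :=
    (pow_dvd_pow _ (Nat.sub_le _ _)).trans (pow_rootMultiplicity_dvd H t)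
  have h2 : (X - C t) ^ (H.rootMultiplicity t - 1) ∣ derivative H := by
    by_cases hH' : derivative H = 0
    · rw [hH']; exact dvd_zero _
    · exact (le_rootMultiplicity_iff hH').mp (rootMultiplicity_sub_one_le_derivative_rootMultiplicity H t)
  unfold wronskian
  exact dvd_sub (dvd_mul_of_dvd_right h2 G) (dvd_mul_of_dvd_right h1 _)

theorem rootMultiplicity_sub_one_le_wronskian (G H : ℝ[X]) (t : ℝ) (hW : wronskian G H ≠ 0) :
    H.rootMultiplicity t - 1 ≤ (wronskian G H).rootMultiplicity t :=
  (le_rootMultiplicity_iff hW).mpr (pow_rootMultiplicity_sub_one_dvd_wronskian G H t)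

/-- At a COMMON zero `t` of `G` and `H`: `mult_t H ≤ mult_t W(G,H)`. -/
theorem rootMultiplicity_le_wronskian_of_common_root (G H : ℝ[X]) (t : ℝ) (hW : wronskian G H ≠ 0)
    (hG : G.IsRoot t) : H.rootMultiplicity t ≤ (wronskian G H).rootMultiplicity t := by
  rw [le_rootMultiplicity_iff hW]
  set m := H.rootMultiplicity t
  have hX : (X - C t) ∣ G := dvd_iff_isRoot.mpr hG
  have h1 : (X - C t) ^ m ∣ H := pow_rootMultiplicity_dvd H t
  have h2 : (X - C t) ^ (m - 1) ∣ derivative H := by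
    by_cases hH' : derivative H = 0
    · rw [hH']; exact dvd_zero _
    · exact (le_rootMultiplicity_iff hH').mp (rootMultiplicity_sub_one_le_derivative_rootMultiplicity H t)
  unfold wronskian
  refine dvd_sub ?_ (dvd_mul_of_dvd_right h1 _)
  -- (X - C t) * (X - C t)^(m-1) ∣ G * H'
  rcases Nat.eq_zero_or_pos m with hm | hm
  · rw [hm, pow_zero]; exact one_dvd _
  · have : (X - C t) ^ m = (X - C t) * (X - C t) ^ (m - 1) := by
      rw [← pow_succ', Nat.sub_add_cancel hm]
    rw [this]
    exact mul_dvd_mul hX h2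

/-! ### rev 6 (c): Rolle with multiplicity for `H/G` on a pole-free open interval (general lemma; Mathlib's
`card_roots_le_derivative` pattern with `Finset.card_le_sdiff_of_interleaved`) -/

/-- Between two zeros `x < y` of `H` with `G ≠ 0` on `[x, y]`, the Wronskian `W(G,H)` vanishes somewhere in `(x, y)`. -/
theorem exists_wronskian_root_between (G H : ℝ[X]) {x y : ℝ} (hxy : x < y)
    (hG : ∀ u ∈ Set.Icc x y, G.eval u ≠ 0) (hx : H.eval x = 0) (hy : H.eval y = 0) :
    ∃ z ∈ Set.Ioo x y, (wronskian G H).eval z = 0 := by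
  set φ : ℝ → ℝ := fun u => H.eval u / G.eval u with hφ
  have hcont : ContinuousOn φ (Set.Icc x y) :=
    (H.continuousOn).div (G.continuousOn) (fun u hu => hG u hu)
  have hends : φ x = φ y := by simp only [hφ, hx, hy, zero_div]
  obtain ⟨z, hz, hz0⟩ := exists_deriv_eq_zero hxy hcont hends
  refine ⟨z, hz, ?_⟩
  have hGz : G.eval z ≠ 0 := hG z (Set.Ioo_subset_Icc_self hz)
  have hd := (H.hasDerivAt z).div (G.hasDerivAt z) hGz
  have e : φ = ((fun u => H.eval u) / fun u => G.eval u) := rfl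
  rw [e, hd.deriv] at hz0
  rw [div_eq_zero_iff, or_iff_left (pow_ne_zero 2 hGz)] at hz0
  simp only [wronskian, eval_sub, eval_mul]
  linarith

/-- **Rolle with multiplicity for a quotient.** On an open interval free of zeros of `G`, the zeros of `H` (with multiplicity)
number at most the zeros of `W(G,H) = G H′ − G′ H` (with multiplicity) plus one. -/
theorem card_roots_Ioo_le_wronskian (G H : ℝ[X]) (a b : ℝ) (hW : wronskian G H ≠ 0)
    (hG : ∀ u ∈ Set.Ioo a b, G.eval u ≠ 0) :
    (H.roots.filter (· ∈ Set.Ioo a b)).card ≤ ((wronskian G H).roots.filter (· ∈ Set.Ioo a b)).card + 1 := by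
  classical
  have hH : H ≠ 0 := by
    intro h; apply hW; simp [wronskian, h]
  set I := Set.Ioo a b
  set MH := H.roots.filter (· ∈ I) with hMH
  set MW := (wronskian G H).roots.filter (· ∈ I) with hMW
  -- distinct zeros interleave
  have hinter : MH.toFinset.card ≤ (MW.toFinset \ MH.toFinset).card + 1 := by
    refine Finset.card_le_sdiff_of_interleaved fun x hx y hy hxy _ => ?_
    rw [Multiset.mem_toFinset, hMH, Multiset.mem_filter, mem_roots hH] at hx hy
    have hsub : Set.Icc x y ⊆ I := Set.Icc_subset_Ioo hx.2.1 hy.2.2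
    obtain ⟨z, hz, hz0⟩ := exists_wronskian_root_between G H hxy (fun u hu => hG u (hsub hu)) hx.1 hy.1
    refine ⟨z, ?_, hz.1, hz.2⟩
    rw [Multiset.mem_toFinset, hMW, Multiset.mem_filter, mem_roots hW]
    exact ⟨hz0, hsub (Set.Ioo_subset_Icc_self hz)⟩
  -- counts on the filtered multisets
  have hcountH : ∀ x ∈ MH.toFinset, MH.count x = H.rootMultiplicity x := by
    intro x hx
    rw [Multiset.mem_toFinset, hMH, Multiset.mem_filter] at hx
    rw [hMH, Multiset.count_filter_of_pos hx.2, count_roots]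
  have hcountW : ∀ x, x ∈ I → MW.count x = (wronskian G H).rootMultiplicity x := by
    intro x hx
    rw [hMW, Multiset.count_filter_of_pos hx, count_roots]
  have hmemI : ∀ x ∈ MH.toFinset, x ∈ I := by
    intro x hx
    rw [Multiset.mem_toFinset, hMH, Multiset.mem_filter] at hx
    exact hx.2
  calc MH.card = ∑ x ∈ MH.toFinset, MH.count x := (Multiset.toFinset_sum_count_eq _).symm
    _ = ∑ x ∈ MH.toFinset, (MH.count x - 1 + 1) :=
      (Eq.symm <| Finset.sum_congr rfl fun _ hx => tsub_add_cancel_of_le <|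
        Nat.succ_le_iff.2 <| Multiset.count_pos.2 <| Multiset.mem_toFinset.1 hx)
    _ = (∑ x ∈ MH.toFinset, (MH.count x - 1)) + MH.toFinset.card := by
      simp only [Finset.sum_add_distrib, Finset.card_eq_sum_ones]
    _ ≤ (∑ x ∈ MH.toFinset, MW.count x) + ((MW.toFinset \ MH.toFinset).card + 1) := by
      refine add_le_add (Finset.sum_le_sum fun x hx => ?_) hinter
      rw [hcountH x hx, hcountW x (hmemI x hx)]
      exact rootMultiplicity_sub_one_le_wronskian G H x hW
    _ ≤ (∑ x ∈ MH.toFinset, MW.count x) + ((∑ x ∈ MW.toFinset \ MH.toFinset, MW.count x) + 1) := by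
      simp only [Finset.card_eq_sum_ones]
      gcongr with x hx
      rw [Nat.succ_le_iff, Multiset.count_pos, ← Multiset.mem_toFinset]
      exact (Finset.mem_sdiff.1 hx).1
    _ = MW.card + 1 := by
      rw [← add_assoc, ← Finset.sum_union Finset.disjoint_sdiff, Finset.union_sdiff_self_eq_union, ←
        Multiset.toFinset_sum_count_eq, ← Finset.sum_subset Finset.subset_union_right]
      intro x _ hx₂
      simpa only [Multiset.mem_toFinset, Multiset.count_eq_zero] using hx₂

/-! ### rev 6 (d): positive-root bookkeeping around at most one pole, and the chart (+,+,+) bound in the kernel -/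

/-- Splitting the positive part of a multiset at a point `t₀` below a ceiling `B`. -/
theorem card_filter_pos_split (M : Multiset ℝ) {t₀ : ℝ} (B : ℝ) (ht₀ : 0 < t₀) :
    (M.filter (· ∈ Set.Ioo 0 t₀)).card + M.count t₀ + (M.filter (· ∈ Set.Ioo t₀ B)).card
      ≤ (M.filter (fun x => 0 < x)).card := by
  classical
  have d1 : M.filter (· ∈ Set.Ioo 0 t₀) + M.filter (fun x => t₀ = x) = M.filter (fun x => x ∈ Set.Ioo 0 t₀ ∨ t₀ = x) := by
    rw [Multiset.filter_add_filter]
    have : M.filter (fun x => x ∈ Set.Ioo 0 t₀ ∧ t₀ = x) = 0 := by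
      rw [Multiset.filter_eq_nil]
      rintro x - ⟨⟨-, hx⟩, rfl⟩
      exact lt_irrefl _ hx
    rw [this, add_zero]
  have d2 : M.filter (fun x => x ∈ Set.Ioo 0 t₀ ∨ t₀ = x) + M.filter (· ∈ Set.Ioo t₀ B)
      = M.filter (fun x => (x ∈ Set.Ioo 0 t₀ ∨ t₀ = x) ∨ x ∈ Set.Ioo t₀ B) := by
    rw [Multiset.filter_add_filter]
    have : M.filter (fun x => (x ∈ Set.Ioo 0 t₀ ∨ t₀ = x) ∧ x ∈ Set.Ioo t₀ B) = 0 := by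
      rw [Multiset.filter_eq_nil]
      rintro x - ⟨h1 | rfl, ⟨h3, -⟩⟩
      · exact lt_irrefl _ (h1.2.trans h3)
      · exact lt_irrefl _ h3
    rw [this, add_zero]
  rw [Multiset.count_eq_card_filter_eq, ← Multiset.card_add, d1, ← Multiset.card_add, d2]
  apply Multiset.card_le_card
  apply Multiset.monotone_filter_right
  rintro x ((h1 | rfl) | h3)
  · exact h1.1
  · exact ht₀
  · exact ht₀.trans h3.1

theorem card_filter_pos_split_eq (M : Multiset ℝ) {t₀ B : ℝ} (ht₀ : 0 < t₀) (hB : t₀ < B)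
    (hall : ∀ x ∈ M, 0 < x → x < B) :
    (M.filter (· ∈ Set.Ioo 0 t₀)).card + M.count t₀ + (M.filter (· ∈ Set.Ioo t₀ B)).card
      = (M.filter (fun x => 0 < x)).card := by
  classical
  have d1 : M.filter (· ∈ Set.Ioo 0 t₀) + M.filter (fun x => t₀ = x) = M.filter (fun x => x ∈ Set.Ioo 0 t₀ ∨ t₀ = x) := by
    rw [Multiset.filter_add_filter]
    have : M.filter (fun x => x ∈ Set.Ioo 0 t₀ ∧ t₀ = x) = 0 := by
      rw [Multiset.filter_eq_nil]
      rintro x - ⟨⟨-, hx⟩, rfl⟩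
      exact lt_irrefl _ hx
    rw [this, add_zero]
  have d2 : M.filter (fun x => x ∈ Set.Ioo 0 t₀ ∨ t₀ = x) + M.filter (· ∈ Set.Ioo t₀ B)
      = M.filter (fun x => (x ∈ Set.Ioo 0 t₀ ∨ t₀ = x) ∨ x ∈ Set.Ioo t₀ B) := by
    rw [Multiset.filter_add_filter]
    have : M.filter (fun x => (x ∈ Set.Ioo 0 t₀ ∨ t₀ = x) ∧ x ∈ Set.Ioo t₀ B) = 0 := by
      rw [Multiset.filter_eq_nil]
      rintro x - ⟨h1 | rfl, ⟨h3, -⟩⟩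
      · exact lt_irrefl _ (h1.2.trans h3)
      · exact lt_irrefl _ h3
    rw [this, add_zero]
  rw [Multiset.count_eq_card_filter_eq, ← Multiset.card_add, d1, ← Multiset.card_add, d2]
  congr 1
  apply Multiset.filter_congr
  intro x hx
  constructor
  · rintro ((h1 | rfl) | h3)
    · exact h1.1
    · exact ht₀
    · exact ht₀.trans h3.1
  · intro hpos
    rcases lt_trichotomy x t₀ with hlt | rfl | hgt
    · exact Or.inl (Or.inl ⟨hpos, hlt⟩)
    · exact Or.inl (Or.inr rfl)
    · exact Or.inr ⟨hgt, hall x hx hpos⟩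

/-- **Chart (+,+,+) bookkeeping in the kernel** (replaces the use of `WronskianRolle` + `EG15PoleLawP` on this chart):
`Z₊(g) ≤ Z₊(Γ₁₅) + 2`.  Proof: `g = X¹⁴ h`, `h = X¹⁴D − N`, `W(X¹⁴D, h) = X¹³ Γ₁₅`; the positive zeros of `D` form at most one
point `t₀` (`eg15D_eval_pos_below_root`); Rolle with multiplicity (`card_roots_Ioo_le_wronskian`) on `(0,t₀)` and `(t₀,B)` and
multiplicity domination at `t₀` (`rootMultiplicity_le_wronskian_of_common_root`). -/
theorem posRootCard_eg15Poly_le_chartP (S : Fin 3 → Matrix (Fin 2) (Fin 2) ℝ) (hS : ∀ a, (S a).IsSymm)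
    (hP : EG15ChartP S) : posRootCard (eg15Poly S) ≤ posRootCard (eg15Gamma S) + 2 := by
  classical
  obtain ⟨hpos, hd3, hp34, hd4, -, -, -⟩ := hP
  set D := eg15D S with hDdef
  set G : ℝ[X] := X ^ 14 * D with hGdef
  set h : ℝ[X] := X ^ 14 * D - eg15N S with hhdef
  have hΓ : eg15Gamma S ≠ 0 := eg15Gamma_ne_zero S hd3.ne' (hpos 0 1 1).ne'
  have hWh : wronskian G h = X ^ 13 * eg15Gamma S := by
    rw [hhdef, sub_eq_add_neg, wronskian_add_right, wronskian_neg_right, hGdef, wronskian_self_eq_zero,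
      wronskian_eg15, neg_neg, zero_add]
  have hW : wronskian G h ≠ 0 := by
    rw [hWh]; exact mul_ne_zero (pow_ne_zero _ X_ne_zero) hΓ
  have hh : h ≠ 0 := by intro h0; apply hW; simp [wronskian, h0]
  -- reduce to `h` and `W`
  have e1 : posRootCard (eg15Poly S) = posRootCard h := by rw [eg15Poly_eq, posRootCard_X_pow_mul]
  have e2 : posRootCard (wronskian G h) = posRootCard (eg15Gamma S) := by rw [hWh, posRootCard_X_pow_mul]
  rw [e1, ← e2]
  -- positive zeros of `G` are positive zeros of `D`, and any two coincide
  have hGroot : ∀ u, 0 < u → G.eval u = 0 → D.eval u = 0 := by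
    intro u hu hGu
    rw [hGdef, eval_mul, eval_pow, eval_X] at hGu
    rcases mul_eq_zero.mp hGu with h1 | h1
    · exact absurd h1 (pow_ne_zero _ hu.ne')
    · exact h1
  have huniq : ∀ u v, 0 < u → 0 < v → D.eval u = 0 → D.eval v = 0 → u = v := by
    intro u v hu hv hDu hDv
    by_contra hne
    rcases lt_or_gt_of_ne hne with hlt | hgt
    · exact (eg15D_eval_pos_below_root S hS hpos hd3 hp34 hd4 hu hlt hDv).ne' hDu
    · exact (eg15D_eval_pos_below_root S hS hpos hd3 hp34 hd4 hv hgt hDu).ne' hDv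
  -- a ceiling above every positive zero of `h`
  set Mh := h.roots with hMh
  set MW := (wronskian G h).roots with hMW
  obtain ⟨B₀, hB₀⟩ : ∃ B₀ : ℝ, ∀ x ∈ Mh, x < B₀ := by
    refine ⟨(Mh.map (fun x => |x|)).sum + 1, fun x hx => ?_⟩
    have h1 : |x| ≤ (Mh.map (fun x => |x|)).sum :=
      Multiset.single_le_sum (fun y hy => by obtain ⟨z, -, rfl⟩ := Multiset.mem_map.mp hy; exact abs_nonneg z) _
        (Multiset.mem_map_of_mem _ hx)
    have h2 : x ≤ |x| := le_abs_self x
    linarith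
  by_cases hex : ∃ t₀, 0 < t₀ ∧ D.eval t₀ = 0
  · obtain ⟨t₀, ht₀, hDt₀⟩ := hex
    set B := max B₀ t₀ + 1 with hBdef
    have htB : t₀ < B := by rw [hBdef]; have := le_max_right B₀ t₀; linarith
    have hallh : ∀ x ∈ Mh, 0 < x → x < B := by
      intro x hx _; rw [hBdef]; have := hB₀ x hx; have := le_max_left B₀ t₀; linarith
    -- G has no zero in (0,t₀) or (t₀,B)
    have hG1 : ∀ u ∈ Set.Ioo 0 t₀, G.eval u ≠ 0 := by
      intro u hu hGu
      exact (ne_of_lt hu.2) (huniq u t₀ hu.1 ht₀ (hGroot u hu.1 hGu) hDt₀)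
    have hG2 : ∀ u ∈ Set.Ioo t₀ B, G.eval u ≠ 0 := by
      intro u hu hGu
      exact (ne_of_gt hu.1) (huniq u t₀ (ht₀.trans hu.1) ht₀ (hGroot u (ht₀.trans hu.1) hGu) hDt₀)
    have r1 := card_roots_Ioo_le_wronskian G h 0 t₀ hW hG1
    have r2 := card_roots_Ioo_le_wronskian G h t₀ B hW hG2
    have hGt₀ : G.IsRoot t₀ := by
      rw [IsRoot, hGdef, eval_mul, eval_pow, eval_X, hDt₀, mul_zero]
    have r3 := rootMultiplicity_le_wronskian_of_common_root G h t₀ hW hGt₀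
    rw [← count_roots, ← count_roots] at r3
    have sh := card_filter_pos_split_eq Mh ht₀ htB hallh
    have sW := card_filter_pos_split MW B ht₀
    unfold posRootCard
    rw [← hMh, ← hMW] at *
    omega
  · -- no positive pole: one interval (0, B)
    simp only [not_exists, not_and] at hex
    set B := B₀ with hBdef
    have hGI : ∀ u ∈ Set.Ioo 0 B, G.eval u ≠ 0 := fun u hu hGu => hex u hu.1 (hGroot u hu.1 hGu)
    have r1 := card_roots_Ioo_le_wronskian G h 0 B hW hGI
    rw [← hMh, ← hMW] at r1
    have eh : Mh.filter (fun x => 0 < x) = Mh.filter (· ∈ Set.Ioo 0 B) :=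
      Multiset.filter_congr fun x hx => ⟨fun hp => ⟨hp, hB₀ x hx⟩, fun hI => hI.1⟩
    have eW : (MW.filter (· ∈ Set.Ioo 0 B)).card ≤ (MW.filter (fun x => 0 < x)).card :=
      Multiset.card_le_card (Multiset.monotone_filter_right _ (fun x hx => hx.1))
    unfold posRootCard
    rw [← hMh, ← hMW, eh]
    omega

/-- **The reduction of record after rev 6 (THREE hypotheses): EG15 ⟸ CERTIFICATE (+) ∧ inertia bookkeeping (−) ∧ CERTIFICATE (−).**
Chart law, pole law and chart-(+) Rolle bookkeeping are kernel; `WronskianRolle` is no longer load-bearing. -/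
theorem eg15_of_critBudget3 (hΓP : EG15CritLawP) (hBM : EG15BookkeepingM) (hΓM : EG15CritLawM) : EG15 := by
  intro S hS
  show posRootCard (eg15Poly S) ≤ 13
  by_cases h14 : 14 ≤ (eg15Poly S).signVariations
  · rcases eg15ChartLaw_holds S hS h14 with hP | hM
    · have h1 := posRootCard_eg15Poly_le_chartP S hS hP
      have h2 := hΓP S hS hP
      omega
    · have h1 := hBM S hS hM
      have h2 := hΓM S hS hM
      omega
  · have h1 := posRootCard_le_signVariations (eg15Poly S)
    omega


/-! ### rev 6 (e): Descartes for the pole polynomial `D` on chart (−,−,−): at most three positive poles with multiplicity -/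

/-- `D` written out (no symmetry assumed). -/
theorem eg15D_expand (S : Fin 3 → Matrix (Fin 2) (Fin 2) ℝ) :
    eg15D S = C (S 0 0 0 * S 0 1 1 - S 0 0 1 * S 0 1 0)
      + C (S 0 0 0 * S 1 1 1 + S 0 1 1 * S 1 0 0 - S 0 0 1 * S 1 1 0 - S 0 1 0 * S 1 0 1) * X ^ 16
      + C (S 1 0 0 * S 1 1 1 - S 1 0 1 * S 1 1 0) * X ^ 32
      + C (S 0 0 0 * S 2 1 1 + S 0 1 1 * S 2 0 0 - S 0 0 1 * S 2 1 0 - S 0 1 0 * S 2 0 1) * X ^ 34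
      + C (S 1 0 0 * S 2 1 1 + S 1 1 1 * S 2 0 0 - S 1 0 1 * S 2 1 0 - S 1 1 0 * S 2 0 1) * X ^ 50
      + C (S 2 0 0 * S 2 1 1 - S 2 0 1 * S 2 1 0) * X ^ 68 := by
  simp only [eg15D, eg15Pencil, Matrix.det_fin_two]
  simp [Matrix.add_apply, Matrix.smul_apply, Matrix.map_apply, map_add, map_sub, map_mul]
  ring

/-- One Descartes step: adding a top monomial to `p` adds a sign variation iff the new top sign is opposite to `p`'s. -/
theorem signVariations_add_top {p : ℝ[X]} {n : ℕ} {c : ℝ} (hp : p ≠ 0) (hn : p.natDegree < n) (hc : c ≠ 0) :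
    (p + C c * X ^ n).signVariations =
      p.signVariations + (if SignType.sign c = -SignType.sign p.leadingCoeff then 1 else 0) ∧
    (p + C c * X ^ n).leadingCoeff = c ∧ (p + C c * X ^ n).natDegree = n ∧ p + C c * X ^ n ≠ 0 := by
  have hdegq : (C c * X ^ n).degree = (n : WithBot ℕ) := degree_C_mul_X_pow n hc
  have hndq : (C c * X ^ n).natDegree = n := natDegree_C_mul_X_pow n c hc
  have hlt : p.degree < (C c * X ^ n).degree := by
    rw [hdegq, degree_eq_natDegree hp]; exact_mod_cast hn
  have hlc : (p + C c * X ^ n).leadingCoeff = c := by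
    rw [leadingCoeff_add_of_degree_lt hlt, leadingCoeff_C_mul_X_pow]
  have hne : p + C c * X ^ n ≠ 0 := by
    intro h0; rw [h0, leadingCoeff_zero] at hlc; exact hc hlc.symm
  have hnd : (p + C c * X ^ n).natDegree = n := by
    rw [natDegree_add_eq_right_of_degree_lt hlt, hndq]
  have hE : (p + C c * X ^ n).eraseLead = p := by
    rw [eraseLead_add_of_natDegree_lt_right (by rw [hndq]; exact hn), eraseLead_C_mul_X_pow, add_zero]
  refine ⟨?_, hlc, hnd, hne⟩
  rw [signVariations_eq_eraseLead_add_ite hne, hE, hlc]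

/-- On chart (−,−,−) the pole polynomial `D` has exactly three sign variations, hence at most three positive zeros
counted with multiplicity (Descartes). -/
theorem eg15D_descartes_chartM (S : Fin 3 → Matrix (Fin 2) (Fin 2) ℝ) (hS : ∀ a, (S a).IsSymm)
    (hM : EG15ChartM S) :
    (eg15D S).signVariations = 3 ∧ (eg15D S).natDegree = 68 ∧ 0 < (eg15D S).leadingCoeff := by
  obtain ⟨-, hd3, hp34, hd4, hp35, hp45, hd5⟩ := hM
  have s0 : S 0 1 0 = S 0 0 1 := (hS 0).apply 0 1
  have s1 : S 1 1 0 = S 1 0 1 := (hS 1).apply 0 1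
  have s2 : S 2 1 0 = S 2 0 1 := (hS 2).apply 0 1
  rw [Matrix.det_fin_two] at hd3 hd4 hd5
  rw [polar] at hp34 hp35 hp45
  -- the six coefficients
  set c0 := S 0 0 0 * S 0 1 1 - S 0 0 1 * S 0 1 0 with hc0
  set c16 := S 0 0 0 * S 1 1 1 + S 0 1 1 * S 1 0 0 - S 0 0 1 * S 1 1 0 - S 0 1 0 * S 1 0 1 with hc16
  set c32 := S 1 0 0 * S 1 1 1 - S 1 0 1 * S 1 1 0 with hc32
  set c34 := S 0 0 0 * S 2 1 1 + S 0 1 1 * S 2 0 0 - S 0 0 1 * S 2 1 0 - S 0 1 0 * S 2 0 1 with hc34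
  set c50 := S 1 0 0 * S 2 1 1 + S 1 1 1 * S 2 0 0 - S 1 0 1 * S 2 1 0 - S 1 1 0 * S 2 0 1 with hc50
  set c68 := S 2 0 0 * S 2 1 1 - S 2 0 1 * S 2 1 0 with hc68
  have h0 : c0 < 0 := hd3
  have h16 : c16 < 0 := by rw [hc16, s0, s1]; linarith
  have h32 : c32 < 0 := hd4
  have h34 : 0 < c34 := by rw [hc34, s0, s2]; linarith
  have h50 : c50 < 0 := by rw [hc50, s1, s2]; linarith
  have h68 : 0 < c68 := hd5
  have hD := eg15D_expand S
  -- peel from the bottom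
  have q0 : (C c0).signVariations = 0 ∧ (C c0).leadingCoeff = c0 ∧ (C c0).natDegree = 0 ∧ C c0 ≠ 0 := by
    refine ⟨by rw [← monomial_zero_left, signVariations_monomial], leadingCoeff_C c0, natDegree_C c0, ?_⟩
    exact C_ne_zero.mpr h0.ne
  have q1 := signVariations_add_top (n := 16) (c := c16) q0.2.2.2 (by rw [q0.2.2.1]; norm_num) h16.ne
  rw [q0.1, q0.2.1, sign_neg h0, sign_neg h16] at q1
  have q2 := signVariations_add_top (n := 32) (c := c32) q1.2.2.2 (by rw [q1.2.2.1]; norm_num) h32.ne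
  rw [q1.1, q1.2.1, sign_neg h16, sign_neg h32] at q2
  have q3 := signVariations_add_top (n := 34) (c := c34) q2.2.2.2 (by rw [q2.2.2.1]; norm_num) h34.ne'
  rw [q2.1, q2.2.1, sign_neg h32, sign_pos h34] at q3
  have q4 := signVariations_add_top (n := 50) (c := c50) q3.2.2.2 (by rw [q3.2.2.1]; norm_num) h50.ne
  rw [q3.1, q3.2.1, sign_pos h34, sign_neg h50] at q4
  have q5 := signVariations_add_top (n := 68) (c := c68) q4.2.2.2 (by rw [q4.2.2.1]; norm_num) h68.ne'
  rw [q4.1, q4.2.1, sign_neg h50, sign_pos h68] at q5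
  have hsv : (eg15D S).signVariations = 3 := by
    rw [hD, q5.1]; norm_num
  refine ⟨hsv, ?_, ?_⟩
  · rw [hD]; exact q5.2.2.1
  · rw [hD, q5.2.1]; exact h68

theorem posRootCard_eg15D_le_three_chartM (S : Fin 3 → Matrix (Fin 2) (Fin 2) ℝ) (hS : ∀ a, (S a).IsSymm)
    (hM : EG15ChartM S) : posRootCard (eg15D S) ≤ 3 := by
  have := (eg15D_descartes_chartM S hS hM).1
  have := posRootCard_le_signVariations (eg15D S)
  omega


/-! ### rev 6 (f): chart (−,−,−) bookkeeping in the kernel — `EG15BookkeepingM` holds -/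

/-- Splitting a multiset count over `(a,B)` at an interior point `t`. -/
theorem card_filter_Ioo_split (M : Multiset ℝ) {a t B : ℝ} (hat : a < t) (htB : t < B) :
    (M.filter (· ∈ Set.Ioo a t)).card + M.count t + (M.filter (· ∈ Set.Ioo t B)).card
      = (M.filter (· ∈ Set.Ioo a B)).card := by
  classical
  have d1 : M.filter (· ∈ Set.Ioo a t) + M.filter (fun x => t = x) = M.filter (fun x => x ∈ Set.Ioo a t ∨ t = x) := by
    rw [Multiset.filter_add_filter]
    have : M.filter (fun x => x ∈ Set.Ioo a t ∧ t = x) = 0 := by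
      rw [Multiset.filter_eq_nil]
      rintro x - ⟨⟨-, hx⟩, rfl⟩
      exact lt_irrefl _ hx
    rw [this, add_zero]
  have d2 : M.filter (fun x => x ∈ Set.Ioo a t ∨ t = x) + M.filter (· ∈ Set.Ioo t B)
      = M.filter (fun x => (x ∈ Set.Ioo a t ∨ t = x) ∨ x ∈ Set.Ioo t B) := by
    rw [Multiset.filter_add_filter]
    have : M.filter (fun x => (x ∈ Set.Ioo a t ∨ t = x) ∧ x ∈ Set.Ioo t B) = 0 := by
      rw [Multiset.filter_eq_nil]
      rintro x - ⟨h1 | rfl, ⟨h3, -⟩⟩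
      · exact lt_irrefl _ (h1.2.trans h3)
      · exact lt_irrefl _ h3
    rw [this, add_zero]
  rw [Multiset.count_eq_card_filter_eq, ← Multiset.card_add, d1, ← Multiset.card_add, d2]
  congr 1
  apply Multiset.filter_congr
  intro x _
  constructor
  · rintro ((h1 | rfl) | h3)
    · exact ⟨h1.1, h1.2.trans htB⟩
    · exact ⟨hat, htB⟩
    · exact ⟨hat.trans h3.1, h3.2⟩
  · rintro ⟨h1, h2⟩
    rcases lt_trichotomy x t with hlt | rfl | hgt
    · exact Or.inl (Or.inl ⟨h1, hlt⟩)
    · exact Or.inl (Or.inr rfl)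
    · exact Or.inr ⟨hgt, h2⟩

/-- Sign constancy on a root-free open interval (intermediate value theorem): a negative value propagates. -/
theorem eval_neg_of_rootFree (D : ℝ[X]) {x y : ℝ} (hfree : ∀ u ∈ Set.Ioo x y, D.eval u ≠ 0) {u v : ℝ}
    (hu : u ∈ Set.Ioo x y) (hv : v ∈ Set.Ioo x y) (hneg : D.eval u < 0) : D.eval v < 0 := by
  by_contra hcon
  rw [not_lt] at hcon
  rcases hcon.lt_or_eq with hpos | hzero
  · have hne : u ≠ v := fun h => by rw [h] at hneg; exact lt_irrefl _ (hneg.trans hpos)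
    have hcont : ContinuousOn (fun x => eval x D) (Set.Icc (min u v) (max u v)) := (Polynomial.continuous D).continuousOn
    rcases lt_or_gt_of_ne hne with huv | hvu
    · have hsub := intermediate_value_Ioo huv.le (f := fun x => eval x D) (Polynomial.continuous D).continuousOn
      obtain ⟨c, hc, hc0⟩ := hsub ⟨hneg, hpos⟩
      exact hfree c ⟨hu.1.trans hc.1, hc.2.trans hv.2⟩ hc0
    · have hsub := intermediate_value_Ioo' hvu.le (f := fun x => eval x D) (Polynomial.continuous D).continuousOn
      obtain ⟨c, hc, hc0⟩ := hsub ⟨hneg, hpos⟩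
      exact hfree c ⟨hv.1.trans hc.1, hc.2.trans hu.2⟩ hc0
  · exact hfree v hv hzero.symm

/-- A finite set of reals, listed increasingly. -/
theorem exists_sorted_list (s : Finset ℝ) :
    ∃ L : List ℝ, L.Pairwise (· < ·) ∧ (∀ x, x ∈ L ↔ x ∈ s) ∧ L.length = s.card := by
  classical
  refine Finset.induction_on_max s ⟨[], List.Pairwise.nil, fun x => by simp, by simp⟩ ?_
  intro a s has ih
  obtain ⟨L, hL, hmem, hlen⟩ := ih
  have haL : a ∉ s := fun h => lt_irrefl _ (has a h)
  refine ⟨L ++ [a], ?_, ?_, ?_⟩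
  · rw [List.pairwise_append]
    refine ⟨hL, List.pairwise_singleton _ _, ?_⟩
    intro x hx b hb
    rw [List.mem_singleton] at hb
    rw [hb]
    exact has x ((hmem x).mp hx)
  · intro x
    simp only [List.mem_append, List.mem_singleton, Finset.mem_insert, hmem]
    tauto
  · rw [List.length_append, List.length_singleton, hlen, Finset.card_insert_of_notMem haL]

/-- The negativity indicators of the consecutive gaps of `a :: L ++ [B]`, read off at the midpoints. -/
noncomputable def gapNeg (D : ℝ[X]) : List ℝ → ℝ → ℝ → ℕ
  | [], a, B => if D.eval ((a + B) / 2) < 0 then 1 else 0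
  | ρ :: L, a, B => (if D.eval ((a + ρ) / 2) < 0 then 1 else 0) + gapNeg D L ρ B

/-- GAP LEMMA (chart (−,−,−)).  On a pole-free gap `(x,y) ⊂ (0,∞)`: either `h = X¹⁴D − N` has no zero there, or — by INERTIA
(`eg15Poly_eval_pos_of_chartM_of_D_pos`) and sign constancy — `D < 0` on the whole gap, and then Rolle with multiplicity
(`card_roots_Ioo_le_wronskian`) bounds the zeros of `h` by the zeros of `Γ₁₅` in the gap (all of which have `D < 0`) plus one. -/
theorem gap_count_chartM (S : Fin 3 → Matrix (Fin 2) (Fin 2) ℝ) (hS : ∀ a, (S a).IsSymm) (hneg : ∀ a i j, S a i j < 0)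
    (hW : wronskian (X ^ 14 * eg15D S) (X ^ 14 * eg15D S - eg15N S) ≠ 0) {x y : ℝ} (hx : 0 ≤ x) (hxy : x < y)
    (hfree : ∀ u ∈ Set.Ioo x y, (eg15D S).eval u ≠ 0) :
    ((X ^ 14 * eg15D S - eg15N S).roots.filter (· ∈ Set.Ioo x y)).card ≤
      (((eg15Gamma S).roots.filter (fun t => (eg15D S).eval t ≤ 0)).filter (· ∈ Set.Ioo x y)).card
        + (if (eg15D S).eval ((x + y) / 2) < 0 then 1 else 0) := by
  classical
  have hWh : wronskian (X ^ 14 * eg15D S) (X ^ 14 * eg15D S - eg15N S) = X ^ 13 * eg15Gamma S := by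
    rw [sub_eq_add_neg, wronskian_add_right, wronskian_neg_right, wronskian_self_eq_zero, wronskian_eg15, neg_neg,
      zero_add]
  have hXΓ : (X : ℝ[X]) ^ 13 * eg15Gamma S ≠ 0 := by rw [← hWh]; exact hW
  have hh : X ^ 14 * eg15D S - eg15N S ≠ 0 := by
    intro h0; apply hW; rw [h0]; simp [wronskian]
  by_cases hz : ∃ t ∈ Set.Ioo x y, (X ^ 14 * eg15D S - eg15N S).eval t = 0
  · obtain ⟨t, ht, hht⟩ := hz
    have htpos : 0 < t := hx.trans_lt ht.1
    have hDt : (eg15D S).eval t < 0 := by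
      rcases lt_trichotomy ((eg15D S).eval t) 0 with hlt | heq | hgt
      · exact hlt
      · exact absurd heq (hfree t ht)
      · exfalso
        have hF := eg15Poly_eval_pos_of_chartM_of_D_pos S hS hneg htpos hgt
        rw [eg15Poly_eq, eval_mul, eval_pow, eval_X, hht, mul_zero] at hF
        exact lt_irrefl _ hF
    have hall : ∀ v ∈ Set.Ioo x y, (eg15D S).eval v < 0 := fun v hv => eval_neg_of_rootFree (eg15D S) hfree ht hv hDt
    have hmid : (eg15D S).eval ((x + y) / 2) < 0 := hall _ ⟨by linarith, by linarith⟩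
    rw [if_pos hmid]
    have hGI : ∀ u ∈ Set.Ioo x y, (X ^ 14 * eg15D S : ℝ[X]).eval u ≠ 0 := by
      intro u hu hGu
      rw [eval_mul, eval_pow, eval_X] at hGu
      rcases mul_eq_zero.mp hGu with h1 | h1
      · exact absurd h1 (pow_ne_zero _ (hx.trans_lt hu.1).ne')
      · exact hfree u hu h1
    have r1 := card_roots_Ioo_le_wronskian (X ^ 14 * eg15D S) (X ^ 14 * eg15D S - eg15N S) x y hW hGI
    have eW : ((wronskian (X ^ 14 * eg15D S) (X ^ 14 * eg15D S - eg15N S)).roots.filter (· ∈ Set.Ioo x y))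
        = ((eg15Gamma S).roots.filter (· ∈ Set.Ioo x y)) := by
      rw [hWh, roots_mul hXΓ, roots_X_pow, Multiset.filter_add]
      have : ((13 • ({0} : Multiset ℝ)).filter (· ∈ Set.Ioo x y)) = 0 := by
        rw [Multiset.filter_eq_nil]
        intro z hz hzI
        have hz0 : z = 0 := Multiset.mem_singleton.mp (Multiset.mem_of_mem_nsmul hz)
        rw [hz0] at hzI
        exact absurd hzI.1 (not_lt.mpr hx)
      rw [this, zero_add]
    have eΓ : ((eg15Gamma S).roots.filter (· ∈ Set.Ioo x y)) =
        (((eg15Gamma S).roots.filter (fun t => (eg15D S).eval t ≤ 0)).filter (· ∈ Set.Ioo x y)) := by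
      rw [Multiset.filter_filter]
      apply Multiset.filter_congr
      intro z _
      exact ⟨fun hz => ⟨hz, (hall z hz).le⟩, fun hz => hz.1⟩
    rw [eW, eΓ] at r1
    exact r1
  · have h0 : ((X ^ 14 * eg15D S - eg15N S).roots.filter (· ∈ Set.Ioo x y)) = 0 := by
      rw [Multiset.filter_eq_nil]
      intro t ht htI
      exact hz ⟨t, htI, (mem_roots hh).mp ht⟩
    rw [h0, Multiset.card_zero]
    exact Nat.zero_le _

/-- POINT LEMMA.  At a positive pole `ρ` (`D(ρ) = 0`): `mult_ρ(h) ≤ mult_ρ(W) = mult_ρ(Γ₁₅)` (`rootMultiplicity_le_wronskian_of_common_root`),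
and `ρ` is a zero of `Γ₁₅` with `D ≤ 0`. -/
theorem point_count_chartM (S : Fin 3 → Matrix (Fin 2) (Fin 2) ℝ)
    (hW : wronskian (X ^ 14 * eg15D S) (X ^ 14 * eg15D S - eg15N S) ≠ 0) {ρ : ℝ} (hρ : 0 < ρ)
    (hDρ : (eg15D S).eval ρ = 0) :
    (X ^ 14 * eg15D S - eg15N S).roots.count ρ ≤
      ((eg15Gamma S).roots.filter (fun t => (eg15D S).eval t ≤ 0)).count ρ := by
  classical
  have hWh : wronskian (X ^ 14 * eg15D S) (X ^ 14 * eg15D S - eg15N S) = X ^ 13 * eg15Gamma S := by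
    rw [sub_eq_add_neg, wronskian_add_right, wronskian_neg_right, wronskian_self_eq_zero, wronskian_eg15, neg_neg,
      zero_add]
  have hXΓ : (X : ℝ[X]) ^ 13 * eg15Gamma S ≠ 0 := by rw [← hWh]; exact hW
  have hGρ : (X ^ 14 * eg15D S : ℝ[X]).IsRoot ρ := by
    rw [IsRoot, eval_mul, eval_pow, eval_X, hDρ, mul_zero]
  have r3 := rootMultiplicity_le_wronskian_of_common_root (X ^ 14 * eg15D S) (X ^ 14 * eg15D S - eg15N S) ρ hW hGρ
  rw [← count_roots, ← count_roots, hWh, roots_mul hXΓ, roots_X_pow, Multiset.count_add] at r3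
  have c0 : (13 • ({0} : Multiset ℝ)).count ρ = 0 := by
    rw [Multiset.count_nsmul, Multiset.count_singleton, if_neg hρ.ne', mul_zero]
  rw [c0, zero_add] at r3
  rw [Multiset.count_filter_of_pos (p := fun t => (eg15D S).eval t ≤ 0) (a := ρ) hDρ.le]
  exact r3

/-- CHAIN LEMMA: summing the gap and point lemmas along the increasing list `L` of the positive poles in `(a,B)`. -/
theorem chain_count_chartM (S : Fin 3 → Matrix (Fin 2) (Fin 2) ℝ) (hS : ∀ a, (S a).IsSymm) (hneg : ∀ a i j, S a i j < 0)
    (hW : wronskian (X ^ 14 * eg15D S) (X ^ 14 * eg15D S - eg15N S) ≠ 0) :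
    ∀ (L : List ℝ) (a B : ℝ), 0 ≤ a → a < B → L.Pairwise (· < ·) → (∀ ρ ∈ L, a < ρ ∧ ρ < B) →
      (∀ ρ ∈ L, (eg15D S).eval ρ = 0) → (∀ u, a < u → u < B → (eg15D S).eval u = 0 → u ∈ L) →
      ((X ^ 14 * eg15D S - eg15N S).roots.filter (· ∈ Set.Ioo a B)).card ≤
        (((eg15Gamma S).roots.filter (fun t => (eg15D S).eval t ≤ 0)).filter (· ∈ Set.Ioo a B)).card
          + gapNeg (eg15D S) L a B := by
  intro L
  induction L with
  | nil =>
    intro a B ha haB _ _ _ hcomp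
    have hfree : ∀ u ∈ Set.Ioo a B, (eg15D S).eval u ≠ 0 :=
      fun u hu hDu => List.not_mem_nil (hcomp u hu.1 hu.2 hDu)
    have := gap_count_chartM S hS hneg hW ha haB hfree
    simpa only [gapNeg] using this
  | cons ρ L ih =>
    intro a B ha haB hsort hbd hroots hcomp
    obtain ⟨hρL, hsortL⟩ := List.pairwise_cons.mp hsort
    obtain ⟨haρ, hρB⟩ := hbd ρ (by simp)
    have hρpos : 0 < ρ := ha.trans_lt haρ
    have hfree : ∀ u ∈ Set.Ioo a ρ, (eg15D S).eval u ≠ 0 := by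
      intro u hu hDu
      have hmem := hcomp u hu.1 (hu.2.trans hρB) hDu
      rcases List.mem_cons.mp hmem with h1 | h1
      · rw [h1] at hu; exact lt_irrefl _ hu.2
      · exact lt_asymm hu.2 (hρL u h1)
    have g1 := gap_count_chartM S hS hneg hW ha haρ hfree
    have p1 := point_count_chartM S hW hρpos (hroots ρ (by simp))
    have i1 := ih ρ B hρpos.le hρB hsortL
      (fun σ hσ => ⟨hρL σ hσ, (hbd σ (List.mem_cons.mpr (Or.inr hσ))).2⟩)
      (fun σ hσ => hroots σ (List.mem_cons.mpr (Or.inr hσ)))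
      (fun u hu1 hu2 hDu => by
        have hmem := hcomp u (haρ.trans hu1) hu2 hDu
        rcases List.mem_cons.mp hmem with h1 | h1
        · rw [h1] at hu1; exact absurd hu1 (lt_irrefl _)
        · exact h1)
    have s1 := card_filter_Ioo_split (X ^ 14 * eg15D S - eg15N S).roots haρ hρB
    have s2 := card_filter_Ioo_split ((eg15Gamma S).roots.filter (fun t => (eg15D S).eval t ≤ 0)) haρ hρB
    simp only [gapNeg]
    omega

/-- LOCAL-MAXIMUM LEMMA.  If `D < 0` at points on both sides of a root `ρ₁` within pole-free gaps `(0,ρ₁)` and `(ρ₁,ρ₂)`, then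
`ρ₁` is at least a double root of `D`. -/
theorem two_le_rootMultiplicity_of_neg_both_sides (D : ℝ[X]) (hD0 : D ≠ 0) {ρ₁ ρ₂ : ℝ} (h01 : 0 < ρ₁) (h12 : ρ₁ < ρ₂)
    (hρ₁ : D.eval ρ₁ = 0) (hfree0 : ∀ u ∈ Set.Ioo 0 ρ₁, D.eval u ≠ 0) (hfree1 : ∀ u ∈ Set.Ioo ρ₁ ρ₂, D.eval u ≠ 0)
    (hm0 : D.eval ((0 + ρ₁) / 2) < 0) (hm1 : D.eval ((ρ₁ + ρ₂) / 2) < 0) : 2 ≤ D.rootMultiplicity ρ₁ := by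
  have hn0 : ∀ v ∈ Set.Ioo 0 ρ₁, D.eval v < 0 :=
    fun v hv => eval_neg_of_rootFree D hfree0 ⟨by linarith, by linarith⟩ hv hm0
  have hn1 : ∀ v ∈ Set.Ioo ρ₁ ρ₂, D.eval v < 0 :=
    fun v hv => eval_neg_of_rootFree D hfree1 ⟨by linarith, by linarith⟩ hv hm1
  have hmax : IsLocalMax (fun x => eval x D) ρ₁ := by
    refine Filter.mem_of_superset (Ioo_mem_nhds h01 h12) ?_
    intro v hv
    show eval v D ≤ eval ρ₁ D
    rw [hρ₁]
    rcases lt_trichotomy v ρ₁ with hlt | heq | hgt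
    · exact (hn0 v ⟨hv.1, hlt⟩).le
    · rw [heq, hρ₁]
    · exact (hn1 v ⟨hgt, hv.2⟩).le
  have hder : (derivative D).eval ρ₁ = 0 := by
    rw [← Polynomial.deriv]; exact hmax.deriv_eq_zero
  have h1 : 1 < D.rootMultiplicity ρ₁ := by
    rw [lt_rootMultiplicity_iff_isRoot_iterate_derivative hD0]
    intro m hm
    interval_cases m
    · simpa [IsRoot] using hρ₁
    · simpa [IsRoot] using hder
  omega

/-- GAP BUDGET: with at most three positive poles (with multiplicity), at most TWO of the gaps are negative. -/
theorem gapNeg_le_two (D : ℝ[X]) (hD0 : D ≠ 0) (hD3 : posRootCard D ≤ 3) (L : List ℝ) (B : ℝ)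
    (hsort : L.Pairwise (· < ·)) (hbd : ∀ ρ ∈ L, 0 < ρ ∧ ρ < B - 1)
    (hroots : ∀ ρ ∈ L, D.eval ρ = 0) (hcomp : ∀ u, 0 < u → D.eval u = 0 → u ∈ L)
    (hposB : 0 < D.eval (B - 1)) (hlen : L.length ≤ 3) : gapNeg D L 0 B ≤ 2 := by
  classical
  -- the last gap `(ρ_r, B)` (or `(0,B)`) is not negative: it contains `B - 1`, where `D > 0`
  have last_nonneg : ∀ ρ, 0 ≤ ρ → ρ < B - 1 → (∀ u ∈ Set.Ioo ρ B, D.eval u ≠ 0) → ¬ D.eval ((ρ + B) / 2) < 0 := by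
    intro ρ hρ hρB hfree hmid
    have := eval_neg_of_rootFree D hfree (u := (ρ + B) / 2) (v := B - 1) ⟨by linarith, by linarith⟩ ⟨hρB, by linarith⟩ hmid
    linarith
  -- multiplicities of listed poles are ≥ 1
  have hcount : ∀ ρ ∈ L, 1 ≤ D.roots.count ρ := by
    intro ρ hρ
    rw [count_roots]
    exact (rootMultiplicity_pos hD0).mpr (hroots ρ hρ)
  have hmono : ∀ B', (D.roots.filter (· ∈ Set.Ioo 0 B')).card ≤ posRootCard D := fun B' =>
    Multiset.card_le_card (Multiset.monotone_filter_right _ (fun x hx => hx.1))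
  rcases L with _ | ⟨ρ₁, _ | ⟨ρ₂, _ | ⟨ρ₃, _ | ⟨ρ₄, L'⟩⟩⟩⟩
  · simp only [gapNeg]
    split_ifs <;> omega
  · simp only [gapNeg]
    split_ifs <;> omega
  · have h12 : ρ₁ < ρ₂ := (List.pairwise_cons.mp hsort).1 ρ₂ (by simp)
    obtain ⟨h2pos, h2B⟩ := hbd ρ₂ (by simp)
    have hfree2 : ∀ u ∈ Set.Ioo ρ₂ B, D.eval u ≠ 0 := by
      intro u hu hDu
      have hmem := hcomp u (h2pos.trans hu.1) hDu
      simp only [List.mem_cons, List.not_mem_nil, or_false] at hmem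
      rcases hmem with h1 | h1
      · rw [h1] at hu; exact lt_asymm h12 hu.1
      · rw [h1] at hu; exact lt_irrefl _ hu.1
    have hl := last_nonneg ρ₂ h2pos.le h2B hfree2
    simp only [gapNeg]
    rw [if_neg hl]
    split_ifs <;> omega
  · have hs := List.pairwise_cons.mp hsort
    have h12 : ρ₁ < ρ₂ := hs.1 ρ₂ (by simp)
    have h13 : ρ₁ < ρ₃ := hs.1 ρ₃ (by simp)
    have h23 : ρ₂ < ρ₃ := (List.pairwise_cons.mp hs.2).1 ρ₃ (by simp)
    obtain ⟨h1pos, h1B⟩ := hbd ρ₁ (by simp)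
    obtain ⟨h3pos, h3B⟩ := hbd ρ₃ (by simp)
    have hmemL : ∀ u, 0 < u → D.eval u = 0 → u = ρ₁ ∨ u = ρ₂ ∨ u = ρ₃ := by
      intro u hu hDu
      have hmem := hcomp u hu hDu
      simpa only [List.mem_cons, List.not_mem_nil, or_false] using hmem
    have hfree3 : ∀ u ∈ Set.Ioo ρ₃ B, D.eval u ≠ 0 := by
      intro u hu hDu
      rcases hmemL u (h3pos.trans hu.1) hDu with h1 | h1 | h1 <;> rw [h1] at hu
      · exact lt_asymm h13 hu.1
      · exact lt_asymm h23 hu.1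
      · exact lt_irrefl _ hu.1
    have hl := last_nonneg ρ₃ h3pos.le h3B hfree3
    -- not both of the first two gaps are negative
    have hfree0 : ∀ u ∈ Set.Ioo 0 ρ₁, D.eval u ≠ 0 := by
      intro u hu hDu
      rcases hmemL u hu.1 hDu with h1 | h1 | h1 <;> rw [h1] at hu
      · exact lt_irrefl _ hu.2
      · exact lt_asymm h12 hu.2
      · exact lt_asymm h13 hu.2
    have hfree1 : ∀ u ∈ Set.Ioo ρ₁ ρ₂, D.eval u ≠ 0 := by
      intro u hu hDu
      rcases hmemL u (h1pos.trans hu.1) hDu with h1 | h1 | h1 <;> rw [h1] at hu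
      · exact lt_irrefl _ hu.1
      · exact lt_irrefl _ hu.2
      · exact lt_asymm h23 hu.2
    have hnot : ¬ (D.eval ((0 + ρ₁) / 2) < 0 ∧ D.eval ((ρ₁ + ρ₂) / 2) < 0) := by
      rintro ⟨hm0, hm1⟩
      have hmult := two_le_rootMultiplicity_of_neg_both_sides D hD0 h1pos h12 (hroots ρ₁ (by simp)) hfree0 hfree1 hm0 hm1
      rw [← count_roots] at hmult
      have c2 := hcount ρ₂ (by simp)
      have c3 := hcount ρ₃ (by simp)
      have s1 := card_filter_Ioo_split D.roots h1pos (h12.trans (h23.trans (by linarith : ρ₃ < B)))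
      have s2 := card_filter_Ioo_split D.roots h12 (h23.trans (by linarith : ρ₃ < B))
      have s3 := card_filter_Ioo_split D.roots h23 (by linarith : ρ₃ < B)
      have hm := hmono B
      omega
    simp only [gapNeg]
    rw [if_neg hl]
    by_cases hA : D.eval ((0 + ρ₁) / 2) < 0
    · by_cases hB' : D.eval ((ρ₁ + ρ₂) / 2) < 0
      · exact absurd ⟨hA, hB'⟩ hnot
      · rw [if_pos hA, if_neg hB']
        split_ifs <;> omega
    · rw [if_neg hA]
      split_ifs <;> omega
  · simp only [List.length_cons] at hlen
    omega

/-- **`EG15BookkeepingM` holds** (chart (−,−,−) bookkeeping in the kernel): `Z₊(g) ≤ negRootedCritCard + 2`.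
Proof: `g = X¹⁴h`; list the positive poles increasingly (at most three with multiplicity, `eg15D_descartes_chartM` + Descartes);
GAP LEMMA on each pole-free gap (inertia ⇒ zeros of `h` only where `D < 0`; Rolle with multiplicity against `W = X¹³Γ₁₅`),
POINT LEMMA at each pole, summed by the CHAIN LEMMA; the number of negative gaps is at most two (GAP BUDGET: the last gap is
positive since `lc(D) = det S₅ > 0`, and three consecutive… two adjacent negative gaps would make the pole between them a double
root, exceeding Descartes' three). -/
theorem eg15BookkeepingM_holds : EG15BookkeepingM := by
  intro S hS hM
  have hM' := hM
  obtain ⟨hneg, hd3, hp34, hd4, hp35, hp45, hd5⟩ := hM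
  have hΓ : eg15Gamma S ≠ 0 := eg15Gamma_ne_zero S hd3.ne (hneg 0 1 1).ne
  have hWh : wronskian (X ^ 14 * eg15D S) (X ^ 14 * eg15D S - eg15N S) = X ^ 13 * eg15Gamma S := by
    rw [sub_eq_add_neg, wronskian_add_right, wronskian_neg_right, wronskian_self_eq_zero, wronskian_eg15, neg_neg,
      zero_add]
  have hW : wronskian (X ^ 14 * eg15D S) (X ^ 14 * eg15D S - eg15N S) ≠ 0 := by
    rw [hWh]; exact mul_ne_zero (pow_ne_zero _ X_ne_zero) hΓ
  obtain ⟨hsv, hnd, hlc⟩ := eg15D_descartes_chartM S hS hM'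
  have hD0 : eg15D S ≠ 0 := fun h0 => by rw [h0, leadingCoeff_zero] at hlc; exact lt_irrefl _ hlc
  have hD3 : posRootCard (eg15D S) ≤ 3 := posRootCard_eg15D_le_three_chartM S hS hM'
  have e1 : posRootCard (eg15Poly S) = posRootCard (X ^ 14 * eg15D S - eg15N S) := by
    rw [eg15Poly_eq, posRootCard_X_pow_mul]
  rw [e1]
  -- the increasing list of the positive poles
  obtain ⟨L, hsort, hmem, hlen⟩ := exists_sorted_list ((eg15D S).roots.toFinset.filter (fun t => 0 < t))
  have hmem' : ∀ x, x ∈ L ↔ 0 < x ∧ (eg15D S).eval x = 0 := by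
    intro x
    rw [hmem x, Finset.mem_filter, Multiset.mem_toFinset, mem_roots hD0, IsRoot.def]
    exact and_comm
  have hfs : (eg15D S).roots.toFinset.filter (fun t => 0 < t) = ((eg15D S).roots.filter (fun t => 0 < t)).toFinset := by
    ext x
    simp only [Finset.mem_filter, Multiset.mem_toFinset, Multiset.mem_filter]
  have hlen3 : L.length ≤ 3 := by
    rw [hlen, hfs]
    exact (Multiset.toFinset_card_le _).trans hD3
  -- ceilings
  have ceil : ∀ M : Multiset ℝ, ∃ B₀ : ℝ, ∀ x ∈ M, x < B₀ := by
    intro M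
    refine ⟨(M.map (fun x => |x|)).sum + 1, fun x hx => ?_⟩
    have h1 : |x| ≤ (M.map (fun x => |x|)).sum :=
      Multiset.single_le_sum (fun y hy => by obtain ⟨z, -, rfl⟩ := Multiset.mem_map.mp hy; exact abs_nonneg z) _
        (Multiset.mem_map_of_mem _ hx)
    have h2 : x ≤ |x| := le_abs_self x
    linarith
  obtain ⟨B₀, hB₀⟩ := ceil (X ^ 14 * eg15D S - eg15N S).roots
  obtain ⟨B₁, hB₁⟩ := ceil (eg15D S).roots
  obtain ⟨Y₀, hY₀⟩ : ∃ Y₀ : ℝ, ∀ y ≥ Y₀, 0 < (eg15D S).eval y := by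
    have hdeg : 0 < (eg15D S).degree := by
      rw [degree_eq_natDegree hD0, hnd]; exact_mod_cast (by norm_num : (0 : ℕ) < 68)
    have ht := Polynomial.tendsto_atTop_of_leadingCoeff_nonneg (eg15D S) hdeg hlc.le
    obtain ⟨Y₀, hY⟩ := Filter.eventually_atTop.mp (ht.eventually_gt_atTop 0)
    exact ⟨Y₀, hY⟩
  set B := max (max (max B₀ B₁) Y₀) 0 + 2 with hBdef
  have hBB₀ : B₀ ≤ B - 2 := by
    rw [hBdef]; have := le_max_left (max B₀ B₁) Y₀; have := le_max_left B₀ B₁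
    have := le_max_left (max (max B₀ B₁) Y₀) 0; linarith
  have hBB₁ : B₁ ≤ B - 2 := by
    rw [hBdef]; have := le_max_left (max B₀ B₁) Y₀; have := le_max_right B₀ B₁
    have := le_max_left (max (max B₀ B₁) Y₀) 0; linarith
  have hBY : Y₀ ≤ B - 1 := by
    rw [hBdef]; have := le_max_right (max B₀ B₁) Y₀; have := le_max_left (max (max B₀ B₁) Y₀) 0; linarith
  have hB2 : 2 ≤ B := by rw [hBdef]; have := le_max_right (max (max B₀ B₁) Y₀) 0; linarith
  -- the chain
  have main := chain_count_chartM S hS hneg hW L 0 B le_rfl (by linarith) hsort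
    (fun ρ hρ => by
      obtain ⟨hρpos, hDρ⟩ := (hmem' ρ).mp hρ
      have := hB₁ ρ ((mem_roots hD0).mpr hDρ)
      exact ⟨hρpos, by linarith⟩)
    (fun ρ hρ => ((hmem' ρ).mp hρ).2)
    (fun u hu _ hDu => (hmem' u).mpr ⟨hu, hDu⟩)
  -- the gap budget
  have hgap := gapNeg_le_two (eg15D S) hD0 hD3 L B hsort
    (fun ρ hρ => by
      obtain ⟨hρpos, hDρ⟩ := (hmem' ρ).mp hρ
      have := hB₁ ρ ((mem_roots hD0).mpr hDρ)
      exact ⟨hρpos, by linarith⟩)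
    (fun ρ hρ => ((hmem' ρ).mp hρ).2) (fun u hu hDu => (hmem' u).mpr ⟨hu, hDu⟩)
    (hY₀ (B - 1) hBY) hlen3
  -- rewrite the two sides
  have eh : (X ^ 14 * eg15D S - eg15N S).roots.filter (fun x => 0 < x)
      = (X ^ 14 * eg15D S - eg15N S).roots.filter (· ∈ Set.Ioo 0 B) :=
    Multiset.filter_congr fun x hx => ⟨fun hp => ⟨hp, by have := hB₀ x hx; linarith⟩, fun hI => hI.1⟩
  have eΓ : ((((eg15Gamma S).roots.filter (fun t => (eg15D S).eval t ≤ 0)).filter (· ∈ Set.Ioo 0 B))).card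
      ≤ negRootedCritCard S := by
    unfold negRootedCritCard
    rw [Multiset.filter_filter]
    exact Multiset.card_le_card (Multiset.monotone_filter_right _ (fun t ht => ⟨ht.1.1, ht.2⟩))
  unfold posRootCard
  rw [eh]
  omega

/-- **The reduction of record after rev 6 (TWO hypotheses = the two finite certificates): EG15 ⟸ CERTIFICATE (+) ∧ CERTIFICATE (−).**
Everything else (chart law, pole law, both bookkeepings) is kernel-checked in this file. -/
theorem eg15_of_certificates (hΓP : EG15CritLawP) (hΓM : EG15CritLawM) : EG15 :=
  eg15_of_critBudget3 hΓP eg15BookkeepingM_holds hΓM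

/-! ## rev 7 (g6, 2026-08-29): non-vacuity of the two certificate laws and the uniform certificate

(R3020 / desk R3059.)  `EG15CritLawP` and `EG15CritLawM` quantify over POPULATED charts: two exact rational members are checked
in the kernel below.  And ONE uniform certificate «`Z₊(Γ₁₅) ≤ 11` on chart (+,+,+) ∪ chart (−,−,−)» already gives `EG15`
(`eg15_of_uniform`, via `critLaws_of_uniform` and `eg15_of_certificates`).  Also `EG15Degenerate` is closed
(`eg15Degenerate_holds`), so the Rolle-window route reads `eg15_of_RW : RolleWindowLemma → RW15Empty → EG15`.  Nothing OPEN is asserted. -/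

/-- An exact member of chart (+,+,+): `S₃ = [[1,3],[3,10]]`, `S₄ = [[10,1],[1,1]]`, `S₅ = [[1,3],[3,1]]`
(det = 1, 9, −8; polars P₃₄ = 95, P₃₅ = −7, P₄₅ = 5). -/
theorem eg15ChartP_witness : EG15ChartP ![!![1, 3; 3, 10], !![10, 1; 1, 1], !![1, 3; 3, 1]] := by
  refine ⟨?_, ?_, ?_, ?_, ?_, ?_, ?_⟩
  · intro a i j
    fin_cases a <;> fin_cases i <;> fin_cases j <;> simp
  all_goals simp [Matrix.det_fin_two, polar]
  all_goals norm_num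

/-- An exact member of chart (−,−,−): `S₃ = [[−1,−3],[−3,−1]]`, `S₄ = [[−1,−30],[−30,−1]]`, `S₅ = [[−10,−1],[−1,−10]]`
(det = −8, −899, 99; polars P₃₄ = −178, P₃₅ = 14, P₄₅ = −40). -/
theorem eg15ChartM_witness : EG15ChartM ![!![-1, -3; -3, -1], !![-1, -30; -30, -1], !![-10, -1; -1, -10]] := by
  refine ⟨?_, ?_, ?_, ?_, ?_, ?_, ?_⟩
  · intro a i j
    fin_cases a <;> fin_cases i <;> fin_cases j <;> simp
  all_goals simp [Matrix.det_fin_two, polar]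
  all_goals norm_num

/-- The witnesses are symmetric letters (so they lie in the domain the laws quantify over). -/
theorem eg15ChartP_witness_symm : ∀ a, ((![!![1, 3; 3, 10], !![10, 1; 1, 1], !![1, 3; 3, 1]] :
    Fin 3 → Matrix (Fin 2) (Fin 2) ℝ) a).IsSymm := by
  intro a; fin_cases a <;> (ext i j; fin_cases i <;> fin_cases j <;> simp)

theorem eg15ChartM_witness_symm : ∀ a, ((![!![-1, -3; -3, -1], !![-1, -30; -30, -1], !![-10, -1; -1, -10]] :
    Fin 3 → Matrix (Fin 2) (Fin 2) ℝ) a).IsSymm := by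
  intro a; fin_cases a <;> (ext i j; fin_cases i <;> fin_cases j <;> simp)

/-- **ONE UNIFORM CERTIFICATE SUFFICES (kernel):** «`Z₊(Γ₁₅) ≤ 11` on both full-alternation charts» ⟹ `EG15`. -/
theorem eg15_of_uniform
    (h : ∀ S : Fin 3 → Matrix (Fin 2) (Fin 2) ℝ, (∀ a, (S a).IsSymm) → (EG15ChartP S ∨ EG15ChartM S) →
      posRootCard (eg15Gamma S) ≤ 11) : EG15 :=
  eg15_of_certificates (critLaws_of_uniform h).1 (critLaws_of_uniform h).2


/-- `EG15Degenerate` IS KERNEL (rev 7): a support strictly smaller than `V15` has ≤ 13 sign variations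
(`eg15Poly_support_eq` contraposed), hence ≤ 13 positive zeros with multiplicity (Descartes, `posRootCard_le_signVariations`). -/
theorem eg15Degenerate_holds : EG15Degenerate := by
  intro S _hS hns
  refine Classical.by_contradiction fun hlt => hns ?_
  have h14 : 14 ≤ (eg15Poly S).signVariations :=
    le_trans (by omega) (posRootCard_le_signVariations (eg15Poly S))
  intro u
  rw [eg15Poly_support_eq S h14, List.mem_toFinset]

/-- The Rolle-window route after rev 7 (kernel glue; both hypotheses OPEN): `RolleWindowLemma` (classical, paper-proved, §7.12 (b))
and the window-emptiness law `RW15Empty` already give `EG15` — the degenerate supports are discharged. -/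
theorem eg15_of_RW (h : RolleWindowLemma) (hE : RW15Empty) : EG15 :=
  eg15_of_rolleWindowLemma h hE eg15Degenerate_holds


/-! ## rev 8 (g7, lens=finite, 2026-08-29): DESCARTES-MULTIPLIER certificates — a third finite currency for `EG15`

For every nonzero `m` the positive zeros of `g` (with multiplicity) are among those of `g * m`, so
`Z₊(g) ≤ Z₊(g·m) ≤ signVariations (g·m)` (Descartes, `posRootCard_le_signVariations`).  Hence ANY `m ≠ 0` with
`signVariations (eg15Poly S * m) ≤ 13` certifies the door bound at `S`, and by the kernel chart law (`eg15ChartLaw_holds`) only the two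
full-alternation charts need one: `eg15_of_multCert : EG15MultCert → EG15`.  By Curtiss (1918) such an `m` exists at `S` iff
`Z₊(g_S) ≤ 13`, so `EG15MultCert` is equivalent to `EG15` POINTWISE — the finite content is HOW `m` depends on `S`.  Three typed
families, each a hypothesis only: (i) `EG15Poincare N` — ONE Poincaré factor `(X + s)^N`, `∃ s > 0` (one real parameter, fixed degree);
(ii) `EG15NegRooted d` — a multiplier with `d` negative real roots `∏_{j<d} (X + s_j)`, `∃ s_j > 0` (`d` parameters; contains (i));
(iii) `EG15Canonical N` — NO existential: the explicit WINDOW-SCALE multiplier `eg15CanonicalMult S N = ∏_{j<13} (X + σ_j(S))^N`, one factor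
per consecutive exponent triple `vm < v < vp` of `V15` at its local scale `σ_j(S) = (|c_vm| / |c_vp|)^{1/(vp−vm)}` (`Real.rpow`;
`eg15WindowScale`) — a universally quantified sign condition on ONE explicit polynomial map of the nine letters, refutable by ONE chart point.
Kernel glue: `eg15_of_poincare`, `eg15_of_negRooted`, `eg15_of_canonical`, and `multCert_of_pieces` / `eg15_of_pieces` (finitely many
PIECES `EG15PoincarePiece U N σ` covering the charts — each a finite conjunction of polynomial sign conditions in the letters — give the door);
MONOTONICITY `poincare_of_le : N ≤ N' → EG15Poincare N → EG15Poincare N'`, `canonical_of_le` (one more factor `X + s`, `s ≥ 0`, never raises the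
count: the tree's port of Avendaño 2009, Lemma 5, `Literature.Algebra.Polynomial.signVariations_X_add_C_mul_le` — the one new import of rev 8).
NUMERICS OF RECORD (exact integer arithmetic on `g · m`; memo `wall_bubbling_EndDoor.md` §7.12 (q); scales rounded to 12 significant bits):
the canonical multiplier with `N = 1` (degree 13) gives `signVariations ≤ 12` at the certified six-root configuration of the memo (value 10;
`N = 2` gives 6 = `Z₊` exactly), at both chart witnesses of this file, at the memo's `negRootedCritCard = 5` instance and at 140/140 random
chart points (letters `10^{±6}` and `10^{±20}`); adversarial ascent of `signVariations (g · m)` over chart (−,−,−) finds `N = 1` failures (value 14 at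
moderate letters, e.g. `S = −(2^{−3.75}, 2^{−1.25}, 2^{−3}), −(2^{4.5}, 2^{5.75}, 2^{1.25}), −(2^{14.25}, 2^{11.125}, 2^{9.25})`, `Z₊ = 2`) at which
`N = 2` (degree 26) certifies; chart (+,+,+) ascent stalls at 12 for `N = 1`; four ascents against `N = 2` (3 × chart (−,−,−), 1 × chart (+,+,+),
250 s and ≈ 1.3·10⁵ exact evaluations each, restarts at letters `2^{[−30,30]}`) reach at most 12 (values 10, 12, 10; 10), i.e. find NO counterexample
to `EG15Canonical 2`.  One Poincaré factor needs `N = 4…11` at the same points; binomials `X^k ± λ` certify nothing (14 at the six-root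
configuration).  Sources: Poincaré (1883); Curtiss, Ann. of Math. 19 (1918) 251–278, doi:10.2307/1967494 (a multiplier realising `Z₊` exactly
exists; degree bounded by the root angles); Avendaño, J. Algebra 324 (2010) 2884–2892; arXiv:2301.00331 (optimality of the Curtiss bound).
OPEN, never asserted: `EG15MultCert`, `EG15Poincare N`, `EG15NegRooted d`, `EG15Canonical N` (every `N`, `d`), every piece; `EG15`, both
critical-value laws, `RW15Empty`, `RolleWindowLemma` unchanged OPEN; DoorA26 (19979) / 18050 untouched; VP ≠ VNP not moved. -/

/-- Multiplier monotonicity (kernel): the positive zeros of `f`, with multiplicity, are among those of `f * m` for `m ≠ 0`. -/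
theorem posRootCard_le_mul (f m : ℝ[X]) (hm : m ≠ 0) : posRootCard f ≤ posRootCard (f * m) := by
  by_cases hf : f = 0
  · simp [hf, posRootCard]
  unfold posRootCard
  rw [Polynomial.roots_mul (mul_ne_zero hf hm), Multiset.filter_add]
  exact Multiset.card_le_card (Multiset.le_add_right _ _)

-- OPEN certificate (hypothesis only; never asserted)
/-- **DESCARTES-MULTIPLIER CERTIFICATE** `EG15MultCert`: on each full-alternation chart some nonzero multiplier `m` brings the
sign-variation count of `g · m` down to `13`.  Equivalent to `EG15` pointwise (Curtiss 1918); the finite content is a piecewise-explicit `m(S)`. -/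
def EG15MultCert : Prop :=
  ∀ S : Fin 3 → Matrix (Fin 2) (Fin 2) ℝ, (∀ a, (S a).IsSymm) → (EG15ChartP S ∨ EG15ChartM S) →
    ∃ m : ℝ[X], m ≠ 0 ∧ (eg15Poly S * m).signVariations ≤ 13

/-- **EG15 ⟸ the multiplier certificate (kernel):** Descartes on `g · m`, multiplier monotonicity, and the kernel chart law. -/
theorem eg15_of_multCert (h : EG15MultCert) : EG15 := by
  intro S hS
  show posRootCard (eg15Poly S) ≤ 13
  by_cases h14 : 14 ≤ (eg15Poly S).signVariations
  · obtain ⟨m, hm, hv⟩ := h S hS (eg15ChartLaw_holds S hS h14)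
    exact (posRootCard_le_mul _ _ hm).trans ((posRootCard_le_signVariations _).trans hv)
  · have h1 := posRootCard_le_signVariations (eg15Poly S)
    omega

-- OPEN certificate family (i) (hypothesis only; never asserted)
/-- **POINCARÉ CERTIFICATE of exponent `N`** `EG15Poincare N`: on each full-alternation chart some `s > 0` gives
`signVariations (g · (X + s)^N) ≤ 13`.  One real parameter, fixed degree. -/
def EG15Poincare (N : ℕ) : Prop :=
  ∀ S : Fin 3 → Matrix (Fin 2) (Fin 2) ℝ, (∀ a, (S a).IsSymm) → (EG15ChartP S ∨ EG15ChartM S) →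
    ∃ s : ℝ, 0 < s ∧ (eg15Poly S * (X + C s) ^ N).signVariations ≤ 13

/-- A Poincaré certificate is a multiplier certificate (kernel). -/
theorem multCert_of_poincare (N : ℕ) (h : EG15Poincare N) : EG15MultCert := by
  intro S hS hc
  obtain ⟨s, _hs, hv⟩ := h S hS hc
  exact ⟨(X + C s) ^ N, pow_ne_zero _ (X_add_C_ne_zero s), hv⟩

/-- **EG15 ⟸ a Poincaré certificate of any fixed exponent (kernel).** -/
theorem eg15_of_poincare (N : ℕ) (h : EG15Poincare N) : EG15 :=
  eg15_of_multCert (multCert_of_poincare N h)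

-- OPEN certificate family (ii) (hypothesis only; never asserted)
/-- **NEGATIVE-ROOTED CERTIFICATE of degree `d`** `EG15NegRooted d`: on each full-alternation chart some multiplier with `d` negative
real roots `∏_{j<d} (X + s_j)`, `s_j > 0`, gives `signVariations ≤ 13`.  (`d` real parameters; `d = N` equal roots is (i).) -/
def EG15NegRooted (d : ℕ) : Prop :=
  ∀ S : Fin 3 → Matrix (Fin 2) (Fin 2) ℝ, (∀ a, (S a).IsSymm) → (EG15ChartP S ∨ EG15ChartM S) →
    ∃ s : Fin d → ℝ, (∀ j, 0 < s j) ∧ (eg15Poly S * ∏ j, (X + C (s j))).signVariations ≤ 13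

theorem prod_X_add_C_ne_zero {ι : Type*} (t : Finset ι) (s : ι → ℝ) : ∏ j ∈ t, (X + C (s j)) ≠ 0 :=
  Finset.prod_ne_zero_iff.mpr fun j _ => X_add_C_ne_zero (s j)

/-- A negative-rooted certificate is a multiplier certificate (kernel). -/
theorem multCert_of_negRooted (d : ℕ) (h : EG15NegRooted d) : EG15MultCert := by
  intro S hS hc
  obtain ⟨s, _hs, hv⟩ := h S hS hc
  exact ⟨∏ j, (X + C (s j)), prod_X_add_C_ne_zero _ s, hv⟩

/-- **EG15 ⟸ a negative-rooted certificate of any fixed degree (kernel).** -/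
theorem eg15_of_negRooted (d : ℕ) (h : EG15NegRooted d) : EG15 :=
  eg15_of_multCert (multCert_of_negRooted d h)

/-- Lower exponents `vm` of the 13 consecutive triples (windows) `vm < v < vp` of `V15`. -/
def V15lo : Fin 13 → ℕ := ![14, 17, 20, 28, 30, 33, 36, 44, 48, 51, 54, 60, 62]

/-- Upper exponents `vp` of the 13 windows of `V15`. -/
def V15hi : Fin 13 → ℕ := ![20, 28, 30, 33, 36, 44, 48, 51, 54, 60, 62, 78, 96]

/-- The LOCAL SCALE of window `j` at `S`: `σ_j(S) = (|c_vm| / |c_vp|)^{1/(vp − vm)}` — the modulus at which the two outer monomials of the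
window balance (`c_u` = coefficient of `X^u` in `eg15Poly S`). -/
noncomputable def eg15WindowScale (S : Fin 3 → Matrix (Fin 2) (Fin 2) ℝ) (j : Fin 13) : ℝ :=
  (|(eg15Poly S).coeff (V15lo j)| / |(eg15Poly S).coeff (V15hi j)|) ^ ((1 : ℝ) / ((V15hi j : ℝ) - (V15lo j : ℝ)))

/-- The CANONICAL (window-scale) multiplier of exponent `N`: `∏_{j<13} (X + σ_j(S))^N`, degree `13 N`, all roots negative real. -/
noncomputable def eg15CanonicalMult (S : Fin 3 → Matrix (Fin 2) (Fin 2) ℝ) (N : ℕ) : ℝ[X] :=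
  ∏ j : Fin 13, (X + C (eg15WindowScale S j)) ^ N

theorem eg15CanonicalMult_ne_zero (S : Fin 3 → Matrix (Fin 2) (Fin 2) ℝ) (N : ℕ) : eg15CanonicalMult S N ≠ 0 :=
  Finset.prod_ne_zero_iff.mpr fun j _ => pow_ne_zero _ (X_add_C_ne_zero (eg15WindowScale S j))

-- OPEN certificate family (iii) (hypothesis only; never asserted) — NO existential
/-- **CANONICAL CERTIFICATE of exponent `N`** `EG15Canonical N`: on each full-alternation chart the explicit window-scale multiplier works:
`signVariations (g · ∏_j (X + σ_j(S))^N) ≤ 13`.  A universally quantified sign condition on one explicit map of the nine letters; refutable by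
one chart point.  Numerics (header): `N = 1` fails at located chart-(−,−,−) points, `N = 2` has no counterexample in the searches of record. -/
def EG15Canonical (N : ℕ) : Prop :=
  ∀ S : Fin 3 → Matrix (Fin 2) (Fin 2) ℝ, (∀ a, (S a).IsSymm) → (EG15ChartP S ∨ EG15ChartM S) →
    (eg15Poly S * eg15CanonicalMult S N).signVariations ≤ 13

/-- A canonical certificate is a multiplier certificate (kernel). -/
theorem multCert_of_canonical (N : ℕ) (h : EG15Canonical N) : EG15MultCert :=
  fun S hS hc => ⟨eg15CanonicalMult S N, eg15CanonicalMult_ne_zero S N, h S hS hc⟩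

/-- **EG15 ⟸ the canonical certificate of any fixed exponent (kernel).** -/
theorem eg15_of_canonical (N : ℕ) (h : EG15Canonical N) : EG15 :=
  eg15_of_multCert (multCert_of_canonical N h)

/-- A PIECE of a Poincaré-type certificate: on the part `U` of the two charts the FIXED exponent `N` and scale rule `σ` work.  (For a basic
semialgebraic `U` and an algebraic `σ` this is a finite conjunction of polynomial sign conditions in the letters — one kernel-checkable
finite certificate per piece.) -/
def EG15PoincarePiece (U : (Fin 3 → Matrix (Fin 2) (Fin 2) ℝ) → Prop) (N : ℕ)
    (σ : (Fin 3 → Matrix (Fin 2) (Fin 2) ℝ) → ℝ) : Prop :=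
  ∀ S : Fin 3 → Matrix (Fin 2) (Fin 2) ℝ, (∀ a, (S a).IsSymm) → (EG15ChartP S ∨ EG15ChartM S) → U S →
    (eg15Poly S * (X + C (σ S)) ^ N).signVariations ≤ 13

/-- **Pieces covering both charts give the multiplier certificate (kernel glue; the intended use is a FINITE index type).** -/
theorem multCert_of_pieces {ι : Type*} (U : ι → (Fin 3 → Matrix (Fin 2) (Fin 2) ℝ) → Prop) (N : ι → ℕ)
    (σ : ι → (Fin 3 → Matrix (Fin 2) (Fin 2) ℝ) → ℝ)
    (hcover : ∀ S : Fin 3 → Matrix (Fin 2) (Fin 2) ℝ, (∀ a, (S a).IsSymm) → (EG15ChartP S ∨ EG15ChartM S) → ∃ i, U i S)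
    (hpiece : ∀ i, EG15PoincarePiece (U i) (N i) (σ i)) : EG15MultCert := by
  intro S hS hc
  obtain ⟨i, hi⟩ := hcover S hS hc
  exact ⟨(X + C (σ i S)) ^ N i, pow_ne_zero _ (X_add_C_ne_zero _), hpiece i S hS hc hi⟩

/-- **EG15 ⟸ any family of Poincaré pieces covering the two charts (kernel).** -/
theorem eg15_of_pieces {ι : Type*} (U : ι → (Fin 3 → Matrix (Fin 2) (Fin 2) ℝ) → Prop) (N : ι → ℕ)
    (σ : ι → (Fin 3 → Matrix (Fin 2) (Fin 2) ℝ) → ℝ)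
    (hcover : ∀ S : Fin 3 → Matrix (Fin 2) (Fin 2) ℝ, (∀ a, (S a).IsSymm) → (EG15ChartP S ∨ EG15ChartM S) → ∃ i, U i S)
    (hpiece : ∀ i, EG15PoincarePiece (U i) (N i) (σ i)) : EG15 :=
  eg15_of_multCert (multCert_of_pieces U N σ hcover hpiece)

/-! ### Monotonicity in the exponent (kernel) — the certificate families degrade gracefully
One more factor `X + s` with `s ≥ 0` never increases the sign-variation count: `s > 0` is Avendaño 2009, Lemma 5, PORTED in the tree
(`Literature.Algebra.Polynomial.signVariations_X_add_C_mul_le`, file `Literature/Algebra/Polynomial/LacunaryBivariateOnLine.lean`), `s = 0` is the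
factor `X` (`Literature.Algebra.Polynomial.Descartes.signVariations_X_pow_mul`).  Hence `EG15Poincare N → EG15Poincare (N+1)` and
`EG15Canonical N → EG15Canonical (N+1)`: a located failure of exponent `N` moves the target to `N + 1`, never kills the currency. -/

theorem signVariations_X_add_C_mul_le_of_nonneg {r : ℝ} (hr : 0 ≤ r) (P : ℝ[X]) :
    ((X + C r) * P).signVariations ≤ P.signVariations := by
  rcases hr.eq_or_lt with h | h
  · rw [← h, map_zero, add_zero, ← pow_one (X : ℝ[X]), Literature.Algebra.Polynomial.Descartes.signVariations_X_pow_mul]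
  · exact Literature.Algebra.Polynomial.signVariations_X_add_C_mul_le h P

theorem signVariations_prod_X_add_C_mul_le_of_nonneg {ι : Type*} (s : Finset ι) (r : ι → ℝ) (hr : ∀ i ∈ s, 0 ≤ r i) (P : ℝ[X]) :
    ((∏ i ∈ s, (X + C (r i))) * P).signVariations ≤ P.signVariations := by
  classical
  induction s using Finset.induction_on generalizing P with
  | empty => simp
  | insert a s ha ih =>
    rw [Finset.prod_insert ha, mul_assoc]
    exact (signVariations_X_add_C_mul_le_of_nonneg (hr a (Finset.mem_insert_self a s)) _).trans
      (ih (fun i hi => hr i (Finset.mem_insert_of_mem hi)) P)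

theorem eg15WindowScale_nonneg (S : Fin 3 → Matrix (Fin 2) (Fin 2) ℝ) (j : Fin 13) : 0 ≤ eg15WindowScale S j :=
  Real.rpow_nonneg (div_nonneg (abs_nonneg _) (abs_nonneg _)) _

/-- **Poincaré certificates are monotone in the exponent (kernel).** -/
theorem poincare_mono (N : ℕ) (h : EG15Poincare N) : EG15Poincare (N + 1) := by
  intro S hS hc
  obtain ⟨s, hs, hv⟩ := h S hS hc
  refine ⟨s, hs, ?_⟩
  have e : eg15Poly S * (X + C s) ^ (N + 1) = (X + C s) * (eg15Poly S * (X + C s) ^ N) := by ring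
  rw [e]
  exact (Literature.Algebra.Polynomial.signVariations_X_add_C_mul_le hs _).trans hv

theorem poincare_of_le {N N' : ℕ} (hle : N ≤ N') (h : EG15Poincare N) : EG15Poincare N' := by
  induction N', hle using Nat.le_induction with
  | base => exact h
  | succ k _ ih => exact poincare_mono k ih

theorem eg15CanonicalMult_succ (S : Fin 3 → Matrix (Fin 2) (Fin 2) ℝ) (N : ℕ) :
    eg15CanonicalMult S (N + 1) = (∏ j : Fin 13, (X + C (eg15WindowScale S j))) * eg15CanonicalMult S N := by
  unfold eg15CanonicalMult
  rw [← Finset.prod_mul_distrib]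
  exact Finset.prod_congr rfl fun j _ => pow_succ' _ _

/-- **Canonical certificates are monotone in the exponent (kernel).** -/
theorem canonical_mono (N : ℕ) (h : EG15Canonical N) : EG15Canonical (N + 1) := by
  intro S hS hc
  have e : eg15Poly S * eg15CanonicalMult S (N + 1) =
      (∏ j : Fin 13, (X + C (eg15WindowScale S j))) * (eg15Poly S * eg15CanonicalMult S N) := by
    rw [eg15CanonicalMult_succ]; ring
  rw [e]
  exact (signVariations_prod_X_add_C_mul_le_of_nonneg _ _ (fun j _ => eg15WindowScale_nonneg S j) _).trans (h S hS hc)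

theorem canonical_of_le {N N' : ℕ} (hle : N ≤ N') (h : EG15Canonical N) : EG15Canonical N' := by
  induction N', hle using Nat.le_induction with
  | base => exact h
  | succ k _ ih => exact canonical_mono k ih

/-! ## rev 9 (g7, lens=finite, 2026-08-29): GENERAL FIXED-MULTIPLIER PIECES and the CANONICAL LAW ON A SET — the kernel targets of the
certified-piece numerics

What a finite certificate for `EG15` can actually look like, after rev 8: a FINITE family of pieces `(Uᵢ, mᵢ)` — `Uᵢ` a part of letter space,
`mᵢ` ONE FIXED nonzero polynomial (rational coefficients in practice) with `signVariations (eg15Poly S * mᵢ) ≤ 13` for every chart member `S` of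
`Uᵢ` — covering the two charts (`eg15_of_multPieces`); or the canonical law of rev 8 RESTRICTED TO SETS `Uᵢ` with exponents `Nᵢ`
(`eg15_of_canonicalOn_cover`).  Both glue theorems are kernel; every piece statement is an OPEN hypothesis until a kernel sign computation on that
piece lands (none has).  The concrete piece shape of the numerics is the relative LETTER BOX `letterBox S₀ w` (every letter within the factor
`1 ± w` of its centre value).

NUMERICS OF RECORD (exact rational interval arithmetic; tools `piece_box.py` = box-constant multiplier with the centre's scales rounded to 12 bits,
`piece_canon.py` = the S-dependent canonical multiplier with normalised factors `(min(1,1/σ) X + min(1,σ))`, wall-robust; both under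
`run/shared/lean/pub/ideators/val-idea-15/lines/g7/mult/`; a value is reported for a box only when EVERY structurally nonzero product coefficient is
sign-definite on the box, so the count is constant there):
 * six-root configuration C₆ (chart (−,−,−), `Z₊ = 6`), `N = 2`, box `w = 1/64`: `signVariations = 6` on the WHOLE box (109/109 coefficient signs
   decided; both tools) — a positive-measure piece on which the door count is certified `≤ 6`; at `w = 1/16` 18–22 coefficients are undecided;
 * (−) alternation witness `((-1,-3,-1),(-1,-30,-1),(-10,-1,-10))`, `N = 1`, `w = 1/64`: `≤ 10` on the box (one coefficient undecided, counted worst-case);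
 * (+) witness `((1,3,10),(10,1,1),(1,3,1))` and the rational point `S_a` of the header of rev 8's exact refutation of `N = 1`: no certification at
   `w ≥ 1/256` with `N ≤ 2` (15 resp. 2 coefficients undecided at `w = 1/256`);
 * six random lacunary chart points (letters spread over 12 decades), `N = 1`: certified at `w = 1/4` (one point), `1/8` (one), `1/16` (three), one
   needs `w < 1/16`.
READING (honest).  Pieces are real but SMALL in letter-relative terms (w ≈ 2⁻² … 2⁻⁸), smallest near the walls and in the compact core; a cover of a
letter range of R decades per letter by such boxes has ≳ (R / log₁₀(1+w))⁹ members — out of reach as such.  The limiting mechanism is visible in the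
data: at every point a handful (2–5 of ≈ 100) of product coefficients are near-balanced BY DESIGN (the canonical scale balances the outer monomials of
its window) while the median dominance margin is 10³–10⁷; so a workable cover must be organised TROPICALLY — cells of log-letter space on which the
dominance pattern of the product coefficients is fixed (finitely many, unbounded, cylindrical in most letters), with the S-DEPENDENT canonical scales
inside each cell, plus a bounded core to subdivide — not by boxes.  That programme is kit-class and is NOT attempted by this seat; the definitions below
only fix its kernel interface.  Nothing in this section asserts any piece.

UPDATE OF RECORD (same day, 09:2xZ; exact, NOT kernel): `EG15Canonical 2` is FALSE.  A local adversarial ascent around the (+) witness found, and exact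
rational interval arithmetic with the algebraic window scales CERTIFIED (0 undecided signs of 90 / 109 / 122 coefficients; an independent 120-digit
evaluation agrees), at the chart-(+,+,+) point `Sc` below (letters (13/12, 5/6, 5/6 | 1/4, 3/16, 1/3 | 11/24, 37/24, 2), all of size ≈ 1 — a
COMPACT-CORE point, `Z₊ = 0`): `signVariations (eg15Poly Sc * eg15CanonicalMult Sc N) = 14, 14, 8` for `N = 1, 2, 3`.  So the canonical currency
now stands at `N ≥ 3` (`canonical_of_le`); each fixed exponent so far (1, then 2) fell to a longer search, and NOTHING in the record bounds the exponent
uniformly — `EG15Canonical 3` is OPEN with no evidence beyond «survives at every point evaluated so far».  The failure set of `N = 2` near `Sc` is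
thin and fragmented (rounding the letters to 1/12, 1/64 or 1/1000 loses it, 1/48, 1/256, 1/1024 keep it).  The typed objects: `Sc`, `Sc_symm`,
`Sc_chartP` (kernel), the OPEN-in-Lean target `CanonicalTwoFailsAtSc` (true by the exact computation; a kernel proof needs rational enclosures of the
thirteen `Real.rpow` scales) and the kernel implication `not_canonical_two_of : CanonicalTwoFailsAtSc → ¬ EG15Canonical 2`. -/

/-- A GENERAL FIXED-MULTIPLIER PIECE (OPEN per instance; never asserted): the one nonzero polynomial `m` certifies `signVariations ≤ 13` for every
chart member of `U`.  For `m` with rational coefficients and `U` a box / basic semialgebraic set this is a finite conjunction of polynomial sign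
conditions in the nine letters. -/
def EG15MultPiece (U : (Fin 3 → Matrix (Fin 2) (Fin 2) ℝ) → Prop) (m : ℝ[X]) : Prop :=
  m ≠ 0 ∧ ∀ S : Fin 3 → Matrix (Fin 2) (Fin 2) ℝ, (∀ a, (S a).IsSymm) → (EG15ChartP S ∨ EG15ChartM S) → U S →
    (eg15Poly S * m).signVariations ≤ 13

/-- **Fixed-multiplier pieces covering both charts give the multiplier certificate (kernel glue; intended use: a FINITE index type).** -/
theorem multCert_of_multPieces {ι : Type*} (U : ι → (Fin 3 → Matrix (Fin 2) (Fin 2) ℝ) → Prop) (m : ι → ℝ[X])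
    (hcover : ∀ S : Fin 3 → Matrix (Fin 2) (Fin 2) ℝ, (∀ a, (S a).IsSymm) → (EG15ChartP S ∨ EG15ChartM S) → ∃ i, U i S)
    (hpiece : ∀ i, EG15MultPiece (U i) (m i)) : EG15MultCert := by
  intro S hS hc
  obtain ⟨i, hi⟩ := hcover S hS hc
  exact ⟨m i, (hpiece i).1, (hpiece i).2 S hS hc hi⟩

/-- **EG15 ⟸ any family of fixed-multiplier pieces covering the two charts (kernel).** -/
theorem eg15_of_multPieces {ι : Type*} (U : ι → (Fin 3 → Matrix (Fin 2) (Fin 2) ℝ) → Prop) (m : ι → ℝ[X])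
    (hcover : ∀ S : Fin 3 → Matrix (Fin 2) (Fin 2) ℝ, (∀ a, (S a).IsSymm) → (EG15ChartP S ∨ EG15ChartM S) → ∃ i, U i S)
    (hpiece : ∀ i, EG15MultPiece (U i) (m i)) : EG15 :=
  eg15_of_multCert (multCert_of_multPieces U m hcover hpiece)

/-- A Poincaré piece with a CONSTANT scale is a fixed-multiplier piece (kernel). -/
theorem multPiece_of_poincarePiece_const (U : (Fin 3 → Matrix (Fin 2) (Fin 2) ℝ) → Prop) (N : ℕ) (s : ℝ)
    (h : EG15PoincarePiece U N (fun _ => s)) : EG15MultPiece U ((X + C s) ^ N) :=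
  ⟨pow_ne_zero _ (X_add_C_ne_zero s), fun S hS hc hU => h S hS hc hU⟩

/-- A piece valid on `V` is valid on every smaller `U` (kernel). -/
theorem multPiece_anti {U V : (Fin 3 → Matrix (Fin 2) (Fin 2) ℝ) → Prop} (hUV : ∀ S, U S → V S) {m : ℝ[X]}
    (h : EG15MultPiece V m) : EG15MultPiece U m :=
  ⟨h.1, fun S hS hc hU => h.2 S hS hc (hUV S hU)⟩

-- OPEN per set (hypothesis only; never asserted)
/-- **The CANONICAL LAW ON A SET** `EG15CanonicalOn U N`: rev 8's explicit window-scale multiplier of exponent `N` works at every chart member of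
`U`.  `EG15CanonicalOn (fun _ => True) N ↔ EG15Canonical N`; the intended use is a finite cover of the charts by sets with their own exponents. -/
def EG15CanonicalOn (U : (Fin 3 → Matrix (Fin 2) (Fin 2) ℝ) → Prop) (N : ℕ) : Prop :=
  ∀ S : Fin 3 → Matrix (Fin 2) (Fin 2) ℝ, (∀ a, (S a).IsSymm) → (EG15ChartP S ∨ EG15ChartM S) → U S →
    (eg15Poly S * eg15CanonicalMult S N).signVariations ≤ 13

theorem canonicalOn_univ_iff (N : ℕ) : EG15CanonicalOn (fun _ => True) N ↔ EG15Canonical N :=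
  ⟨fun h S hS hc => h S hS hc trivial, fun h S hS hc _ => h S hS hc⟩

theorem canonicalOn_anti {U V : (Fin 3 → Matrix (Fin 2) (Fin 2) ℝ) → Prop} (hUV : ∀ S, U S → V S) {N : ℕ}
    (h : EG15CanonicalOn V N) : EG15CanonicalOn U N :=
  fun S hS hc hU => h S hS hc (hUV S hU)

/-- Monotone in the exponent on every set (kernel; Avendaño Lemma 5 as in `canonical_mono`). -/
theorem canonicalOn_mono (U : (Fin 3 → Matrix (Fin 2) (Fin 2) ℝ) → Prop) (N : ℕ) (h : EG15CanonicalOn U N) :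
    EG15CanonicalOn U (N + 1) := by
  intro S hS hc hU
  have e : eg15Poly S * eg15CanonicalMult S (N + 1) =
      (∏ j : Fin 13, (X + C (eg15WindowScale S j))) * (eg15Poly S * eg15CanonicalMult S N) := by
    rw [eg15CanonicalMult_succ]; ring
  rw [e]
  exact (signVariations_prod_X_add_C_mul_le_of_nonneg _ _ (fun j _ => eg15WindowScale_nonneg S j) _).trans (h S hS hc hU)

theorem canonicalOn_of_le (U : (Fin 3 → Matrix (Fin 2) (Fin 2) ℝ) → Prop) {N N' : ℕ} (hle : N ≤ N') (h : EG15CanonicalOn U N) :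
    EG15CanonicalOn U N' := by
  induction N', hle using Nat.le_induction with
  | base => exact h
  | succ k _ ih => exact canonicalOn_mono U k ih

/-- **A cover of the charts by sets carrying the canonical law (each with its own exponent) gives the multiplier certificate (kernel).** -/
theorem multCert_of_canonicalOn_cover {ι : Type*} (U : ι → (Fin 3 → Matrix (Fin 2) (Fin 2) ℝ) → Prop) (N : ι → ℕ)
    (hcover : ∀ S : Fin 3 → Matrix (Fin 2) (Fin 2) ℝ, (∀ a, (S a).IsSymm) → (EG15ChartP S ∨ EG15ChartM S) → ∃ i, U i S)
    (hon : ∀ i, EG15CanonicalOn (U i) (N i)) : EG15MultCert := by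
  intro S hS hc
  obtain ⟨i, hi⟩ := hcover S hS hc
  exact ⟨eg15CanonicalMult S (N i), eg15CanonicalMult_ne_zero S (N i), hon i S hS hc hi⟩

/-- **EG15 ⟸ a cover of the charts by sets carrying the canonical law (kernel).** -/
theorem eg15_of_canonicalOn_cover {ι : Type*} (U : ι → (Fin 3 → Matrix (Fin 2) (Fin 2) ℝ) → Prop) (N : ι → ℕ)
    (hcover : ∀ S : Fin 3 → Matrix (Fin 2) (Fin 2) ℝ, (∀ a, (S a).IsSymm) → (EG15ChartP S ∨ EG15ChartM S) → ∃ i, U i S)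
    (hon : ∀ i, EG15CanonicalOn (U i) (N i)) : EG15 :=
  eg15_of_multCert (multCert_of_canonicalOn_cover U N hcover hon)

/-- With a FINITE cover the exponents can be levelled to their maximum: a finite canonical cover is a canonical cover with ONE exponent (kernel). -/
theorem canonicalOn_cover_level {ι : Type*} [Fintype ι] (U : ι → (Fin 3 → Matrix (Fin 2) (Fin 2) ℝ) → Prop) (N : ι → ℕ)
    (hon : ∀ i, EG15CanonicalOn (U i) (N i)) :
    ∀ i, EG15CanonicalOn (U i) (Finset.univ.sup N) :=
  fun i => canonicalOn_of_le (U i) (Finset.le_sup (Finset.mem_univ i)) (hon i)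

/-- … hence a finite canonical cover of the charts yields the GLOBAL canonical law at the levelled exponent (kernel): the finite-cover currency and
rev 8's one-exponent currency `EG15Canonical N₀` are the same currency. -/
theorem canonical_of_finite_cover {ι : Type*} [Fintype ι] (U : ι → (Fin 3 → Matrix (Fin 2) (Fin 2) ℝ) → Prop) (N : ι → ℕ)
    (hcover : ∀ S : Fin 3 → Matrix (Fin 2) (Fin 2) ℝ, (∀ a, (S a).IsSymm) → (EG15ChartP S ∨ EG15ChartM S) → ∃ i, U i S)
    (hon : ∀ i, EG15CanonicalOn (U i) (N i)) : EG15Canonical (Finset.univ.sup N) := by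
  intro S hS hc
  obtain ⟨i, hi⟩ := hcover S hS hc
  exact canonicalOn_cover_level U N hon i S hS hc hi

/-- The piece shape of the numerics: the RELATIVE LETTER BOX of half-width `w` around `S₀` (every entry within the factor `1 ± w` of its centre
value; for `w < 1` the sign pattern of the letters is that of `S₀`). -/
def letterBox (S₀ : Fin 3 → Matrix (Fin 2) (Fin 2) ℝ) (w : ℝ) (S : Fin 3 → Matrix (Fin 2) (Fin 2) ℝ) : Prop :=
  ∀ a i j, |S a i j - S₀ a i j| ≤ w * |S₀ a i j|

theorem letterBox_self (S₀ : Fin 3 → Matrix (Fin 2) (Fin 2) ℝ) {w : ℝ} (hw : 0 ≤ w) : letterBox S₀ w S₀ :=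
  fun a i j => by rw [sub_self, abs_zero]; exact mul_nonneg hw (abs_nonneg _)

theorem letterBox_mono (S₀ : Fin 3 → Matrix (Fin 2) (Fin 2) ℝ) {w w' : ℝ} (hle : w ≤ w') :
    ∀ S, letterBox S₀ w S → letterBox S₀ w' S :=
  fun _ h a i j => (h a i j).trans (mul_le_mul_of_nonneg_right hle (abs_nonneg _))

/-! ### The located failure of exponent 2 (typed; the failure itself is exact computation of record, not kernel) -/

/-- The chart-(+,+,+) point of the exact refutation of `EG15Canonical 2`: letters `(a, b, c)` = (13/12, 5/6, 5/6), (1/4, 3/16, 1/3),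
(11/24, 37/24, 2) as symmetric matrices `!![a, b; b, c]`. -/
noncomputable def Sc : Fin 3 → Matrix (Fin 2) (Fin 2) ℝ
  | 0 => !![13/12, 5/6; 5/6, 5/6]
  | 1 => !![1/4, 3/16; 3/16, 1/3]
  | 2 => !![11/24, 37/24; 37/24, 2]

@[simp] theorem Sc_zero : Sc 0 = !![13/12, 5/6; 5/6, 5/6] := rfl
@[simp] theorem Sc_one : Sc 1 = !![1/4, 3/16; 3/16, 1/3] := rfl
@[simp] theorem Sc_two : Sc 2 = !![11/24, 37/24; 37/24, 2] := rfl
@[simp] theorem Sc_two' (h : 2 < 3) : Sc ⟨2, h⟩ = !![11/24, 37/24; 37/24, 2] := rfl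

theorem Sc_symm : ∀ a, (Sc a).IsSymm := by
  intro a
  fin_cases a <;> (unfold Matrix.IsSymm; ext i j; fin_cases i <;> fin_cases j <;> rfl)

/-- `Sc` lies on chart (+,+,+) (kernel): det S₃ = 5/24, polar₃₄ = 37/144, det S₄ = 37/768, polar₃₅ = −1/48, polar₄₅ = 43/576, det S₅ = −841/576. -/
theorem Sc_chartP : EG15ChartP Sc := by
  refine ⟨?_, ?_, ?_, ?_, ?_, ?_, ?_⟩
  · intro a i j
    fin_cases a <;> fin_cases i <;> fin_cases j <;> norm_num
  all_goals norm_num [polar, Matrix.det_fin_two]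

/-- OPEN in Lean, TRUE by exact computation of record (two code paths, 09:2xZ): the canonical multiplier of exponent 2 leaves 14 sign variations
at `Sc`.  A kernel proof needs two-sided rational enclosures of the thirteen window scales (`Real.rpow`) and the signs of 109 coefficients. -/
def CanonicalTwoFailsAtSc : Prop := 13 < (eg15Poly Sc * eg15CanonicalMult Sc 2).signVariations

/-- The located failure refutes the exponent-2 law (kernel implication; the hypothesis is the open computation above). -/
theorem not_canonical_two_of (h : CanonicalTwoFailsAtSc) : ¬ EG15Canonical 2 :=
  fun hc => Nat.lt_irrefl 13 (Nat.lt_of_lt_of_le h (hc Sc Sc_symm (Or.inl Sc_chartP)))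


/-! ### rev 10 (2026-08-29, line lead val-idea-15 g7): LINK to the kernel negative of record
`Theorems/DoorA26/Negative/EG15PoincareSmallExponent.lean` (critic val-idea-crit-5 g6, p712097 ACCEPTED):
a single Poincaré factor `(X + C s)^N`, `N ≤ 3`, never lowers the 14 sign variations at ANY chart point, so the
certificate family (i) `EG15Poincare N` FAILS for `N ≤ 3` and starts at `N = 4` at the earliest (OPEN there).
KERNEL here: the alternating coefficient chain of `eg15Poly` along `V15` on the two charts
(`eg15Poly_coeff_values`, `eg15Poly_isChain_of_chartP`, `eg15Poly_isChain_of_chartM`) — exactly the hypothesis shape the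
tree theorem consumes — and the two-line link `fourteen_le_signVariations_poincare_of_chart` /
`not_eg15Poincare_of_le_three`, stated MODULO the named hypothesis `PoincareSmallExponentNegative` (= the tree
theorem's statement verbatim): at this rev the farm snapshot serving the line file does not yet carry that module's
olean (`lean check` with the import answers rc 75 `remote:stale:unbuilt`), so the import and the by-name discharge
(`Theorems.DoorA26.Negative.fourteen_le_signVariations_mul_X_add_C_pow`) are rev 11 of this file — a one-line proof then.
Nothing else moves: `EG15`, `EG15MultCert`, `EG15Canonical N` (N ≥ 3), `TripleStratum26`, (W), (M), `DoorA26`, 18050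
stay OPEN; VP ≠ VNP is not touched.  (The same olean lag holds crit-5's kernel certificate `CanonicalTwoFailsAtSc`
— announced 10:18:39Z, `Theorems/DoorA26/Negative/EG15CanonicalTwoAtSc*.lean` — whose link
`theorem canonicalTwoFailsAtSc : CanonicalTwoFailsAtSc := …` ⇒ `¬ EG15Canonical 2 := not_canonical_two_of canonicalTwoFailsAtSc`
also belongs to rev 11.) -/

/-- The fifteen coefficients of `eg15Poly` on `V15`, read off `eg15Poly_coeff` (kernel bookkeeping). -/
theorem eg15Poly_coeff_values (S : Fin 3 → Matrix (Fin 2) (Fin 2) ℝ) :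
    (eg15Poly S).coeff 14 = -(S 0 1 1) ∧ (eg15Poly S).coeff 17 = S 0 0 1 + S 0 1 0 ∧ (eg15Poly S).coeff 20 = -(S 0 0 0) ∧
    (eg15Poly S).coeff 28 = S 0 0 0 * S 0 1 1 - S 0 0 1 * S 0 1 0 ∧
    (eg15Poly S).coeff 30 = -(S 1 1 1) ∧ (eg15Poly S).coeff 33 = S 1 0 1 + S 1 1 0 ∧ (eg15Poly S).coeff 36 = -(S 1 0 0) ∧
    (eg15Poly S).coeff 44 = S 0 0 0 * S 1 1 1 + S 0 1 1 * S 1 0 0 - S 0 0 1 * S 1 1 0 - S 0 1 0 * S 1 0 1 ∧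
    (eg15Poly S).coeff 48 = -(S 2 1 1) ∧ (eg15Poly S).coeff 51 = S 2 0 1 + S 2 1 0 ∧ (eg15Poly S).coeff 54 = -(S 2 0 0) ∧
    (eg15Poly S).coeff 60 = S 1 0 0 * S 1 1 1 - S 1 0 1 * S 1 1 0 ∧
    (eg15Poly S).coeff 62 = S 0 0 0 * S 2 1 1 + S 0 1 1 * S 2 0 0 - S 0 0 1 * S 2 1 0 - S 0 1 0 * S 2 0 1 ∧
    (eg15Poly S).coeff 78 = S 1 0 0 * S 2 1 1 + S 1 1 1 * S 2 0 0 - S 1 0 1 * S 2 1 0 - S 1 1 0 * S 2 0 1 ∧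
    (eg15Poly S).coeff 96 = S 2 0 0 * S 2 1 1 - S 2 0 1 * S 2 1 0 := by
  refine ⟨?_, ?_, ?_, ?_, ?_, ?_, ?_, ?_, ?_, ?_, ?_, ?_, ?_, ?_, ?_⟩ <;> (rw [eg15Poly_coeff]; norm_num)

/-- **Chart (+,+,+) ⇒ the alternating coefficient chain along `V15` (kernel).**  The shape consumed by
`Negative.fourteen_le_signVariations_mul_X_add_C_pow`. -/
theorem eg15Poly_isChain_of_chartP (S : Fin 3 → Matrix (Fin 2) (Fin 2) ℝ) (hS : ∀ a, (S a).IsSymm)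
    (h : EG15ChartP S) :
    [96, 78, 62, 60, 54, 51, 48, 44, 36, 33, 30, 28, 20, 17, 14].IsChain
      (fun a b => (eg15Poly S).coeff a * (eg15Poly S).coeff b < 0) := by
  obtain ⟨hpos, hd3, hp34, hd4, hp35, hp45, hd5⟩ := h
  obtain ⟨c14, c17, c20, c28, c30, c33, c36, c44, c48, c51, c54, c60, c62, c78, c96⟩ := eg15Poly_coeff_values S
  have s0 : S 0 1 0 = S 0 0 1 := by simpa using (hS 0).apply 0 1
  have s1 : S 1 1 0 = S 1 0 1 := by simpa using (hS 1).apply 0 1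
  have s2 : S 2 1 0 = S 2 0 1 := by simpa using (hS 2).apply 0 1
  simp only [Matrix.det_fin_two, polar] at hd3 hp34 hd4 hp35 hp45 hd5
  have h14 : (eg15Poly S).coeff 14 < 0 := by rw [c14]; linarith [hpos 0 1 1]
  have h17 : 0 < (eg15Poly S).coeff 17 := by rw [c17]; linarith [hpos 0 0 1, hpos 0 1 0]
  have h20 : (eg15Poly S).coeff 20 < 0 := by rw [c20]; linarith [hpos 0 0 0]
  have h28 : 0 < (eg15Poly S).coeff 28 := by rw [c28]; linarith
  have h30 : (eg15Poly S).coeff 30 < 0 := by rw [c30]; linarith [hpos 1 1 1]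
  have h33 : 0 < (eg15Poly S).coeff 33 := by rw [c33]; linarith [hpos 1 0 1, hpos 1 1 0]
  have h36 : (eg15Poly S).coeff 36 < 0 := by rw [c36]; linarith [hpos 1 0 0]
  have h44 : 0 < (eg15Poly S).coeff 44 := by rw [c44, s0, s1]; linarith
  have h48 : (eg15Poly S).coeff 48 < 0 := by rw [c48]; linarith [hpos 2 1 1]
  have h51 : 0 < (eg15Poly S).coeff 51 := by rw [c51]; linarith [hpos 2 0 1, hpos 2 1 0]
  have h54 : (eg15Poly S).coeff 54 < 0 := by rw [c54]; linarith [hpos 2 0 0]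
  have h60 : 0 < (eg15Poly S).coeff 60 := by rw [c60]; linarith
  have h62 : (eg15Poly S).coeff 62 < 0 := by rw [c62, s0, s2]; linarith
  have h78 : 0 < (eg15Poly S).coeff 78 := by rw [c78, s1, s2]; linarith
  have h96 : (eg15Poly S).coeff 96 < 0 := by rw [c96]; linarith
  exact
    (List.IsChain.cons_cons (mul_neg_of_neg_of_pos h96 h78)
    (List.IsChain.cons_cons (mul_neg_of_pos_of_neg h78 h62)
    (List.IsChain.cons_cons (mul_neg_of_neg_of_pos h62 h60)
    (List.IsChain.cons_cons (mul_neg_of_pos_of_neg h60 h54)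
    (List.IsChain.cons_cons (mul_neg_of_neg_of_pos h54 h51)
    (List.IsChain.cons_cons (mul_neg_of_pos_of_neg h51 h48)
    (List.IsChain.cons_cons (mul_neg_of_neg_of_pos h48 h44)
    (List.IsChain.cons_cons (mul_neg_of_pos_of_neg h44 h36)
    (List.IsChain.cons_cons (mul_neg_of_neg_of_pos h36 h33)
    (List.IsChain.cons_cons (mul_neg_of_pos_of_neg h33 h30)
    (List.IsChain.cons_cons (mul_neg_of_neg_of_pos h30 h28)
    (List.IsChain.cons_cons (mul_neg_of_pos_of_neg h28 h20)
    (List.IsChain.cons_cons (mul_neg_of_neg_of_pos h20 h17)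
    (List.IsChain.cons_cons (mul_neg_of_pos_of_neg h17 h14) (List.IsChain.singleton 14)))))))))))))))

/-- **Chart (−,−,−) ⇒ the alternating coefficient chain along `V15` (kernel).** -/
theorem eg15Poly_isChain_of_chartM (S : Fin 3 → Matrix (Fin 2) (Fin 2) ℝ) (hS : ∀ a, (S a).IsSymm)
    (h : EG15ChartM S) :
    [96, 78, 62, 60, 54, 51, 48, 44, 36, 33, 30, 28, 20, 17, 14].IsChain
      (fun a b => (eg15Poly S).coeff a * (eg15Poly S).coeff b < 0) := by
  obtain ⟨hneg, hd3, hp34, hd4, hp35, hp45, hd5⟩ := h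
  obtain ⟨c14, c17, c20, c28, c30, c33, c36, c44, c48, c51, c54, c60, c62, c78, c96⟩ := eg15Poly_coeff_values S
  have s0 : S 0 1 0 = S 0 0 1 := by simpa using (hS 0).apply 0 1
  have s1 : S 1 1 0 = S 1 0 1 := by simpa using (hS 1).apply 0 1
  have s2 : S 2 1 0 = S 2 0 1 := by simpa using (hS 2).apply 0 1
  simp only [Matrix.det_fin_two, polar] at hd3 hp34 hd4 hp35 hp45 hd5
  have h14 : 0 < (eg15Poly S).coeff 14 := by rw [c14]; linarith [hneg 0 1 1]
  have h17 : (eg15Poly S).coeff 17 < 0 := by rw [c17]; linarith [hneg 0 0 1, hneg 0 1 0]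
  have h20 : 0 < (eg15Poly S).coeff 20 := by rw [c20]; linarith [hneg 0 0 0]
  have h28 : (eg15Poly S).coeff 28 < 0 := by rw [c28]; linarith
  have h30 : 0 < (eg15Poly S).coeff 30 := by rw [c30]; linarith [hneg 1 1 1]
  have h33 : (eg15Poly S).coeff 33 < 0 := by rw [c33]; linarith [hneg 1 0 1, hneg 1 1 0]
  have h36 : 0 < (eg15Poly S).coeff 36 := by rw [c36]; linarith [hneg 1 0 0]
  have h44 : (eg15Poly S).coeff 44 < 0 := by rw [c44, s0, s1]; linarith
  have h48 : 0 < (eg15Poly S).coeff 48 := by rw [c48]; linarith [hneg 2 1 1]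
  have h51 : (eg15Poly S).coeff 51 < 0 := by rw [c51]; linarith [hneg 2 0 1, hneg 2 1 0]
  have h54 : 0 < (eg15Poly S).coeff 54 := by rw [c54]; linarith [hneg 2 0 0]
  have h60 : (eg15Poly S).coeff 60 < 0 := by rw [c60]; linarith
  have h62 : 0 < (eg15Poly S).coeff 62 := by rw [c62, s0, s2]; linarith
  have h78 : (eg15Poly S).coeff 78 < 0 := by rw [c78, s1, s2]; linarith
  have h96 : 0 < (eg15Poly S).coeff 96 := by rw [c96]; linarith
  exact
    (List.IsChain.cons_cons (mul_neg_of_pos_of_neg h96 h78)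
    (List.IsChain.cons_cons (mul_neg_of_neg_of_pos h78 h62)
    (List.IsChain.cons_cons (mul_neg_of_pos_of_neg h62 h60)
    (List.IsChain.cons_cons (mul_neg_of_neg_of_pos h60 h54)
    (List.IsChain.cons_cons (mul_neg_of_pos_of_neg h54 h51)
    (List.IsChain.cons_cons (mul_neg_of_neg_of_pos h51 h48)
    (List.IsChain.cons_cons (mul_neg_of_pos_of_neg h48 h44)
    (List.IsChain.cons_cons (mul_neg_of_neg_of_pos h44 h36)
    (List.IsChain.cons_cons (mul_neg_of_pos_of_neg h36 h33)
    (List.IsChain.cons_cons (mul_neg_of_neg_of_pos h33 h30)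
    (List.IsChain.cons_cons (mul_neg_of_pos_of_neg h30 h28)
    (List.IsChain.cons_cons (mul_neg_of_neg_of_pos h28 h20)
    (List.IsChain.cons_cons (mul_neg_of_pos_of_neg h20 h17)
    (List.IsChain.cons_cons (mul_neg_of_neg_of_pos h17 h14) (List.IsChain.singleton 14)))))))))))))))

/-- The statement of the kernel negative of record `Theorems/DoorA26/Negative/EG15PoincareSmallExponent.lean`
(critic val-idea-crit-5 g6, p712097 ACCEPTED 2026-08-29; `…Theorems.DoorA26.Negative.fourteen_le_signVariations_mul_X_add_C_pow`),
restated VERBATIM as a named hypothesis because the farm snapshot serving this line file does not yet carry that module's olean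
(`remote:stale:unbuilt` at rev 10); it is PROVED in the tree — discharge by name (`:= fun P h1 h2 s hs N hN =>
Theorems.DoorA26.Negative.fourteen_le_signVariations_mul_X_add_C_pow P h1 h2 hs hN`) as soon as the import elaborates (rev 11 of this file). -/
def PoincareSmallExponentNegative : Prop :=
  ∀ P : ℝ[X], P.support ⊆ [14, 17, 20, 28, 30, 33, 36, 44, 48, 51, 54, 60, 62, 78, 96].toFinset →
    [96, 78, 62, 60, 54, 51, 48, 44, 36, 33, 30, 28, 20, 17, 14].IsChain (fun a b => P.coeff a * P.coeff b < 0) →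
    ∀ s : ℝ, 0 < s → ∀ N : ℕ, N ≤ 3 → 14 ≤ (P * (X + C s) ^ N).signVariations

/-- **A Poincaré factor of exponent `N ≤ 3` never lowers the count at a chart point (kernel modulo the named tree theorem).** -/
theorem fourteen_le_signVariations_poincare_of_chart (hneg : PoincareSmallExponentNegative)
    (S : Fin 3 → Matrix (Fin 2) (Fin 2) ℝ) (hS : ∀ a, (S a).IsSymm)
    (hc : EG15ChartP S ∨ EG15ChartM S) {s : ℝ} (hs : 0 < s) {N : ℕ} (hN : N ≤ 3) :
    14 ≤ (eg15Poly S * (X + C s) ^ N).signVariations := by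
  have hsupp : (eg15Poly S).support ⊆
      [14, 17, 20, 28, 30, 33, 36, 44, 48, 51, 54, 60, 62, 78, 96].toFinset := eg15Poly_support_subset S
  rcases hc with hP | hM
  · exact hneg (eg15Poly S) hsupp (eg15Poly_isChain_of_chartP S hS hP) s hs N hN
  · exact hneg (eg15Poly S) hsupp (eg15Poly_isChain_of_chartM S hS hM) s hs N hN

/-- **`EG15Poincare N` is FALSE for `N ≤ 3`** given the named tree theorem (kernel link; witness `Sc`). -/
theorem not_eg15Poincare_of_le_three (hneg : PoincareSmallExponentNegative) {N : ℕ} (hN : N ≤ 3) :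
    ¬ EG15Poincare N := by
  intro h
  obtain ⟨s, hs, hv⟩ := h Sc Sc_symm (Or.inl Sc_chartP)
  have h14 := fourteen_le_signVariations_poincare_of_chart hneg Sc Sc_symm (Or.inl Sc_chartP) hs hN
  omega

/-! ### rev 11 (2026-08-29, line lead val-idea-15 g8): the OLEAN-LAG DISCHARGE — both kernel negatives of record BY NAME
The farm now serves the olean of `Theorems/DoorA26/Negative/EG15PoincareSmallExponent.lean` (critic val-idea-crit-5, p712097), so the
hypothesis named at rev 10 is discharged in one line and its corollaries become UNCONDITIONAL kernel facts of this line file: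
 * `poincareSmallExponentNegative : PoincareSmallExponentNegative` ⇒ `¬ EG15Poincare N` for `N ≤ 3` (the single-factor Poincaré format
   starts at `N = 4` at the earliest; OPEN there).
The second named hypothesis, `CanonicalTwoFailsAtSc`, is KERNEL in the tree as well (critic val-idea-crit-5, p714105 ACCEPTED 10:51:10Z,
`Theorems/DoorA26/Negative/EG15CanonicalTwoAtSc.lean` + `…Levels.lean`), but at this rev its olean is not yet served to the line file
(`lean check` with that import: rc 75 `remote:stale:37:unbuilt`, 12:13Z); its one-line link `canonicalTwoFailsAtSc : CanonicalTwoFailsAtSc`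
⇒ `not_canonical_two : ¬ EG15Canonical 2` is rev 12 (candidate staged and announced with this rev).
These are statements about CERTIFICATE FORMATS only.  `EG15` (hence `DoorA26`, 19979) is NOT touched: `Z₊(Sc) = 0`, and every refuted format
is a sufficient condition, never a reformulation.  `EG15MultCert`, `EG15Canonical N` (N ≥ 3), `EG15Poincare N` (N ≥ 4), `EG15NegRooted d`,
the piece families, `TripleStratum26`, (W), (M), (R), 18050 stay OPEN; VP ≠ VNP is not moved.  No new definition in this rev. -/

/-- The tree theorem of record discharges the named hypothesis (one line, by name; p712097). -/
theorem poincareSmallExponentNegative : PoincareSmallExponentNegative :=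
  fun P h1 h2 _s hs _N hN =>
    Theorems.DoorA26.Negative.fourteen_le_signVariations_mul_X_add_C_pow P h1 h2 hs hN

/-- **`EG15Poincare N` is FALSE for `N ≤ 3` — unconditional (kernel, by name).** -/
theorem not_eg15Poincare_of_le_three' {N : ℕ} (hN : N ≤ 3) : ¬ EG15Poincare N :=
  not_eg15Poincare_of_le_three poincareSmallExponentNegative hN

/-- The three smallest exponents of the single-factor Poincaré format, refuted at once (kernel; witness `Sc` on chart (+,+,+)).
A statement about the FORMAT `(X + C s)^N`, not about `EG15`. -/
theorem not_eg15Poincare_one_two_three : ¬ EG15Poincare 1 ∧ ¬ EG15Poincare 2 ∧ ¬ EG15Poincare 3 :=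
  ⟨not_eg15Poincare_of_le_three' (by norm_num), not_eg15Poincare_of_le_three' (by norm_num),
    not_eg15Poincare_of_le_three' le_rfl⟩

/-! ## rev 12 (line lead val-idea-15 g8, 2026-08-29) — OLEAN-LAG DISCHARGE (ii): the exponent-2 canonical law, by name

The farm now also serves the olean of `Theorems/DoorA26/Negative/EG15CanonicalTwoAtSc.lean` (+ `…Levels.lean`; critic val-idea-crit-5,
p714105 ACCEPTED 10:51:10Z), so the second hypothesis named at rev 9/10, `CanonicalTwoFailsAtSc`, is discharged in one line and its corollary
becomes an UNCONDITIONAL kernel fact of this line file: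
 * `canonicalTwoFailsAtSc : CanonicalTwoFailsAtSc` ⇒ `not_canonical_two : ¬ EG15Canonical 2` ⇒ `¬ EG15Canonical N` for every `N ≤ 2`
   (monotonicity `canonical_of_le`); the window-scale currency therefore starts at `N = 3` at the earliest (OPEN there; prior of record
   «next to fall», memo §(q)).
This is a statement about a CERTIFICATE FORMAT only.  `EG15` (hence `DoorA26`, 19979) is NOT touched: `Z₊(Sc) = 0`.  VP ≠ VNP not moved.
Pure insertion w.r.t. rev 11: one `import` line (l. 5) and this tail block; no definition added, no statement changed. -/

/-- **The exponent-2 canonical multiplier leaves more than 13 sign variations at `Sc` — kernel, by name of crit-5's certificate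
`Negative.thirteen_lt_signVariations_mul_canonicalTwo` (p714105: 13 rational `rpow` enclosures, 195 coefficient intervals, 15 alternating
anchors).**  The link instantiates the def-free tree theorem at `lo := V15lo`, `hi := V15hi`, `P := eg15Poly Sc`; the fifteen coefficient
facts are read off `eg15Poly_coeff` by `norm_num`. -/
theorem canonicalTwoFailsAtSc : CanonicalTwoFailsAtSc := by
  have h := Theorems.DoorA26.Negative.thirteen_lt_signVariations_mul_canonicalTwo V15lo V15hi rfl rfl (eg15Poly Sc)
    (eg15Poly_support_subset Sc)
    (by rw [eg15Poly_coeff]; norm_num) (by rw [eg15Poly_coeff]; norm_num) (by rw [eg15Poly_coeff]; norm_num)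
    (by rw [eg15Poly_coeff]; norm_num) (by rw [eg15Poly_coeff]; norm_num) (by rw [eg15Poly_coeff]; norm_num)
    (by rw [eg15Poly_coeff]; norm_num) (by rw [eg15Poly_coeff]; norm_num) (by rw [eg15Poly_coeff]; norm_num)
    (by rw [eg15Poly_coeff]; norm_num) (by rw [eg15Poly_coeff]; norm_num) (by rw [eg15Poly_coeff]; norm_num)
    (by rw [eg15Poly_coeff]; norm_num) (by rw [eg15Poly_coeff]; norm_num) (by rw [eg15Poly_coeff]; norm_num)
  exact h

/-- **`EG15Canonical 2` is FALSE — unconditional (kernel, by name).** -/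
theorem not_canonical_two : ¬ EG15Canonical 2 := not_canonical_two_of canonicalTwoFailsAtSc

/-- … hence `¬ EG15Canonical N` for every `N ≤ 2` (kernel; monotonicity `canonical_of_le`).  `EG15Canonical 3` is OPEN. -/
theorem not_canonical_of_le_two {N : ℕ} (hN : N ≤ 2) : ¬ EG15Canonical N :=
  fun h => not_canonical_two (canonical_of_le hN h)


/-! ## rev 13 (g9 = planner-val-idea-15-g8-0, lens=finite, 2026-08-29): the b-FREE Pólya–Rolle reduction on chart (−,−,−) —
`EG15 ⟸ EG15CritLawP ∧ EG15L4Reduction ∧ EG15L4Law` (memo §7.12 (q)(13))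

On chart (−,−,−) put `T_l = −S_l` (all six entries positive); then `eg15Poly S = det (w wᵀ + Σ_l X^{e15 l} T_l) = A·C − B²` with the
POSYNOMIALS `A = 1 + a₃X¹⁴ + a₄X³⁰ + a₅X⁴⁸`, `B = X³ + b₃X¹⁴ + b₄X³⁰ + b₅X⁴⁸`, `C = X⁶ + c₃X¹⁴ + c₄X³⁰ + c₅X⁴⁸`
(`a_l = −(S l) 0 0`, `b_l = −(S l) 0 1`, `c_l = −(S l) 1 1`).  On `(0,∞)` the zeros of `g` with multiplicity are exactly those of the
real-analytic function `d = B − √(A·C)` (the cofactor `B + √(AC)` is positive), and the Euler operator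
`𝔏₄ = (𝒟 − 3)(𝒟 − 14)(𝒟 − 30)(𝒟 − 48)`, `𝒟 = X · d/dX`, ANNIHILATES `B` (its kernel on `(0,∞)` is spanned by `X³, X¹⁴, X³⁰, X⁴⁸`).
Each factor `𝒟 − β = X^{β+1} ∘ d/dX ∘ X^{−β}` costs at most one zero (Rolle with multiplicity), so
`Z₊(g) ≤ 4 + Z₊(𝔏₄ √(AC))`, and `(AC)^{7/2} · 𝔏₄ √(AC) = l4Form (A·C)` is the universal differential form typed below (a polynomial:
no square root survives; identity verified symbolically for an arbitrary smooth `X₀`, memo (q)(13)(b)).  Hence the b-FREE law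
`EG15L4Law` — «`Z₊(l4Form (A·C)) ≤ 9` for all positive `a, c`», SIX letters (five after the gauge `X ↦ λX`), NO `b`-letters — gives
the chart-(−,−,−) bound `Z₊(g) ≤ 13` (`eg15BoundM_of_l4`), and with the chart-(+,+,+) certificate the door (`eg15_of_l4`).
LOCATED (memo (q)(13)(c): ≈ 7 000 probed letter points with `|log₁₀|` up to 12, adaptive-precision sign counts, adversarial climbs, face
censuses): bulk counts `Z₊(l4Form (AC)) ∈ {1, 3, 5, 7}` (the parity is exact: lowest coefficient `−8436·c₃·X³²`, top coefficient
`+1458·a₅²c₅²(a₄c₅ − a₅c₄)²·X³⁴⁸`), counts 9 next to the faces `c₃ → 0` / `a₄c₅ − a₅c₄ → 0`, and an EXACT interior witness with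
`Z₊(l4Form (AC)) ≥ 9` (rational letters, rational sign chain; (q)(13)(c)) — so the law `≤ 9` below has NO slack; no count above 9 was located.  NOT PROVED and never asserted: `EG15L4Reduction` (paper-proved — four Rolle steps on `B − √(AC)`;
OPEN in Lean, real-analytic zero counting) and `EG15L4Law` (OPEN).  Kernel glue only: `eg15_of_chartBounds`, `eg15BoundP_of_critLawP`,
`eg15BoundM_of_l4`, `eg15_of_l4`.  `EG15`, DoorA26 (19979) and 18050 untouched. -/

/-- The Euler derivative `𝒟 p = X · p′`. -/
noncomputable def eulerD (p : ℝ[X]) : ℝ[X] := X * derivative p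

/-- The universal `𝔏₄`-form for the kernel exponents `(3, 14, 30, 48)`:
`(X₀)^{7/2} · (𝒟−3)(𝒟−14)(𝒟−30)(𝒟−48) √X₀ = 60480 X₀⁴ − 13878 X₀³X₁ + 1404 X₀³X₂ − (95/2) X₀³X₃ + ½ X₀³X₄ − 702 X₀²X₁²
+ (285/4) X₀²X₁X₂ − X₀²X₁X₃ − ¾ X₀²X₂² − (285/8) X₀X₁³ + (9/4) X₀X₁²X₂ − (15/16) X₁⁴`, `X_k = 𝒟^k X₀` (memo §7.12 (q)(13)(b)). -/
noncomputable def l4Form (X0 : ℝ[X]) : ℝ[X] :=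
  let X1 := eulerD X0
  let X2 := eulerD X1
  let X3 := eulerD X2
  let X4 := eulerD X3
  C 60480 * X0 ^ 4 - C 13878 * X0 ^ 3 * X1 + C 1404 * X0 ^ 3 * X2 - C (95 / 2) * X0 ^ 3 * X3 + C (1 / 2) * X0 ^ 3 * X4
    - C 702 * X0 ^ 2 * X1 ^ 2 + C (285 / 4) * X0 ^ 2 * X1 * X2 - X0 ^ 2 * X1 * X3 - C (3 / 4) * X0 ^ 2 * X2 ^ 2
    - C (285 / 8) * X0 * X1 ^ 3 + C (9 / 4) * X0 * X1 ^ 2 * X2 - C (15 / 16) * X1 ^ 4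

/-- Chart-(−,−,−) diagonal letters as posynomials: `A = 1 + a 0·X¹⁴ + a 1·X³⁰ + a 2·X⁴⁸`. -/
noncomputable def l4A (a : Fin 3 → ℝ) : ℝ[X] := 1 + C (a 0) * X ^ 14 + C (a 1) * X ^ 30 + C (a 2) * X ^ 48

/-- `C = X⁶ + c 0·X¹⁴ + c 1·X³⁰ + c 2·X⁴⁸`. -/
noncomputable def l4C (c : Fin 3 → ℝ) : ℝ[X] := X ^ 6 + C (c 0) * X ^ 14 + C (c 1) * X ^ 30 + C (c 2) * X ^ 48

/-- `P₄(a,c) = l4Form (A·C)` — the b-free polynomial whose positive zeros bound those of `g` on chart (−,−,−) (degree 348, lowest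
exponent 32). -/
noncomputable def l4Poly (a c : Fin 3 → ℝ) : ℝ[X] := l4Form (l4A a * l4C c)

-- OPEN law (hypothesis only; never asserted)
/-- **`EG15L4Law`** (the b-FREE 𝔏₄-law, memo §7.12 (q)(13)): for all positive `a, c`, `P₄(a,c)` has at most 9 positive zeros with
multiplicity.  What `EG15` needs on chart (−,−,−) is exactly this 9, and 9 is ATTAINED (exact interior witness, (q)(13)(c)): no slack.
No count above 9 located.  OPEN. -/
def EG15L4Law : Prop :=
  ∀ a c : Fin 3 → ℝ, (∀ i, 0 < a i) → (∀ i, 0 < c i) → posRootCard (l4Poly a c) ≤ 9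

-- paper-proved reduction (Rolle ×4 on `B − √(AC)`); OPEN in Lean, hypothesis only
/-- **`EG15L4Reduction`**: for far letters with all entries negative, `Z₊(eg15Poly S) ≤ Z₊(P₄(a,c)) + 4` with `a_l = −(S l) 0 0`,
`c_l = −(S l) 1 1` (Pólya–Rolle for the disconjugate Euler operator `𝔏₄` applied to `B − √(AC)`; memo (q)(13)(a)). -/
def EG15L4Reduction : Prop :=
  ∀ S : Fin 3 → Matrix (Fin 2) (Fin 2) ℝ, (∀ a, (S a).IsSymm) → (∀ a i j, S a i j < 0) →
    posRootCard (eg15Poly S) ≤ posRootCard (l4Poly (fun l => -(S l 0 0)) (fun l => -(S l 1 1))) + 4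

/-- The chart-(+,+,+) door bound as a proposition. -/
def EG15BoundP : Prop :=
  ∀ S : Fin 3 → Matrix (Fin 2) (Fin 2) ℝ, (∀ a, (S a).IsSymm) → EG15ChartP S → posRootCard (eg15Poly S) ≤ 13

/-- The chart-(−,−,−) door bound as a proposition. -/
def EG15BoundM : Prop :=
  ∀ S : Fin 3 → Matrix (Fin 2) (Fin 2) ℝ, (∀ a, (S a).IsSymm) → EG15ChartM S → posRootCard (eg15Poly S) ≤ 13

/-- **Kernel glue:** the two chart bounds give the door (kernel chart law + Descartes off the full-alternation charts). -/
theorem eg15_of_chartBounds (hP : EG15BoundP) (hM : EG15BoundM) : EG15 := by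
  intro S hS
  show posRootCard (eg15Poly S) ≤ 13
  by_cases h14 : 14 ≤ (eg15Poly S).signVariations
  · rcases eg15ChartLaw_holds S hS h14 with h | h
    · exact hP S hS h
    · exact hM S hS h
  · have h1 := posRootCard_le_signVariations (eg15Poly S)
    omega

/-- The chart-(+,+,+) certificate gives the chart-(+,+,+) bound (kernel bookkeeping `posRootCard_eg15Poly_le_chartP`). -/
theorem eg15BoundP_of_critLawP (h : EG15CritLawP) : EG15BoundP := by
  intro S hS hP
  have h1 := posRootCard_eg15Poly_le_chartP S hS hP
  have h2 := h S hS hP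
  omega

/-- **The b-free route on chart (−,−,−) (kernel glue):** `EG15L4Reduction ∧ EG15L4Law ⇒ EG15BoundM`. -/
theorem eg15BoundM_of_l4 (hR : EG15L4Reduction) (hL : EG15L4Law) : EG15BoundM := by
  intro S hS hM
  have hneg : ∀ a i j, S a i j < 0 := hM.1
  have ha : ∀ i, 0 < (fun l => -(S l 0 0)) i := fun i => by simpa using hneg i 0 0
  have hc : ∀ i, 0 < (fun l => -(S l 1 1)) i := fun i => by simpa using hneg i 1 1
  have h1 := hR S hS hneg
  have h2 := hL _ _ ha hc
  omega

/-- **`EG15 ⟸ EG15CritLawP ∧ EG15L4Reduction ∧ EG15L4Law`** (kernel glue; all three hypotheses OPEN in Lean, the middle one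
paper-proved). -/
theorem eg15_of_l4 (hΓP : EG15CritLawP) (hR : EG15L4Reduction) (hL : EG15L4Law) : EG15 :=
  eg15_of_chartBounds (eg15BoundP_of_critLawP hΓP) (eg15BoundM_of_l4 hR hL)

/-- Non-vacuity of the letter domain of `EG15L4Law` / `EG15L4Reduction`: the chart-(−,−,−) witness of rev 7 has all entries negative. -/
theorem eg15ChartM_witness_entries_neg :
    ∀ a i j, (![!![-1, -3; -3, -1], !![-1, -30; -30, -1], !![-10, -1; -1, -10]] : Fin 3 → Matrix (Fin 2) (Fin 2) ℝ) a i j < 0 :=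
  eg15ChartM_witness.1

/-! ## rev 14 (g9 = planner-val-idea-15-g8-0, lens=finite, 2026-08-29; memo §7.12 (q)(14)) — the SHARPENED b-free reduction: overhead 3, law `≤ 10`

Boundary gain in the Pólya–Rolle count.  On the letter domain (all entries negative) `d := √(AC) − B` vanishes at `y → 0⁺` to
order 11 (`d = ½c₃·y¹¹ − b₃·y¹⁴ + …`: the `y³` terms of `√(AC)` and `B` cancel; order 14 on the face `c₃ = 0`), strictly above
B's lowest exponent 3.  Hence in the first Rolle step `φ := y⁻³·d → 0` at `0⁺`, and `φ′` (equivalently `(𝒟 − 3)d`) has a zero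
in `(0, y₁)` in addition to one between each pair of consecutive zeros of `d` (with multiplicity bookkeeping): that step costs
nothing.  The three remaining steps (`β = 14, 30, 48 ≥ 11`) cost one each; no gain at `∞`.  So `Z₊(g) ≤ Z₊(P₄) + 3` (memo
(q)(14)(a); paper-proved, OPEN in Lean as `EG15L4Reduction3`), and the chart-(−,−,−) bound 13 follows from the WEAKER law
`Z₊(P₄) ≤ 10` (`EG15L4Law10`; in the bulk `Z₊(P₄)` is odd, so `≤ 10` is `≤ 9` there, but on the tie face `a₄c₅ = a₅c₄` the
parity is even and `10` is genuinely allowed; located maximum on that face 8 in 160 guarded counts + 4 adversarial climbs).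
Located census of record (memo (q)(14)(c)–(e), exact rational letters, parity-guarded counter): complete 67-face table, supremum
9 (bulk, `{a₄ = 0}`, `{c₄ = 0}`), no 10 or 11 in ≈ 11 400 guarded counts; tropical (fully resolved) supremum 5 (exact).  The memo
also records two SIBLING reductions with the same overhead 3 — `P_A := C⁵·𝔏_A(B²/C)` (a-free, `𝔏_A = 𝒟(𝒟−14)(𝒟−30)(𝒟−48)`) and
`P_C := A⁵·𝔏_C(B²/A)` (c-free, `𝔏_C = (𝒟−6)(𝒟−14)(𝒟−30)(𝒟−48)`) — not typed here.  Nothing below asserts any of the hypotheses;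
`EG15` stays OPEN. -/

/-- **`EG15L4Law10`** (memo (q)(14)(a)): for all positive `a, c`, `P₄(a,c)` has at most 10 positive zeros with multiplicity — what the
SHARPENED reduction needs on chart (−,−,−).  Located: supremum 9 (bulk, odd parity; exact witness in rev 13's docstring of
`EG15L4Law`), 8 on the even-parity tie face; no 10 or 11 located.  OPEN. -/
def EG15L4Law10 : Prop :=
  ∀ a c : Fin 3 → ℝ, (∀ i, 0 < a i) → (∀ i, 0 < c i) → posRootCard (l4Poly a c) ≤ 10

/-- **`EG15L4Reduction3`** (memo (q)(14)(a)): the b-free reduction with the boundary gain at `0⁺`: `Z₊(eg15Poly S) ≤ Z₊(P₄(a,c)) + 3`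
on the negative-entry letter domain.  Paper-proved; OPEN in Lean, hypothesis only. -/
def EG15L4Reduction3 : Prop :=
  ∀ S : Fin 3 → Matrix (Fin 2) (Fin 2) ℝ, (∀ a, (S a).IsSymm) → (∀ a i j, S a i j < 0) →
    posRootCard (eg15Poly S) ≤ posRootCard (l4Poly (fun l => -(S l 0 0)) (fun l => -(S l 1 1))) + 3

/-- The law `≤ 9` implies the law `≤ 10` (kernel, monotonicity). -/
theorem eg15L4Law10_of_l4Law (h : EG15L4Law) : EG15L4Law10 :=
  fun a c ha hc => (h a c ha hc).trans (by norm_num)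

/-- The sharpened reduction implies the rev-13 reduction (kernel, monotonicity). -/
theorem eg15L4Reduction_of_reduction3 (h : EG15L4Reduction3) : EG15L4Reduction :=
  fun S hS hneg => (h S hS hneg).trans (by omega)

/-- **Sharpened b-free route on chart (−,−,−) (kernel glue):** `EG15L4Reduction3 ∧ EG15L4Law10 ⇒ EG15BoundM`. -/
theorem eg15BoundM_of_l4sharp (hR : EG15L4Reduction3) (hL : EG15L4Law10) : EG15BoundM := by
  intro S hS hM
  have hneg : ∀ a i j, S a i j < 0 := hM.1
  have ha : ∀ i, 0 < (fun l => -(S l 0 0)) i := fun i => by simpa using hneg i 0 0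
  have hc : ∀ i, 0 < (fun l => -(S l 1 1)) i := fun i => by simpa using hneg i 1 1
  have h1 := hR S hS hneg
  have h2 := hL _ _ ha hc
  omega

/-- **`EG15 ⟸ EG15CritLawP ∧ EG15L4Reduction3 ∧ EG15L4Law10`** (kernel glue; hypotheses OPEN in Lean, the middle one paper-proved;
the last one is WEAKER than rev 13's `EG15L4Law`). -/
theorem eg15_of_l4sharp (hΓP : EG15CritLawP) (hR : EG15L4Reduction3) (hL : EG15L4Law10) : EG15 :=
  eg15_of_chartBounds (eg15BoundP_of_critLawP hΓP) (eg15BoundM_of_l4sharp hR hL)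

end Summit.ValiantsHypothesis.ValiantsHypothesis.Cruxes.DoorA26.WallBubbling.EndDoor
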